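import Mathlib
import Literature.NumberTheory.Automorphic.HigherGreenFunctionProofs

/-!
# Higher Green functions, layer 0 (continued): Legendre's equation, the Laplacian, `q`-expansions

Second proved companion file of `Literature/NumberTheory/Automorphic/HigherGreenFunction.lean`
(the Gross–Zagier algebraicity conjecture `GKZAlgebraicity`, Bruinier–Li–Yang 2025, Conjecture 1.1 /
Theorem 1.4), continuing `HigherGreenFunctionProofs.lean` (layer 0 of Gross–Zagier 1986, §II.2),
which has reached the gate's file-size limit. Two groups of results: (A) Heine's integral solves
Legendre's equation and the kernel of `G_s` is a Laplace eigenfunction; (B) the Fourier coefficients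
in `IsRatWeaklyHolomorphicForm` are determined by the form. (CM points of given discriminant are
exhibited in `HigherGreenFunctionCM.lean`.)

## (A) Legendre's equation and the Laplacian

The kernel of the higher Green function `G_s(z₁, z₂) = -2 Q_{s-1}(cosh d(z₁, z₂))` of (1.1) is
Heine's integral `Q_{s-1}(t) = greenQ s t = ∫₀^∞ (t + √(t²-1) cosh u)^{-s} du`. This file proves that
it is the Legendre function of the second kind of degree `s - 1` in the differential-equation sense,
which is the radial content of the defining property `Δ G_s = s(s-1) G_s` of the higher Green
functions (Gross–Zagier 1986, §II.2, property (b)): for an integer `s ≥ 1` and `t > 1`,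

* `hasDerivAt_greenQ`, `deriv_greenQ`: `Q_{s-1}` is differentiable with
  `Q_{s-1}'(t) = s (Q_s(t) - t Q_{s-1}(t)) / (t² - 1)` — the recurrence
  `(1 - t²) Q_ν' = (ν+1)(t Q_ν - Q_{ν+1})`, `ν = s - 1` — by differentiation under the integral sign
  (`hasDerivAt_integral_of_dominated_loc_of_deriv_le`; the `t`-derivative of the integrand,
  `hasDerivAt_greenQ_integrand`, is `(s/(t²-1))(A^{-(s+1)} - t A^{-s})`, `A = t + √(t²-1) cosh u`,
  dominated by `C e^{-su}` locally uniformly in `t`);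
* `greenQ_three_term`: Bonnet's recursion `(s+1) Q_{s+1} - (2s+1) t Q_s + s Q_{s-1} = 0`, because
  `d/du [√(t²-1) sinh u · A^{-(s+1)}] = -s A^{-s} + (2s+1) t A^{-(s+1)} - (s+1) A^{-(s+2)}` integrates
  to `0` over `(0, ∞)` (`integral_Ioi_of_hasDerivAt_of_tendsto`);
* `hasDerivAt_deriv_greenQ`, `greenQ_legendre_ode` (`'` with `iteratedDeriv`): consequently
  `(1 - t²) Q_{s-1}'' - 2t Q_{s-1}' + (s-1)s Q_{s-1} = 0`, **Legendre's differential equation** of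
  degree `ν = s - 1`;
* `contDiffOn_greenQ`: `Q_{s-1}` is `C^∞` on `(1, ∞)` (induction on the order using the recurrence for
  the derivative); `deriv_greenQ_neg`, `strictAntiOn_greenQ`: `Q_{s-1}' < 0`, so `Q_{s-1}` is strictly
  decreasing (`Q_s ≤ Q_{s-1}/t < t Q_{s-1}`, `greenQ_succ_le_div`).

* `hyperbolicLaplacian_greenQ_coshDistArg`, `hyperbolicLaplacian_greenQ_cosh_dist`: **the kernel
  `k(z) = Q_{s-1}(cosh d(z₁, z))` of `G_s` is an eigenfunction of the hyperbolic Laplacian**,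
  `(Im z)² (∂ᵤ² + ∂ᵥ²) k = s(s-1) k` for `z = u + iv ≠ z₁` (Gross–Zagier 1986, §II.2, property (b) of
  `G_s`, termwise): the chain rule `v² Δ_E (Q ∘ t) = Q''(t) v²|∇t|² + Q'(t) v² Δ_E t` for
  `t(u, v) = ((x₁-u)² + y₁² + v²)/(2 y₁ v) = cosh d(z₁, z)` with `v²|∇t|² = t² - 1`, `v² Δ_E t = 2t`,
  and Legendre's equation; second partials are the iterated derivatives of the coordinate slices
  (`hasDerivAt_deriv_comp`, `hasDerivAt_coshDistArg_re`/`_im`/`_im_deriv`).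

Together with `greenQ_le` (`Q_{s-1}(t) = O(t^{-s})` at `+∞`) and the logarithmic singularity at
`t → 1⁺` (`tendsto_greenQ_nhdsGT_one`) of `HigherGreenFunctionProofs.lean`, this identifies `greenQ s`
with the classical `Q_{s-1}` (the recessive solution of Legendre's equation at `+∞`) up to the
normalising constant fixed by Heine's integral itself.

* `greenQ_one_eq`, `greenQ_two_eq`: the closed forms `Q_0(t) = ½ log((t+1)/(t-1))` (an explicit
  antiderivative of Heine's integrand for `s = 1`) and `Q_1(t) = t Q_0(t) - 1` (from the recurrence
  for `Q_0'`); `exists_abs_greenQ_add_half_log_le`: **the sharp logarithmic singularity**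
  `|Q_{s-1}(t) + ½ log(t-1)| ≤ C_s` on `(1, 2]`, by Bonnet's recursion from the two closed forms —
  each diagonal term `-2Q_{k-1}(cosh d(z, z'))` of `G_k` is `log|z - z'|² + O(1)` (Gross–Zagier 1986,
  §II.2, property (b)).

## (B) Uniqueness of `q`-expansions

* `fourierCoeff_eq_zero_of_hasSum_zero`: a `q`-expansion `Σ_{m ∈ ℤ} d(m) e^{2πimz}` with support
  bounded below that sums to `0` on `ℍ` has `d = 0` (at the least `m₀` in the support,
  `d(m₀) = -Σ_{m > m₀} d(m) e^{-2π(m-m₀)y} = O(e^{-2πy})` at `z = iy`, `y → ∞`); hence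
  `IsRatWeaklyHolomorphicForm.coeff_unique`: **the coefficient function `c` of
  `IsRatWeaklyHolomorphicForm N k f c` is determined by `f`**, so `G_{r+1,f} = principalHigherGreen N r c`
  ((1.3)) and `Z_f` in `GKZAlgebraicity` depend only on `f` (`.principalHigherGreen_eq`).

* `IsRatWeaklyHolomorphicForm.eq_zero_of_levelOne`, `.eq_of_principalPart_eq_levelOne`: **in
  level one and negative weight the principal part determines the form** — a rational
  `f ∈ M^{!,∞}_k(SL(2, ℤ))`, `k < 0`, without principal part is bounded at the only cusp, hence a
  level-one modular form of negative weight, hence `0` (`ModularFormClass.levelOne_neg_weight_eq_zero`);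
  so for `N = 1` the datum `f` of `GKZAlgebraicity` is equivalent to its principal part
  `{c(-m)}_{m ≥ 1}` (`isBoundedAtImInfty_of_hasSum_fourier`, `mem_Gamma0_one`, `.sub`).

* `exists_isRatWeaklyHolomorphicForm_discriminant_inv`: **the hypothesis class is inhabited
  with a genuine pole** — `1/Δ = q⁻¹ + 24 + ⋯ ∈ M^{!,∞}_{-12}(SL(2, ℤ))` with rational
  coefficients and principal part `q⁻¹` (the `q`-expansion of `q/Δ` is the inverse in `ℚ⟦X⟧` of
  that of `Δ/q`, which is rational by `Δ = (E₄³ - E₆²)/1728` and Mathlib's `q`-expansions of `E_k`: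
  `exists_ratPowerSeries_E`, `exists_ratPowerSeries_discriminant`, `qExpansion_qParam`,
  `qExpansion_qParam_div_discriminant_mul`, `exists_ratPowerSeries_qParam_div_discriminant`); hence
  `GKZAlgebraicity.higherGreen_seven_levelOne`: **under the named fact, the CM values of the
  level-one `G₇` off the diagonal are `|d₁d₂|⁻³ log|α|`, `α ∈ ℚ̄ˣ`** (`r = 6`, `f = 1/Δ`,
  `G_{7,f} = G₇^{(1)}`, `Z_f = T₁`; the cusp-form-free weight `14`); more generally
  `exists_isRatWeaklyHolomorphicForm_div_discriminant`: `g/Δ ∈ M^{!,∞}_{k-12}(SL(2, ℤ))` with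
  rational coefficients and principal part `g(i∞) q⁻¹` for every level-one `g` of weight `k` with
  rational `q`-expansion, whence `GKZAlgebraicity.higherGreen_two_levelOne` (`g = E₁₀`, `r = 1`):
  **the fact contains the original Gross–Zagier conjecture** `G₂(z₁, z₂) = |d₁d₂|^{-1/2} log|α|` for
  non-equivalent CM points (Gross–Zagier 1986, §V.4; level `1`, `S₄ = 0`), and likewise
  `G₃, G₄, G₅` (`GKZAlgebraicity.higherGreen_levelOne_of_E` with `E₈, E₆, E₄`: all level-one
  cusp-form-free weights `4, 6, 8, 10, 14`).

* `exists_isRatWeaklyHolomorphicForm_div_discriminant_pow`: more generally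
  `g/Δⁿ ∈ M^{!,∞}_{k-12n}(SL(2, ℤ))` with rational coefficients and principal part of order `n`
  (`c(-n) = g(i∞)`) for every `n ≥ 0` (`(q/Δ)ⁿ`: `mdifferentiable_`/`periodic_`/
  `isBoundedAtImInfty_`/`qExpansion_qParam_div_discriminant_pow`); hence
  `exists_isRatWeaklyHolomorphicForm_levelOne`: **for every `r ≥ 1` the hypothesis class of
  `GKZAlgebraicity` in weight `-2r` contains a level-one form with a pole of exact order `n ≥ 1`**
  (`E_k/Δⁿ`, `r = 6j + i`: `(k, n) = (12 - 2i, j + 1)` for `i ≤ 4`, `(14, j + 2)` for `i = 5`),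
  so the named fact is non-vacuous, with non-empty `Z_f`, in every weight
  (`exists_isRatWeaklyHolomorphicForm_coeff_ne_zero`).

* `exists_isRatWeaklyHolomorphicForm_primeLevel`: **beyond level one — for every prime `p`,
  `Δ(z)/Δ(pz)² ∈ M^{!,∞}_{-12}(Γ₀(p))` with rational coefficients and principal part
  `q^{1-2p} + ⋯` of exact order `2p - 1`.** Ingredients: `Δ(p·γz) = (cz + d)¹² Δ(pz)` for
  `γ ∈ Γ₀(p)` (`discriminant_levelScale_smul_gamma0`, via `diag(p,1)γ = γ' diag(p,1)`); composition
  with `z ↦ mz` preserves holomorphy, periodicity, boundedness and acts on `q`-expansions by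
  `X ↦ Xᵐ` (`mdifferentiable_`/`periodic_`/`isBoundedAtImInfty_`/`qExpansion_comp_levelScale_smul`),
  so `f = q^{-2p} · Δ(z) · (q/Δ)(pz)²` has rational coefficients; at the other cusp, Bézout
  brings `diag(p,1)γ` (`p ∤ c`) to the form `g (1 B; 0 p)`, `g ∈ SL(2, ℤ)`
  (`exists_levelScale_mul_eq_mul_upper`), whence `(f ∣₋₁₂ γ)(z) = p²⁴ Δ(z)/Δ((z + B)/p)²`
  (`exists_slash_discriminant_div_sq_eq`), which is bounded as `Im z → ∞` because
  `Δ/q → 1` (`isBoundedAtImInfty_discriminant_div_sq`; order `p - 2 ≥ 0` at the cusp `0`).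
* `IsRatWeaklyHolomorphicForm.mul`, `.pow`, `isRatWeaklyHolomorphicForm_one`: **the classes
  `M^{!,∞}_k(Γ₀(N))` with rational coefficients multiply** (Cauchy product of the absolutely
  convergent `q`-series after shifting to `ℕ`, `ModularForm.mul_slash_SL2`), with the expected
  leading principal coefficient; `.of_levelOne`: a pole-free rational form of level one (e.g.
  `E_k`, `exists_isRatWeaklyHolomorphicForm_E`) belongs to the class at every level; hence
  `exists_isRatWeaklyHolomorphicForm_primeLevel_weight`: **for `p` prime and every `r` there is a
  rational `f = E_k · (Δ(z)/Δ(pz)²)^{n₀} ∈ M^{!,∞}_{-2r}(Γ₀(p))` with a pole of exact order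
  `n₀(2p - 1) ≥ 1`** — `GKZAlgebraicity` is non-vacuous with a genuine pole in every weight at
  every prime level.
* `IsRatWeaklyHolomorphicForm.hecke`: **the Hecke operators `T_p` (`p ∤ N` prime) preserve the
  class**: `T_p f = ∑_{i ∈ I_p(N)} f ∣ₖ βᵢ = p^{k-1} f(pz) + p⁻¹ ∑_{j mod p} f((z+j)/p)` is again a
  rational form of `M^{!,∞}_k(Γ₀(N))`, with coefficients `c(pn) + p^{k-1} c(n/p)` — weight-`k`
  invariance by the independence of the transversal of `Γ₀(N) \ Δ₀ᴺ(p)` (the tree's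
  `sum_slash_eq_sum_slash_of_transversal`, `existsUnique_mem_delta0_mul_heckeRep`, Diamond–Shurman
  Prop. 5.2.1), holomorphy away from `∞` because `βᵢσ = γ (a b; 0 d)` with `γ ∉ Γ₀(N)` whenever
  `σ ∉ Γ₀(N)` (`gcd(p, N) = 1`), the coefficients by the orthogonality of the characters of `ℤ/pℤ`
  (`hasSum_sum_slash_tpB`, `hasSum_slash_tpD`, `sum_ζp_zpow`).

## References

* J. H. Bruinier, Y. Li, T. Yang, *Deformations of theta integrals and a conjecture of
  Gross–Zagier*, Forum Math. Sigma 13 (2025), arXiv:2204.10604, (1.1). [`BruinierLiYang2025`]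
* B. Gross, D. Zagier, *Heegner points and derivatives of L-series*, Invent. Math. 84 (1986),
  §II.2 (properties (a)–(d) of `G_{N,s}`, Legendre functions of the second kind). [`GrossZagier1986`]
-/

noncomputable section

namespace Literature.NumberTheory.Automorphic

open Real Set Filter
open _root_.MeasureTheory
open scoped Real _root_.Topology ContDiff UpperHalfPlane

/-! ## Legendre's differential equation: `Q_{s-1}` is smooth on `(1, ∞)`, strictly decreasing, and
solves `(1 - t²) y'' - 2t y' + s(s-1) y = 0` -/

/-- `d/dt √(t² - 1) = t / √(t² - 1)` for `t > 1`. [folklore] -/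
theorem hasDerivAt_sqrt_sq_sub_one {t : ℝ} (ht : 1 < t) :
    HasDerivAt (fun t : ℝ => √(t ^ 2 - 1)) (t / √(t ^ 2 - 1)) t := by
  have h1 : HasDerivAt (fun t : ℝ => t ^ 2 - 1) (2 * t) t := by
    simpa using (hasDerivAt_pow 2 t).sub_const 1
  have h2 : t ^ 2 - 1 ≠ 0 := by nlinarith
  refine (h1.sqrt h2).congr_deriv ?_
  rw [mul_div_mul_left t (√(t ^ 2 - 1)) two_ne_zero]

/-- The chain rule for Heine's integrand in the parameter `t > 1`:
`∂/∂t (t + √(t²-1) cosh u)^{-s} = -s (1 + t cosh u / √(t²-1)) (t + √(t²-1) cosh u)^{-(s+1)}`.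
[folklore] -/
theorem hasDerivAt_greenQ_integrand_aux {t : ℝ} (ht : 1 < t) (s : ℕ) (u : ℝ) :
    HasDerivAt (fun t : ℝ => ((t + √(t ^ 2 - 1) * Real.cosh u) ^ s)⁻¹)
      (-(s : ℝ) * (1 + t / √(t ^ 2 - 1) * Real.cosh u) *
        ((t + √(t ^ 2 - 1) * Real.cosh u) ^ (s + 1))⁻¹) t := by
  have hA0 : 0 < t + √(t ^ 2 - 1) * Real.cosh u := greenQ_base_pos (by linarith) u
  have hA : HasDerivAt (fun t : ℝ => t + √(t ^ 2 - 1) * Real.cosh u)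
      (1 + t / √(t ^ 2 - 1) * Real.cosh u) t :=
    (hasDerivAt_id t).add ((hasDerivAt_sqrt_sq_sub_one ht).mul_const _)
  refine ((hA.fun_pow s).fun_inv (pow_ne_zero s hA0.ne')).congr_deriv ?_
  rcases Nat.eq_zero_or_pos s with rfl | hs
  · simp
  · obtain ⟨k, rfl⟩ := Nat.exists_eq_add_one_of_ne_zero hs.ne'
    simp only [Nat.add_sub_cancel, Nat.cast_add, Nat.cast_one]
    field_simp
    ring

/-- The `t`-derivative of Heine's integrand, rewritten without the square root in the numerator:
`∂/∂t (t + √(t²-1) cosh u)^{-s} = (s/(t²-1)) ((t + …)^{-(s+1)} - t (t + …)^{-s})` (`t > 1`), using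
`√(t²-1) cosh u = (t + √(t²-1) cosh u) - t` and `√(t²-1)² = t² - 1`. [folklore] -/
theorem hasDerivAt_greenQ_integrand {t : ℝ} (ht : 1 < t) (s : ℕ) (u : ℝ) :
    HasDerivAt (fun t : ℝ => ((t + √(t ^ 2 - 1) * Real.cosh u) ^ s)⁻¹)
      ((s : ℝ) / (t ^ 2 - 1) * (((t + √(t ^ 2 - 1) * Real.cosh u) ^ (s + 1))⁻¹ -
        t * ((t + √(t ^ 2 - 1) * Real.cosh u) ^ s)⁻¹)) t := by
  have he0 : 0 < √(t ^ 2 - 1) := Real.sqrt_pos.mpr (by nlinarith)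
  have he2 : √(t ^ 2 - 1) ^ 2 = t ^ 2 - 1 := Real.sq_sqrt (by nlinarith)
  have hA0 : 0 < t + √(t ^ 2 - 1) * Real.cosh u := greenQ_base_pos (by linarith) u
  refine (hasDerivAt_greenQ_integrand_aux ht s u).congr_deriv ?_
  set e : ℝ := √(t ^ 2 - 1) with he
  have ht2 : t ^ 2 - 1 = e ^ 2 := he2.symm
  rw [ht2, pow_succ]
  field_simp
  linear_combination -(s : ℝ) * he2

/-- The exponent lowers the integrand: `(t + √(t²-1) cosh u)^{-(s+1)} ≤ (t + √(t²-1) cosh u)^{-s}`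
for `t ≥ 1` (the base is `≥ t ≥ 1`). [folklore] -/
theorem greenQ_integrand_succ_le {t : ℝ} (ht : 1 ≤ t) (s : ℕ) (u : ℝ) :
    ((t + √(t ^ 2 - 1) * Real.cosh u) ^ (s + 1))⁻¹ ≤ ((t + √(t ^ 2 - 1) * Real.cosh u) ^ s)⁻¹ := by
  have h0 : 0 ≤ √(t ^ 2 - 1) * Real.cosh u := mul_nonneg (Real.sqrt_nonneg _) (Real.cosh_pos u).le
  have h1 : 1 ≤ t + √(t ^ 2 - 1) * Real.cosh u := by linarith
  exact inv_anti₀ (pow_pos (by linarith) s) (pow_le_pow_right₀ h1 (Nat.le_succ s))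

/-- Heine's integrand decreases in the parameter: for `0 < t₁ ≤ t`,
`(t + √(t²-1) cosh u)^{-s} ≤ (t₁ + √(t₁²-1) cosh u)^{-s}`. [folklore] -/
theorem greenQ_integrand_anti {t₁ t : ℝ} (ht₁ : 0 < t₁) (h : t₁ ≤ t) (s : ℕ) (u : ℝ) :
    ((t + √(t ^ 2 - 1) * Real.cosh u) ^ s)⁻¹ ≤ ((t₁ + √(t₁ ^ 2 - 1) * Real.cosh u) ^ s)⁻¹ := by
  have hb1 : 0 < t₁ + √(t₁ ^ 2 - 1) * Real.cosh u := greenQ_base_pos ht₁ u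
  have hmono : t₁ + √(t₁ ^ 2 - 1) * Real.cosh u ≤ t + √(t ^ 2 - 1) * Real.cosh u :=
    add_le_add h (mul_le_mul_of_nonneg_right (Real.sqrt_le_sqrt (by nlinarith))
      (Real.cosh_pos u).le)
  exact inv_anti₀ (pow_pos hb1 s) (pow_le_pow_left₀ hb1.le hmono s)

/-- **The derivative of `Q_{s-1}`.** For `t₀ > 1` and `s ≥ 1`, `t ↦ Q_{s-1}(t) = greenQ s t` is
differentiable at `t₀` with `Q_{s-1}'(t₀) = s (Q_s(t₀) - t₀ Q_{s-1}(t₀)) / (t₀² - 1)` — the classical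
recurrence `(1 - t²) Q_ν'(t) = (ν + 1)(t Q_ν(t) - Q_{ν+1}(t))`, `ν = s - 1` — by differentiating Heine's
integral (1.1) under the integral sign (the `t`-derivative of the integrand is dominated by
`C e^{-su}` for `t` near `t₀`, `hasDerivAt_greenQ_integrand`). [folklore] -/
theorem hasDerivAt_greenQ {t₀ : ℝ} (ht₀ : 1 < t₀) {s : ℕ} (hs : 1 ≤ s) :
    HasDerivAt (greenQ s) ((s : ℝ) * (greenQ (s + 1) t₀ - t₀ * greenQ s t₀) / (t₀ ^ 2 - 1)) t₀ := by
  set t₁ : ℝ := (1 + t₀) / 2 with ht₁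
  set t₂ : ℝ := t₀ + 1 with ht₂
  have ht₁1 : 1 < t₁ := by rw [ht₁]; linarith
  have ht₁0 : t₁ < t₀ := by rw [ht₁]; linarith
  have ht₀2 : t₀ < t₂ := by rw [ht₂]; linarith
  have hs' : -(s : ℝ) < 0 := by
    have : (1 : ℝ) ≤ s := by exact_mod_cast hs
    linarith
  have hden₁ : 0 < t₁ ^ 2 - 1 := by nlinarith
  have hS : Ioo t₁ t₂ ∈ 𝓝 t₀ := Ioo_mem_nhds ht₁0 ht₀2
  set C : ℝ := (s : ℝ) / (t₁ ^ 2 - 1) * (1 + t₂) * (2 / √(t₁ ^ 2 - 1)) ^ s with hC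
  have key := hasDerivAt_integral_of_dominated_loc_of_deriv_le
    (μ := volume.restrict (Ioi (0 : ℝ))) (x₀ := t₀)
    (F := fun t u => ((t + √(t ^ 2 - 1) * Real.cosh u) ^ s)⁻¹)
    (F' := fun t u => (s : ℝ) / (t ^ 2 - 1) * (((t + √(t ^ 2 - 1) * Real.cosh u) ^ (s + 1))⁻¹ -
        t * ((t + √(t ^ 2 - 1) * Real.cosh u) ^ s)⁻¹))
    (bound := fun u => C * Real.exp (-(s : ℝ) * u)) hS ?_ ?_ ?_ ?_ ?_ ?_
  · -- identify the derivative of the integral with the three-`Q` expression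
    have hI : HasDerivAt (greenQ s) (∫ u in Ioi (0 : ℝ), (s : ℝ) / (t₀ ^ 2 - 1) *
        (((t₀ + √(t₀ ^ 2 - 1) * Real.cosh u) ^ (s + 1))⁻¹ -
          t₀ * ((t₀ + √(t₀ ^ 2 - 1) * Real.cosh u) ^ s)⁻¹)) t₀ := key.2
    refine hI.congr_deriv ?_
    rw [integral_const_mul, integral_sub (integrableOn_greenQ_integrand ht₀ (by omega))
      ((integrableOn_greenQ_integrand ht₀ hs).const_mul t₀), integral_const_mul]
    rw [greenQ, greenQ]
    ring
  · filter_upwards [hS] with t ht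
    exact (continuous_greenQ_integrand (by linarith [ht.1]) s).aestronglyMeasurable
  · exact integrableOn_greenQ_integrand ht₀ hs
  · refine Continuous.aestronglyMeasurable ?_
    exact continuous_const.mul ((continuous_greenQ_integrand (by linarith) (s + 1)).sub
      (continuous_const.mul (continuous_greenQ_integrand (by linarith) s)))
  · refine ae_of_all _ fun u t ht => ?_
    have ht1 : 1 < t := ht₁1.trans ht.1
    have hA0 : 0 < t + √(t ^ 2 - 1) * Real.cosh u := greenQ_base_pos (by linarith) u
    have hden : 0 < t ^ 2 - 1 := by nlinarith
    have hFs : 0 < ((t + √(t ^ 2 - 1) * Real.cosh u) ^ s)⁻¹ := inv_pos.mpr (pow_pos hA0 s)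
    have hFs1 : 0 < ((t + √(t ^ 2 - 1) * Real.cosh u) ^ (s + 1))⁻¹ := inv_pos.mpr (pow_pos hA0 _)
    have h1 : |((t + √(t ^ 2 - 1) * Real.cosh u) ^ (s + 1))⁻¹ -
        t * ((t + √(t ^ 2 - 1) * Real.cosh u) ^ s)⁻¹| ≤
        (1 + t) * ((t + √(t ^ 2 - 1) * Real.cosh u) ^ s)⁻¹ := by
      refine (abs_sub _ _).trans ?_
      rw [abs_of_pos hFs1, abs_of_pos (mul_pos (by linarith) hFs), one_add_mul]
      exact add_le_add (greenQ_integrand_succ_le ht1.le s u) le_rfl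
    have h2 : ((t + √(t ^ 2 - 1) * Real.cosh u) ^ s)⁻¹ ≤
        (2 / √(t₁ ^ 2 - 1)) ^ s * Real.exp (-(s : ℝ) * u) :=
      (greenQ_integrand_anti (by linarith) ht.1.le s u).trans (greenQ_integrand_le ht₁1 s u)
    have h3 : (s : ℝ) / (t ^ 2 - 1) ≤ (s : ℝ) / (t₁ ^ 2 - 1) :=
      div_le_div_of_nonneg_left (Nat.cast_nonneg s) hden₁ (by nlinarith [ht.1])
    rw [norm_mul, Real.norm_of_nonneg (div_nonneg (Nat.cast_nonneg s) hden.le), Real.norm_eq_abs]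
    calc (s : ℝ) / (t ^ 2 - 1) * |((t + √(t ^ 2 - 1) * Real.cosh u) ^ (s + 1))⁻¹ -
          t * ((t + √(t ^ 2 - 1) * Real.cosh u) ^ s)⁻¹|
        ≤ (s : ℝ) / (t₁ ^ 2 - 1) *
            ((1 + t₂) * ((2 / √(t₁ ^ 2 - 1)) ^ s * Real.exp (-(s : ℝ) * u))) := by
          refine mul_le_mul h3 (h1.trans ?_) (abs_nonneg _)
            (div_nonneg (Nat.cast_nonneg s) hden₁.le)
          exact mul_le_mul (by linarith [ht.2]) h2 hFs.le (by linarith [ht.1])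
      _ = C * Real.exp (-(s : ℝ) * u) := by rw [hC]; ring
  · exact (integrableOn_exp_mul_Ioi hs' 0).const_mul C
  · exact ae_of_all _ fun u t ht => hasDerivAt_greenQ_integrand (ht₁1.trans ht.1) s u

/-- `Q_{s-1}'(t) = s (Q_s(t) - t Q_{s-1}(t)) / (t² - 1)` for `t > 1`, `s ≥ 1`. [folklore] -/
theorem deriv_greenQ {t : ℝ} (ht : 1 < t) {s : ℕ} (hs : 1 ≤ s) :
    deriv (greenQ s) t = (s : ℝ) * (greenQ (s + 1) t - t * greenQ s t) / (t ^ 2 - 1) :=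
  (hasDerivAt_greenQ ht hs).deriv

/-- `Q_{s-1}` is differentiable on `(1, ∞)` (`s ≥ 1`). [folklore] -/
theorem differentiableOn_greenQ {s : ℕ} (hs : 1 ≤ s) : DifferentiableOn ℝ (greenQ s) (Ioi 1) :=
  fun _ ht => (hasDerivAt_greenQ ht hs).differentiableAt.differentiableWithinAt

/-- `Q_s(t) ≤ Q_{s-1}(t) / t` for `t > 1` (the base of Heine's integrand is `≥ t`). [folklore] -/
theorem greenQ_succ_le_div {t : ℝ} (ht : 1 < t) {s : ℕ} (hs : 1 ≤ s) :
    greenQ (s + 1) t ≤ greenQ s t / t := by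
  rw [greenQ, greenQ, div_eq_mul_inv, ← integral_mul_const]
  refine setIntegral_mono_on (integrableOn_greenQ_integrand ht (by omega))
    ((integrableOn_greenQ_integrand ht hs).mul_const _) measurableSet_Ioi fun u _ => ?_
  have hA0 := greenQ_base_pos (by linarith : (0 : ℝ) < t) u
  have hAt : t ≤ t + √(t ^ 2 - 1) * Real.cosh u := by
    have : 0 ≤ √(t ^ 2 - 1) * Real.cosh u := mul_nonneg (Real.sqrt_nonneg _) (Real.cosh_pos u).le
    linarith
  rw [pow_succ, mul_inv]
  exact mul_le_mul_of_nonneg_left ((inv_le_inv₀ hA0 (by linarith)).mpr hAt)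
    (inv_pos.mpr (pow_pos hA0 s)).le

/-- **`Q_{s-1}` is strictly decreasing**: `Q_{s-1}'(t) < 0` for `t > 1` (`s ≥ 1`), since
`Q_s(t) ≤ Q_{s-1}(t)/t < t Q_{s-1}(t)`. [folklore] -/
theorem deriv_greenQ_neg {t : ℝ} (ht : 1 < t) {s : ℕ} (hs : 1 ≤ s) : deriv (greenQ s) t < 0 := by
  rw [deriv_greenQ ht hs]
  have hQ := greenQ_pos ht hs
  have h1 := greenQ_succ_le_div ht hs
  have hden : 0 < t ^ 2 - 1 := by nlinarith
  have hs0 : (0 : ℝ) < s := by exact_mod_cast hs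
  have h2 : greenQ s t / t < t * greenQ s t := by
    rw [div_lt_iff₀ (by linarith)]
    nlinarith
  exact div_neg_of_neg_of_pos (mul_neg_of_pos_of_neg hs0 (by linarith)) hden

/-- `Q_{s-1}` is strictly decreasing on `(1, ∞)` (`s ≥ 1`). [folklore] -/
theorem strictAntiOn_greenQ {s : ℕ} (hs : 1 ≤ s) : StrictAntiOn (greenQ s) (Ioi 1) :=
  strictAntiOn_of_deriv_neg (convex_Ioi 1) (continuousOn_greenQ hs) fun t ht => by
    rw [interior_Ioi] at ht
    exact deriv_greenQ_neg ht hs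

/-- **The three-term recurrence** `(s+1) Q_{s+1}(t) - (2s+1) t Q_s(t) + s Q_{s-1}(t) = 0` for `t > 1`,
`s ≥ 1` — Bonnet's recursion `(ν+1) Q_{ν+1} - (2ν+1) t Q_ν + ν Q_{ν-1} = 0` of the Legendre functions,
`ν = s` — for Heine's integral: with `e = √(t²-1)` and `A = t + e cosh u`,
`d/du [e sinh u · A^{-(s+1)}] = -s A^{-s} + (2s+1) t A^{-(s+1)} - (s+1) A^{-(s+2)}` (using
`e² sinh² u = (A - t)² - e² = A² - 2tA + 1`), whose integral over `(0, ∞)` vanishes because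
`e sinh u A^{-(s+1)}` vanishes at `u = 0` and tends to `0` at `∞`. [folklore] -/
theorem greenQ_three_term {t : ℝ} (ht : 1 < t) {s : ℕ} (hs : 1 ≤ s) :
    ((s : ℝ) + 1) * greenQ (s + 2) t - (2 * s + 1) * t * greenQ (s + 1) t + s * greenQ s t = 0 := by
  have he0 : 0 < √(t ^ 2 - 1) := Real.sqrt_pos.mpr (by nlinarith)
  have he2 : √(t ^ 2 - 1) ^ 2 = t ^ 2 - 1 := Real.sq_sqrt (by nlinarith)
  have hA0 : ∀ u, 0 < t + √(t ^ 2 - 1) * Real.cosh u := fun u => greenQ_base_pos (by linarith) u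
  have hs1 : -(s : ℝ) < 0 := by
    have : (1 : ℝ) ≤ s := by exact_mod_cast hs
    linarith
  set g : ℝ → ℝ := fun u => √(t ^ 2 - 1) * Real.sinh u *
    ((t + √(t ^ 2 - 1) * Real.cosh u) ^ (s + 1))⁻¹ with hg
  set g' : ℝ → ℝ := fun u => -(s : ℝ) * ((t + √(t ^ 2 - 1) * Real.cosh u) ^ s)⁻¹ +
    (2 * s + 1) * t * ((t + √(t ^ 2 - 1) * Real.cosh u) ^ (s + 1))⁻¹ -
    ((s : ℝ) + 1) * ((t + √(t ^ 2 - 1) * Real.cosh u) ^ (s + 2))⁻¹ with hg'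
  have hderiv : ∀ u, HasDerivAt g (g' u) u := by
    intro u
    have hA : HasDerivAt (fun u : ℝ => t + √(t ^ 2 - 1) * Real.cosh u)
        (√(t ^ 2 - 1) * Real.sinh u) u :=
      ((Real.hasDerivAt_cosh u).const_mul _).const_add t
    have h1 := (hA.fun_pow (s + 1)).fun_inv (pow_ne_zero _ (hA0 u).ne')
    have h2 := ((Real.hasDerivAt_sinh u).const_mul (√(t ^ 2 - 1))).mul h1
    refine h2.congr_deriv ?_
    simp only [hg', Nat.add_sub_cancel, Nat.cast_add, Nat.cast_one]
    have hApos : 0 < t + √(t ^ 2 - 1) * Real.cosh u := hA0 u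
    set e : ℝ := √(t ^ 2 - 1) with he
    have hsinh : Real.sinh u ^ 2 = Real.cosh u ^ 2 - 1 := Real.sinh_sq u
    field_simp
    linear_combination (e * Real.cosh u + t) ^ (s * 3) * ((s : ℝ) + 1) *
        (-(e ^ 2 * (t + e * Real.cosh u) ^ 2)) * hsinh +
      (e * Real.cosh u + t) ^ (s * 3) * ((s : ℝ) + 1) *
        (2 * e * t * Real.cosh u + e ^ 2 * Real.cosh u ^ 2 + t ^ 2) * he2
  have hint : IntegrableOn g' (Ioi 0) :=
    ((((integrableOn_greenQ_integrand ht hs).const_mul _).add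
      ((integrableOn_greenQ_integrand ht (by omega)).const_mul _)).sub
      ((integrableOn_greenQ_integrand ht (by omega)).const_mul _))
  have hlim : Tendsto g atTop (𝓝 0) := by
    refine squeeze_zero_norm (a := fun u => (2 / √(t ^ 2 - 1)) ^ s * Real.exp (-(s : ℝ) * u))
      (fun u => ?_) ?_
    · have hA := hA0 u
      rw [hg, norm_mul, norm_mul, Real.norm_of_nonneg he0.le, Real.norm_eq_abs,
        Real.norm_of_nonneg (inv_pos.mpr (pow_pos hA _)).le]
      have habs : |Real.sinh u| ≤ Real.cosh u := by
        have h := sq_le_sq.mp (show Real.sinh u ^ 2 ≤ Real.cosh u ^ 2 by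
          rw [Real.sinh_sq]; linarith)
        rwa [abs_of_pos (Real.cosh_pos u)] at h
      calc √(t ^ 2 - 1) * |Real.sinh u| * ((t + √(t ^ 2 - 1) * Real.cosh u) ^ (s + 1))⁻¹
          ≤ (t + √(t ^ 2 - 1) * Real.cosh u) *
              ((t + √(t ^ 2 - 1) * Real.cosh u) ^ (s + 1))⁻¹ := by
            refine mul_le_mul_of_nonneg_right ?_ (inv_pos.mpr (pow_pos hA _)).le
            nlinarith [mul_le_mul_of_nonneg_left habs he0.le]
        _ = ((t + √(t ^ 2 - 1) * Real.cosh u) ^ s)⁻¹ := by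
            rw [pow_succ' _ s, mul_inv, ← mul_assoc, mul_inv_cancel₀ hA.ne', one_mul]
        _ ≤ (2 / √(t ^ 2 - 1)) ^ s * Real.exp (-(s : ℝ) * u) := greenQ_integrand_le ht s u
    · have hs0 : (0 : ℝ) < s := by exact_mod_cast hs
      have h1 : Tendsto (fun u : ℝ => Real.exp (-(s : ℝ) * u)) atTop (𝓝 0) := by
        have h2 := Real.tendsto_exp_atBot.comp
          (tendsto_neg_atTop_atBot.comp (tendsto_id.const_mul_atTop hs0))
        refine h2.congr fun u => ?_
        simp [neg_mul]
      simpa using h1.const_mul ((2 / √(t ^ 2 - 1)) ^ s)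
  have hcont : ContinuousWithinAt g (Ici 0) 0 := (hderiv 0).continuousAt.continuousWithinAt
  have hFTC := integral_Ioi_of_hasDerivAt_of_tendsto hcont (fun u _ => hderiv u) hint hlim
  have hg0 : g 0 = 0 := by simp [hg]
  rw [hg0, sub_zero] at hFTC
  have hlin : ∫ u in Ioi (0 : ℝ), g' u = -(s : ℝ) * greenQ s t +
      (2 * s + 1) * t * greenQ (s + 1) t - ((s : ℝ) + 1) * greenQ (s + 2) t := by
    rw [hg', integral_sub, integral_add, integral_const_mul, integral_const_mul,
      integral_const_mul]
    · rfl
    · exact (integrableOn_greenQ_integrand ht hs).const_mul _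
    · exact (integrableOn_greenQ_integrand ht (by omega)).const_mul _
    · exact ((integrableOn_greenQ_integrand ht hs).const_mul _).add
        ((integrableOn_greenQ_integrand ht (by omega)).const_mul _)
    · exact (integrableOn_greenQ_integrand ht (by omega)).const_mul _
  linarith [hFTC, hlin]

/-- **The second derivative of `Q_{s-1}`**: for `t > 1`, `s ≥ 1`,
`Q_{s-1}''(t) = (s(s-1) Q_{s-1}(t) - 2t Q_{s-1}'(t)) / (t² - 1)` — differentiate the recurrence
`hasDerivAt_greenQ` once more and eliminate `Q_{s+1}` with the three-term recurrence
`greenQ_three_term`. [folklore] -/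
theorem hasDerivAt_deriv_greenQ {t : ℝ} (ht : 1 < t) {s : ℕ} (hs : 1 ≤ s) :
    HasDerivAt (deriv (greenQ s))
      (((s : ℝ) * (s - 1) * greenQ s t - 2 * t * deriv (greenQ s) t) / (t ^ 2 - 1)) t := by
  have hden : t ^ 2 - 1 ≠ 0 := by nlinarith
  have hQ := hasDerivAt_greenQ ht hs
  have hP := hasDerivAt_greenQ ht (Nat.le_succ_of_le hs)
  have h3 := greenQ_three_term ht hs
  have hev : deriv (greenQ s) =ᶠ[𝓝 t]
      fun τ => (s : ℝ) * (greenQ (s + 1) τ - τ * greenQ s τ) / (τ ^ 2 - 1) :=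
    Filter.eventuallyEq_of_mem (Ioi_mem_nhds ht) fun τ hτ => deriv_greenQ hτ hs
  have hnum : HasDerivAt (fun τ : ℝ => (s : ℝ) * (greenQ (s + 1) τ - τ * greenQ s τ))
      ((s : ℝ) * (((s + 1 : ℕ) : ℝ) * (greenQ (s + 1 + 1) t - t * greenQ (s + 1) t) / (t ^ 2 - 1) -
        (1 * greenQ s t + t * ((s : ℝ) * (greenQ (s + 1) t - t * greenQ s t) / (t ^ 2 - 1))))) t :=
    (hP.sub ((hasDerivAt_id t).mul hQ)).const_mul _
  have hdenD : HasDerivAt (fun τ : ℝ => τ ^ 2 - 1) (2 * t) t := by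
    simpa using (hasDerivAt_pow 2 t).sub_const 1
  have hquot := hnum.div hdenD hden
  refine (hquot.congr_of_eventuallyEq hev).congr_deriv ?_
  rw [deriv_greenQ ht hs]
  have h22 : s + 1 + 1 = s + 2 := rfl
  simp only [h22, Nat.cast_add, Nat.cast_one]
  field_simp
  linear_combination h3

/-- **Legendre's differential equation.** For `t > 1` and an integer `s ≥ 1`, Heine's integral
`Q_{s-1}(t) = greenQ s t` of (1.1) satisfies `(1 - t²) y'' - 2t y' + (s-1)s y = 0`, Legendre's
equation of degree `ν = s - 1` (`ν(ν+1) = (s-1)s`): `greenQ s` is the Legendre function of the second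
kind `Q_{s-1}` on `(1, ∞)` — the solution of Legendre's equation, unique up to scalars, that decays at
`+∞` (`greenQ_le`: `Q_{s-1}(t) = O(t^{-s})`). In geodesic polar coordinates this is the radial part
of `Δ G_s = s(s-1) G_s` for the point-pair invariant `G_s(z₁, z₂) = -2 Q_{s-1}(cosh d(z₁, z₂))`
(Gross–Zagier 1986, §II.2). [folklore] -/
theorem greenQ_legendre_ode {t : ℝ} (ht : 1 < t) {s : ℕ} (hs : 1 ≤ s) :
    (1 - t ^ 2) * deriv (deriv (greenQ s)) t - 2 * t * deriv (greenQ s) t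
      + ((s : ℝ) - 1) * s * greenQ s t = 0 := by
  rw [(hasDerivAt_deriv_greenQ ht hs).deriv]
  have hden : t ^ 2 - 1 ≠ 0 := by nlinarith
  field_simp
  ring

/-- Legendre's equation with `iteratedDeriv`. [folklore] -/
theorem greenQ_legendre_ode' {t : ℝ} (ht : 1 < t) {s : ℕ} (hs : 1 ≤ s) :
    (1 - t ^ 2) * iteratedDeriv 2 (greenQ s) t - 2 * t * iteratedDeriv 1 (greenQ s) t
      + ((s : ℝ) - 1) * s * greenQ s t = 0 := by
  rw [iteratedDeriv_succ, iteratedDeriv_one]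
  exact greenQ_legendre_ode ht hs

/-- **`Q_{s-1}` is smooth on `(1, ∞)`** (`s ≥ 1`): by `hasDerivAt_greenQ` the derivative of `greenQ s`
is a rational combination of `greenQ s`, `greenQ (s+1)` and `t` with non-vanishing denominator
`t² - 1`, so `C^n`-regularity for every `n` follows by induction on `n`, simultaneously for all `s`.
[folklore] -/
theorem contDiffOn_greenQ {s : ℕ} (hs : 1 ≤ s) : ContDiffOn ℝ ∞ (greenQ s) (Ioi 1) := by
  suffices h : ∀ n : ℕ, ∀ s : ℕ, 1 ≤ s → ContDiffOn ℝ n (greenQ s) (Ioi 1) from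
    contDiffOn_infty.mpr fun n => h n s hs
  intro n
  induction n with
  | zero => exact fun s hs => contDiffOn_zero.mpr (continuousOn_greenQ hs)
  | succ n ih =>
    intro s hs
    have hcast : ((n + 1 : ℕ) : WithTop ℕ∞) = (n : WithTop ℕ∞) + 1 := by push_cast; rfl
    rw [hcast, contDiffOn_succ_iff_deriv_of_isOpen isOpen_Ioi]
    refine ⟨differentiableOn_greenQ hs, fun h => absurd h (by simp), ?_⟩
    have hexp : ContDiffOn ℝ n
        (fun τ : ℝ => (s : ℝ) * (greenQ (s + 1) τ - τ * greenQ s τ) / (τ ^ 2 - 1)) (Ioi 1) := by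
      refine ContDiffOn.div ?_ ((contDiffOn_id.pow 2).sub contDiffOn_const) fun τ hτ => ?_
      · exact contDiffOn_const.mul ((ih (s + 1) (by omega)).sub (contDiffOn_id.mul (ih s hs)))
      · have hτ' : (1 : ℝ) < τ := hτ
        nlinarith
    exact hexp.congr fun τ hτ => deriv_greenQ hτ hs

section Laplacian

/-! ## The kernel `Q_{s-1}(cosh d(z₁, ·))` of `G_s` is an eigenfunction of the hyperbolic Laplacian -/

/-- The second derivative of a composite `ξ ↦ Q(u(ξ))` of real functions of one variable:
`(Q ∘ u)'' = Q''(u) u'² + Q'(u) u''` at a point where `u` is twice differentiable and `Q` is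
differentiable near `u(x)` and twice differentiable at `u(x)`. [folklore] -/
theorem hasDerivAt_deriv_comp {Q u : ℝ → ℝ} {x Q₂ u₂ : ℝ}
    (hQ : ∀ᶠ ξ in 𝓝 x, DifferentiableAt ℝ Q (u ξ)) (hu : ∀ᶠ ξ in 𝓝 x, DifferentiableAt ℝ u ξ)
    (hQ2 : HasDerivAt (deriv Q) Q₂ (u x)) (hu2 : HasDerivAt (deriv u) u₂ x) :
    HasDerivAt (deriv fun ξ => Q (u ξ)) (Q₂ * deriv u x ^ 2 + deriv Q (u x) * u₂) x := by
  have hev : (deriv fun ξ => Q (u ξ)) =ᶠ[𝓝 x] fun ξ => deriv Q (u ξ) * deriv u ξ :=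
    (hQ.and hu).mono fun ξ hξ => deriv_comp ξ hξ.1 hξ.2
  have hux : HasDerivAt u (deriv u x) x := hu.self_of_nhds.hasDerivAt
  have h1 : HasDerivAt (fun ξ => deriv Q (u ξ)) (Q₂ * deriv u x) x := hQ2.comp x hux
  refine ((h1.mul hu2).congr_of_eventuallyEq hev).congr_deriv ?_
  ring

/-- `∂/∂u` of `t(u, v) = ((x₁ - u)² + y₁² + v²)/(2 y₁ v)` (`= cosh d(z₁, u + iv)`, `coshDistArg_eq`):
`∂t/∂u = (u - x₁)/(y₁ v)`. [folklore] -/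
theorem hasDerivAt_coshDistArg_re (x₁ y₁ v u : ℝ) :
    HasDerivAt (fun u : ℝ => ((x₁ - u) ^ 2 + y₁ ^ 2 + v ^ 2) / (2 * y₁ * v))
      ((u - x₁) / (y₁ * v)) u := by
  rcases eq_or_ne (y₁ * v) 0 with h0 | h0
  · have h0' : 2 * y₁ * v = 0 := by rw [mul_assoc, h0, mul_zero]
    simp only [h0', h0, div_zero]
    exact hasDerivAt_const u 0
  · have h1 : HasDerivAt (fun u : ℝ => (x₁ - u) ^ 2 + y₁ ^ 2 + v ^ 2)
        ((2 : ℕ) * (x₁ - u) ^ (2 - 1) * (-1)) u :=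
      ((((hasDerivAt_id u).const_sub x₁).pow 2).add_const (y₁ ^ 2)).add_const (v ^ 2)
    refine (h1.div_const (2 * y₁ * v)).congr_deriv ?_
    have h2 : (2 : ℝ) ≠ 0 := two_ne_zero
    field_simp
    ring

/-- `∂/∂v` of `t(u, v) = ((x₁ - u)² + y₁² + v²)/(2 y₁ v)`: `∂t/∂v = (v² - (x₁ - u)² - y₁²)/(2 y₁ v²)`
(`v ≠ 0`, `y₁ ≠ 0`). [folklore] -/
theorem hasDerivAt_coshDistArg_im {x₁ y₁ u v : ℝ} (hy₁ : y₁ ≠ 0) (hv : v ≠ 0) :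
    HasDerivAt (fun v : ℝ => ((x₁ - u) ^ 2 + y₁ ^ 2 + v ^ 2) / (2 * y₁ * v))
      ((v ^ 2 - (x₁ - u) ^ 2 - y₁ ^ 2) / (2 * y₁ * v ^ 2)) v := by
  have hc : HasDerivAt (fun v : ℝ => (x₁ - u) ^ 2 + y₁ ^ 2 + v ^ 2) ((2 : ℕ) * v ^ (2 - 1)) v := by
    simpa using ((hasDerivAt_pow 2 v).const_add ((x₁ - u) ^ 2 + y₁ ^ 2))
  have hd : HasDerivAt (fun v : ℝ => 2 * y₁ * v) (2 * y₁) v := by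
    simpa using (hasDerivAt_id v).const_mul (2 * y₁)
  refine (hc.div hd (by positivity)).congr_deriv ?_
  have h2 : (2 : ℝ) ≠ 0 := two_ne_zero
  field_simp
  ring

/-- `∂²/∂v²` ingredient: `d/dv [(v² - C)/(2 y₁ v²)] = C/(y₁ v³)` (`v ≠ 0`, `y₁ ≠ 0`). [folklore] -/
theorem hasDerivAt_coshDistArg_im_deriv {y₁ C v : ℝ} (hy₁ : y₁ ≠ 0) (hv : v ≠ 0) :
    HasDerivAt (fun v : ℝ => (v ^ 2 - C) / (2 * y₁ * v ^ 2)) (C / (y₁ * v ^ 3)) v := by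
  have hc : HasDerivAt (fun v : ℝ => v ^ 2 - C) ((2 : ℕ) * v ^ (2 - 1)) v := by
    simpa using ((hasDerivAt_pow 2 v).sub_const C)
  have hd : HasDerivAt (fun v : ℝ => 2 * y₁ * v ^ 2) (2 * y₁ * ((2 : ℕ) * v ^ (2 - 1))) v := by
    simpa using ((hasDerivAt_pow 2 v).const_mul (2 * y₁))
  refine (hc.div hd (by positivity)).congr_deriv ?_
  have h2 : (2 : ℝ) ≠ 0 := two_ne_zero
  field_simp
  ring

/-- **The kernel of `G_s` is an eigenfunction of the hyperbolic Laplacian with eigenvalue `s(s-1)`.**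
In the coordinates `z = u + iv` of `ℍ`, with `z₁ = x₁ + iy₁` fixed and
`t(u, v) = ((x₁ - u)² + y₁² + v²)/(2 y₁ v) = cosh d(z₁, z)` (`coshDistArg_eq`), the function
`k(u, v) = Q_{s-1}(t(u, v))` (the `γ`-term of (1.1), `G_s(z₁, z) = -2 Σ_γ k(γz)`) satisfies
`v² (∂²k/∂u² + ∂²k/∂v²) = s(s-1) k` at every `z ≠ z₁` (`s ≥ 1`), i.e. `Δ k = s(s-1) k` for the
hyperbolic Laplacian `Δ = v²(∂ᵤ² + ∂ᵥ²)` of Gross–Zagier 1986, §II.2 (`= -Δ_hyp k = s(1-s)·(-k)` in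
the positive convention): by the chain rule `v² Δ_E (Q ∘ t) = Q''(t) · v²|∇t|² + Q'(t) · v² Δ_E t`
with `v²|∇t|² = t² - 1` and `v² Δ_E t = 2t`, and Legendre's equation `(t²-1) Q'' + 2t Q' = s(s-1) Q`
(`greenQ_legendre_ode`). The second partial derivatives are the iterated derivatives of the
coordinate slices. [cite: GrossZagier1986, §II.2 (b)] -/
theorem hyperbolicLaplacian_greenQ_coshDistArg {s : ℕ} (hs : 1 ≤ s) {x₁ y₁ u v : ℝ}
    (hy₁ : 0 < y₁) (hv : 0 < v) (hne : (u, v) ≠ (x₁, y₁)) :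
    v ^ 2 * (deriv (deriv fun ξ : ℝ => greenQ s (((x₁ - ξ) ^ 2 + y₁ ^ 2 + v ^ 2) / (2 * y₁ * v))) u
        + deriv (deriv fun η : ℝ => greenQ s (((x₁ - u) ^ 2 + y₁ ^ 2 + η ^ 2) / (2 * y₁ * η))) v) =
      ((s : ℝ) - 1) * s * greenQ s (((x₁ - u) ^ 2 + y₁ ^ 2 + v ^ 2) / (2 * y₁ * v)) := by
  set t₀ : ℝ := ((x₁ - u) ^ 2 + y₁ ^ 2 + v ^ 2) / (2 * y₁ * v) with ht₀
  have h2yv : 0 < 2 * y₁ * v := by positivity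
  have ht : 2 * y₁ * v * t₀ = (x₁ - u) ^ 2 + y₁ ^ 2 + v ^ 2 := by
    rw [ht₀]; field_simp
  have hpos : 0 < (x₁ - u) ^ 2 + (y₁ - v) ^ 2 := by
    rcases (add_nonneg (sq_nonneg (x₁ - u)) (sq_nonneg (y₁ - v))).lt_or_eq with h | h
    · exact h
    · exfalso
      have hx : x₁ - u = 0 := by nlinarith [sq_nonneg (x₁ - u), sq_nonneg (y₁ - v)]
      have hy : y₁ - v = 0 := by nlinarith [sq_nonneg (x₁ - u), sq_nonneg (y₁ - v)]
      exact hne (Prod.ext (by simp; linarith) (by simp; linarith))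
  have ht₀1 : 1 < t₀ := by
    rw [ht₀, lt_div_iff₀ h2yv]
    nlinarith
  -- `Q = greenQ s` near `t₀`
  have hQd : ∀ᶠ τ in 𝓝 t₀, DifferentiableAt ℝ (greenQ s) τ :=
    Filter.eventually_of_mem (Ioi_mem_nhds ht₀1) fun τ hτ =>
      (hasDerivAt_greenQ hτ hs).differentiableAt
  have hQ2 := hasDerivAt_deriv_greenQ ht₀1 hs
  set Q₂ : ℝ := (((s : ℝ) * (s - 1)) * greenQ s t₀ - 2 * t₀ * deriv (greenQ s) t₀) / (t₀ ^ 2 - 1)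
    with hQ₂
  have hQ2eq : Q₂ * (t₀ ^ 2 - 1) = (s : ℝ) * (s - 1) * greenQ s t₀ - 2 * t₀ * deriv (greenQ s) t₀ := by
    have : t₀ ^ 2 - 1 ≠ 0 := by nlinarith
    rw [hQ₂]; field_simp
  -- the `u`-slice
  set u₁ : ℝ → ℝ := fun ξ => ((x₁ - ξ) ^ 2 + y₁ ^ 2 + v ^ 2) / (2 * y₁ * v) with hu₁
  have hu₁d : ∀ ξ, HasDerivAt u₁ ((ξ - x₁) / (y₁ * v)) ξ := fun ξ =>
    hasDerivAt_coshDistArg_re x₁ y₁ v ξ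
  have hu₁x : u₁ u = t₀ := rfl
  have hderu₁ : deriv u₁ = fun ξ => (ξ - x₁) / (y₁ * v) := funext fun ξ => (hu₁d ξ).deriv
  have hu₁2 : HasDerivAt (deriv u₁) (1 / (y₁ * v)) u := by
    rw [hderu₁]
    exact ((hasDerivAt_id u).sub_const x₁).div_const (y₁ * v)
  have hcont₁ : ContinuousAt u₁ u := (hu₁d u).continuousAt
  have hA := hasDerivAt_deriv_comp (Q := greenQ s) (u := u₁) (x := u)
    (hcont₁.eventually (hu₁x ▸ hQd)) (Filter.Eventually.of_forall fun ξ => (hu₁d ξ).differentiableAt)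
    (hu₁x ▸ hQ2) hu₁2
  -- the `v`-slice
  set C : ℝ := (x₁ - u) ^ 2 + y₁ ^ 2 with hC
  set u₂ : ℝ → ℝ := fun η => ((x₁ - u) ^ 2 + y₁ ^ 2 + η ^ 2) / (2 * y₁ * η) with hu₂
  have hu₂d : ∀ η, η ≠ 0 → HasDerivAt u₂ ((η ^ 2 - (x₁ - u) ^ 2 - y₁ ^ 2) / (2 * y₁ * η ^ 2)) η :=
    fun η hη => hasDerivAt_coshDistArg_im hy₁.ne' hη
  have hu₂x : u₂ v = t₀ := rfl
  have hderu₂ : deriv u₂ =ᶠ[𝓝 v] fun η => (η ^ 2 - C) / (2 * y₁ * η ^ 2) :=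
    Filter.eventually_of_mem (Ioi_mem_nhds hv) fun η hη => by
      rw [(hu₂d η (ne_of_gt hη)).deriv, hC]; ring
  have hu₂2 : HasDerivAt (deriv u₂) (C / (y₁ * v ^ 3)) v :=
    (hasDerivAt_coshDistArg_im_deriv hy₁.ne' hv.ne').congr_of_eventuallyEq hderu₂
  have hcont₂ : ContinuousAt u₂ v := (hu₂d v hv.ne').continuousAt
  have hB := hasDerivAt_deriv_comp (Q := greenQ s) (u := u₂) (x := v)
    (hcont₂.eventually (hu₂x ▸ hQd))
    (Filter.eventually_of_mem (Ioi_mem_nhds hv) fun η hη => (hu₂d η (ne_of_gt hη)).differentiableAt)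
    (hu₂x ▸ hQ2) hu₂2
  rw [hA.deriv, hB.deriv, hu₁x, hu₂x, hderu₁, (hu₂d v hv.ne').deriv]
  -- the two coordinate identities `v²|∇t|² = t² - 1`, `v² Δ_E t = 2t`
  have hy0 : y₁ ≠ 0 := hy₁.ne'
  have hv0 : v ≠ 0 := hv.ne'
  have id1 : v ^ 2 * (((u - x₁) / (y₁ * v)) ^ 2 +
      ((v ^ 2 - (x₁ - u) ^ 2 - y₁ ^ 2) / (2 * y₁ * v ^ 2)) ^ 2) = t₀ ^ 2 - 1 := by
    rw [ht₀]
    field_simp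
    ring
  have id2 : v ^ 2 * (1 / (y₁ * v) + C / (y₁ * v ^ 3)) = 2 * t₀ := by
    rw [ht₀, hC]
    field_simp
    ring
  linear_combination Q₂ * id1 + deriv (greenQ s) t₀ * id2 + hQ2eq

/-- The same on `ℍ`: for `z ≠ z₁` in `ℍ` and `s ≥ 1`,
`(Im z)² (∂ᵤ² + ∂ᵥ²)[Q_{s-1}(t(u, v))](z) = s(s-1) Q_{s-1}(cosh d(z₁, z))`, where
`t(u, v) = ((Re z₁ - u)² + (Im z₁)² + v²)/(2 Im z₁ · v)` is `cosh d(z₁, u + iv)` in coordinates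
(`UpperHalfPlane.cosh_dist`, `coshDistArg_eq`): each term `Q_{s-1}(cosh d(z₁, γ z₂))` of the series
(1.1)–(1.2) defining `G_s^{Γ₀(N), m}` is an eigenfunction of the hyperbolic Laplacian in `z₂` with
eigenvalue `s(s-1)` away from its singularity. [cite: GrossZagier1986, §II.2 (b)] -/
theorem hyperbolicLaplacian_greenQ_cosh_dist {s : ℕ} (hs : 1 ≤ s) {z₁ z : ℍ} (hne : z ≠ z₁) :
    z.im ^ 2 * (deriv (deriv fun ξ : ℝ =>
          greenQ s (((z₁.re - ξ) ^ 2 + z₁.im ^ 2 + z.im ^ 2) / (2 * z₁.im * z.im))) z.re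
        + deriv (deriv fun η : ℝ =>
          greenQ s (((z₁.re - z.re) ^ 2 + z₁.im ^ 2 + η ^ 2) / (2 * z₁.im * η))) z.im) =
      ((s : ℝ) - 1) * s * greenQ s (Real.cosh (dist z₁ z)) := by
  have hne' : (z.re, z.im) ≠ (z₁.re, z₁.im) := by
    intro h
    exact hne (UpperHalfPlane.ext (Complex.ext (congrArg Prod.fst h) (congrArg Prod.snd h)))
  rw [UpperHalfPlane.cosh_dist, coshDistArg_eq]
  exact hyperbolicLaplacian_greenQ_coshDistArg hs z₁.im_pos z.im_pos hne'

end Laplacian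

section Fourier

/-! ## Fourier coefficients at `∞` are determined by the form -/

/-- At `z = iy`: `e^{2πimz} = e^{-2πmy}`. [folklore] -/
theorem exp_two_pi_I_mul_I_mul (m : ℤ) {y : ℝ} (hy : 0 < y) :
    Complex.exp (2 * π * Complex.I * m * ((⟨Complex.I * y, by simpa using hy⟩ : ℍ) : ℂ)) =
      (Real.exp (-2 * π * m * y) : ℂ) := by
  rw [Complex.ofReal_exp]
  congr 1
  push_cast
  show 2 * (π : ℂ) * Complex.I * m * (Complex.I * y) = -2 * π * m * y
  linear_combination (2 * (π : ℂ) * m * y) * Complex.I_sq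

/-- **Uniqueness of `q`-expansions.** If `Σ_{m ∈ ℤ} d(m) e^{2πimz} = 0` for every `z ∈ ℍ` (as a
summable family) and `d` vanishes below some index, then `d = 0`: otherwise, at the least `m₀` with
`d(m₀) ≠ 0`, `d(m₀) = -Σ_{m > m₀} d(m) e^{-2π(m - m₀)y}` at `z = iy`, whose right-hand side is
`O(e^{-2πy})` as `y → ∞` (absolute convergence at `y = 1`). [folklore] -/
theorem fourierCoeff_eq_zero_of_hasSum_zero {d : ℤ → ℂ} {M : ℤ} (hM : ∀ m < M, d m = 0)
    (h : ∀ z : ℍ, HasSum (fun m : ℤ => d m * Complex.exp (2 * π * Complex.I * m * (z : ℂ))) 0) :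
    d = 0 := by
  classical
  by_contra hd
  obtain ⟨m₁, hm₁⟩ : ∃ m, d m ≠ 0 := by
    by_contra hall
    push Not at hall
    exact hd (funext hall)
  obtain ⟨m₀, hm₀, hmin⟩ := Int.exists_least_of_bdd (P := fun m => d m ≠ 0)
    ⟨M, fun m hm => le_of_not_gt fun hlt => hm (hM m hlt)⟩ ⟨m₁, hm₁⟩
  have hbelow : ∀ m < m₀, d m = 0 := fun m hm => by
    by_contra hne
    exact absurd (hmin m hne) (not_le.mpr hm)
  -- the shifted series at `z = iy`: `g y m = d m e^{-2π (m - m₀) y}`, summing to `0`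
  set g : ℝ → ℤ → ℂ := fun y m => d m * (Real.exp (-2 * π * (m - m₀) * y) : ℂ) with hg
  have hgsum : ∀ {y : ℝ}, 0 < y → HasSum (g y) 0 := by
    intro y hy
    have h1 := h ⟨Complex.I * y, by simpa using hy⟩
    simp_rw [exp_two_pi_I_mul_I_mul _ hy] at h1
    have h2 := h1.mul_left (Real.exp (2 * π * m₀ * y) : ℂ)
    rw [mul_zero] at h2
    have hfun : (fun m : ℤ => (Real.exp (2 * π * m₀ * y) : ℂ) *
        (d m * (Real.exp (-2 * π * m * y) : ℂ))) = g y := by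
      funext m
      rw [hg]
      dsimp only
      rw [show -2 * π * ((m : ℝ) - m₀) * y = 2 * π * m₀ * y + -2 * π * m * y by ring, Real.exp_add]
      push_cast
      ring
    rw [hfun] at h2
    exact h2
  -- extract the term `m₀`: `d m₀ = -Σ_{m ≠ m₀} g y m`
  have hextract : ∀ {y : ℝ}, 0 < y → d m₀ = -∑' m, if m = m₀ then 0 else g y m := by
    intro y hy
    have h1 := (hgsum hy).summable.tsum_eq_add_tsum_ite m₀
    rw [(hgsum hy).tsum_eq] at h1
    have hg0 : g y m₀ = d m₀ := by simp [hg]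
    rw [hg0] at h1
    linear_combination -h1
  -- absolute convergence at `y = 1`
  set A : ℝ := ∑' m, ‖if m = m₀ then 0 else g 1 m‖ with hA
  have hAsum : Summable fun m => ‖if m = m₀ then 0 else g 1 m‖ := by
    refine summable_norm_iff.mpr ?_
    have hs := (hgsum one_pos).summable
    convert hs.update m₀ 0 using 1  -- hmm; use an explicit route instead below
    funext m
    by_cases hm : m = m₀
    · subst hm; simp
    · simp [hm]
  -- termwise bound for `y ≥ 1`
  have hterm : ∀ {y : ℝ}, 1 ≤ y → ∀ m,
      ‖if m = m₀ then 0 else g y m‖ ≤ Real.exp (-2 * π * (y - 1)) * ‖if m = m₀ then 0 else g 1 m‖ := by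
    intro y hy m
    by_cases hm : m = m₀
    · simp [hm]
    · rcases lt_or_gt_of_ne hm with hlt | hgt
      · simp [hm, hg, hbelow m hlt]
      · simp only [hm, if_false, hg, norm_mul, Complex.norm_real, Real.norm_eq_abs,
          abs_of_pos (Real.exp_pos _)]
        have h1 : (1 : ℝ) ≤ (m : ℝ) - m₀ := by
          have : m₀ + 1 ≤ m := hgt
          have : ((m₀ + 1 : ℤ) : ℝ) ≤ m := by exact_mod_cast this
          push_cast at this
          linarith
        have hkey : Real.exp (-2 * π * (m - m₀) * y) ≤
            Real.exp (-2 * π * (y - 1)) * Real.exp (-2 * π * (m - m₀) * 1) := by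
          rw [← Real.exp_add, Real.exp_le_exp]
          have hprod : 0 ≤ ((m : ℝ) - m₀ - 1) * (y - 1) := mul_nonneg (by linarith) (by linarith)
          nlinarith [mul_nonneg Real.pi_pos.le hprod]
        calc ‖d m‖ * Real.exp (-2 * π * (m - m₀) * y)
            ≤ ‖d m‖ * (Real.exp (-2 * π * (y - 1)) * Real.exp (-2 * π * (m - m₀) * 1)) :=
              mul_le_mul_of_nonneg_left hkey (norm_nonneg _)
          _ = Real.exp (-2 * π * (y - 1)) * (‖d m‖ * Real.exp (-2 * π * (m - m₀) * 1)) := by ring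
  -- hence `‖d m₀‖ ≤ e^{-2π(y-1)} A` for `y ≥ 1`
  have hbound : ∀ {y : ℝ}, 1 ≤ y → ‖d m₀‖ ≤ Real.exp (-2 * π * (y - 1)) * A := by
    intro y hy
    have hsumy : Summable fun m => ‖if m = m₀ then 0 else g y m‖ :=
      (hAsum.mul_left (Real.exp (-2 * π * (y - 1)))).of_nonneg_of_le (fun m => norm_nonneg _)
        (hterm hy)
    rw [hextract (by linarith : (0 : ℝ) < y), norm_neg]
    refine (norm_tsum_le_tsum_norm hsumy).trans ?_
    rw [hA, ← tsum_mul_left]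
    exact hsumy.tsum_le_tsum (hterm hy) (hAsum.mul_left _)
  -- let `y → ∞`
  have hlim : Tendsto (fun y : ℝ => Real.exp (-2 * π * (y - 1)) * A) atTop (𝓝 0) := by
    have h1 : Tendsto (fun y : ℝ => -2 * π * (y - 1)) atTop atBot := by
      have h2 : Tendsto (fun y : ℝ => y - 1) atTop atTop := tendsto_atTop_add_const_right _ (-1) tendsto_id
      have h3 : Tendsto (fun y : ℝ => 2 * π * (y - 1)) atTop atTop :=
        h2.const_mul_atTop (by positivity)
      exact (tendsto_neg_atTop_atBot.comp h3).congr fun y => by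
        simp only [Function.comp_apply]
        ring
    simpa using (Real.tendsto_exp_atBot.comp h1).mul_const A
  have hle : ‖d m₀‖ ≤ 0 :=
    le_of_tendsto_of_tendsto tendsto_const_nhds hlim
      (Filter.eventually_of_mem (Ici_mem_atTop 1) fun y hy => hbound hy)
  exact hm₀ (norm_le_zero_iff.mp hle)

/-- **The Fourier coefficients of `f ∈ M^{!,∞}_k(Γ₀(N))` at `∞` are determined by `f`**: the
coefficient function `c` in `IsRatWeaklyHolomorphicForm N k f c` is unique, so the principal higher
Green function `G_{r+1,f} = principalHigherGreen N r c` of (1.3) and the divisor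
`Z_f = Σ_{c(-m) ≠ 0} T_m` depend only on `f`. [folklore] -/
theorem IsRatWeaklyHolomorphicForm.coeff_unique {N : ℕ} {k : ℤ} {f : ℍ → ℂ} {c c' : ℤ → ℚ}
    (h : IsRatWeaklyHolomorphicForm N k f c) (h' : IsRatWeaklyHolomorphicForm N k f c') :
    c = c' := by
  obtain ⟨M, hM⟩ := h.finite_principalPart
  obtain ⟨M', hM'⟩ := h'.finite_principalPart
  have hd := fourierCoeff_eq_zero_of_hasSum_zero (d := fun m => (c m : ℂ) - c' m)
    (M := min (-(M : ℤ)) (-(M' : ℤ))) (fun m hm => by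
      simp [hM m (lt_of_lt_of_le hm (min_le_left _ _)), hM' m (lt_of_lt_of_le hm (min_le_right _ _))])
    (fun z => by
      have := (h.hasSum_fourier z).sub (h'.hasSum_fourier z)
      rw [sub_self] at this
      have hfun : (fun m : ℤ => (c m : ℂ) * Complex.exp (2 * π * Complex.I * m * (z : ℂ)) -
          (c' m : ℂ) * Complex.exp (2 * π * Complex.I * m * (z : ℂ))) =
          fun m : ℤ => ((c m : ℂ) - c' m) * Complex.exp (2 * π * Complex.I * m * (z : ℂ)) := by
        funext m
        ring
      rw [hfun] at this
      exact this)
  funext m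
  have := congrFun hd m
  simp only [Pi.zero_apply, sub_eq_zero] at this
  exact_mod_cast this

/-- Consequently `G_{r+1,f}` is well defined: two coefficient functions of the same `f` give the same
principal higher Green function. [folklore] -/
theorem IsRatWeaklyHolomorphicForm.principalHigherGreen_eq {N : ℕ} {k : ℤ} {f : ℍ → ℂ}
    {c c' : ℤ → ℚ} (h : IsRatWeaklyHolomorphicForm N k f c)
    (h' : IsRatWeaklyHolomorphicForm N k f c') (r : ℕ) :
    principalHigherGreen N r c = principalHigherGreen N r c' := by
  rw [h.coeff_unique h']

end Fourier

section LogAsymptotics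

/-! ## The logarithmic singularity, sharp form: `Q_{s-1}(t) = -½ log(t - 1) + O(1)` as `t → 1⁺` -/

/-- **`Q_0` in closed form**: `greenQ 1 t = ∫₀^∞ du/(t + √(t²-1) cosh u) = ½ log((t+1)/(t-1))`
(`t > 1`). With `e = √(t²-1)` and `c = t - e ∈ (0, 1)` (so `c² + 2ce = 1`, `c² + 1 = 2tc`) an
antiderivative of the integrand is `F(u) = log((1+c)eᵘ + (1-c)) - log((1-c)eᵘ + (1+c))`, with
`F(0) = 0` and `F(u) → log((1+c)/(1-c))` as `u → ∞`; and `((1+c)/(1-c))² = (t+1)/(t-1)`. [folklore] -/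
theorem greenQ_one_eq {t : ℝ} (ht : 1 < t) : greenQ 1 t = Real.log ((t + 1) / (t - 1)) / 2 := by
  set e : ℝ := √(t ^ 2 - 1) with he
  have he0 : 0 < e := Real.sqrt_pos.mpr (by nlinarith)
  have he2 : e ^ 2 = t ^ 2 - 1 := Real.sq_sqrt (by nlinarith)
  have het : e < t := by nlinarith
  have het1 : t - 1 < e := by nlinarith
  set c : ℝ := t - e with hc
  have hc0 : 0 < c := by rw [hc]; linarith
  have hc1 : c < 1 := by rw [hc]; linarith
  have hp0 : 0 < 1 + c := by linarith
  have hq0 : 0 < 1 - c := by linarith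
  -- the antiderivative and its derivative
  set F : ℝ → ℝ := fun u => Real.log ((1 + c) * Real.exp u + (1 - c)) -
    Real.log ((1 - c) * Real.exp u + (1 + c)) with hF
  have hden1 : ∀ u, 0 < (1 + c) * Real.exp u + (1 - c) := fun u => by positivity
  have hden2 : ∀ u, 0 < (1 - c) * Real.exp u + (1 + c) := fun u => by positivity
  have hderiv : ∀ u, HasDerivAt F (((t + √(t ^ 2 - 1) * Real.cosh u) ^ 1)⁻¹) u := by
    intro u
    have h1 : HasDerivAt (fun u => (1 + c) * Real.exp u + (1 - c)) ((1 + c) * Real.exp u) u := by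
      simpa using ((Real.hasDerivAt_exp u).const_mul (1 + c)).add_const (1 - c)
    have h2 : HasDerivAt (fun u => (1 - c) * Real.exp u + (1 + c)) ((1 - c) * Real.exp u) u := by
      simpa using ((Real.hasDerivAt_exp u).const_mul (1 - c)).add_const (1 + c)
    refine ((h1.log (hden1 u).ne').sub (h2.log (hden2 u).ne')).congr_deriv ?_
    rw [← he, pow_one, Real.cosh_eq]
    have hexp : Real.exp u * Real.exp (-u) = 1 := by
      rw [← Real.exp_add, add_neg_cancel, Real.exp_zero]
    have hA : 0 < t + e * ((Real.exp u + Real.exp (-u)) / 2) := by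
      have := Real.exp_pos u; have := Real.exp_pos (-u); positivity
    have hd1 := hden1 u
    have hd2 := hden2 u
    field_simp
    rw [hc]
    linear_combination (-2 * Real.exp u ^ 2 - 4 * Real.exp u - 2) * he2 +
      (4 * (t * e - e ^ 2)) * hexp
  -- the limit at `+∞` and the value at `0`
  have hF' : ∀ u, F u = Real.log ((1 + c) + (1 - c) * Real.exp (-u)) -
      Real.log ((1 - c) + (1 + c) * Real.exp (-u)) := by
    intro u
    have hE := Real.exp_pos u
    have h1 : (1 + c) * Real.exp u + (1 - c) = Real.exp u * ((1 + c) + (1 - c) * Real.exp (-u)) := by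
      rw [mul_add, ← mul_assoc, mul_comm (Real.exp u) (1 - c), mul_assoc, ← Real.exp_add,
        add_neg_cancel, Real.exp_zero]
      ring
    have h2 : (1 - c) * Real.exp u + (1 + c) = Real.exp u * ((1 - c) + (1 + c) * Real.exp (-u)) := by
      rw [mul_add, ← mul_assoc, mul_comm (Real.exp u) (1 + c), mul_assoc, ← Real.exp_add,
        add_neg_cancel, Real.exp_zero]
      ring
    have hpos1 : 0 < (1 + c) + (1 - c) * Real.exp (-u) := by positivity
    have hpos2 : 0 < (1 - c) + (1 + c) * Real.exp (-u) := by positivity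
    simp only [hF, h1, h2]
    rw [Real.log_mul hE.ne' hpos1.ne', Real.log_mul hE.ne' hpos2.ne']
    ring
  have hlim : Tendsto F atTop (𝓝 (Real.log (1 + c) - Real.log (1 - c))) := by
    have hcont : ContinuousAt (fun x : ℝ => Real.log ((1 + c) + (1 - c) * x) -
        Real.log ((1 - c) + (1 + c) * x)) 0 := by
      refine (ContinuousAt.log (by fun_prop) ?_).sub (ContinuousAt.log (by fun_prop) ?_) <;>
        simp <;> linarith
    have h := hcont.tendsto.comp Real.tendsto_exp_neg_atTop_nhds_zero
    simp only [mul_zero, add_zero] at h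
    refine h.congr fun u => ?_
    simp only [Function.comp_apply, hF' u]
  have hF0 : F 0 = 0 := by
    simp only [hF, Real.exp_zero, mul_one]
    rw [show (1 + c) + (1 - c) = (1 - c) + (1 + c) by ring, sub_self]
  have hcont0 : ContinuousWithinAt F (Ici 0) 0 := (hderiv 0).continuousAt.continuousWithinAt
  have hFTC := integral_Ioi_of_hasDerivAt_of_tendsto hcont0 (fun u _ => hderiv u)
    (integrableOn_greenQ_integrand ht le_rfl) hlim
  rw [hF0, sub_zero] at hFTC
  rw [greenQ, hFTC]
  -- `log(1+c) - log(1-c) = ½ log((t+1)/(t-1))` since `((1+c)/(1-c))² = (t+1)/(t-1)`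
  have hsq : ((1 + c) / (1 - c)) ^ 2 = (t + 1) / (t - 1) := by
    have hc2 : c ^ 2 - 2 * t * c + 1 = 0 := by rw [hc]; nlinarith [he2]
    have ht1 : t - 1 ≠ 0 := by linarith
    have hq1 : 1 - c ≠ 0 := hq0.ne'
    field_simp
    linear_combination (-2) * hc2
  rw [← hsq, Real.log_pow, Real.log_div hp0.ne' hq0.ne']
  push_cast
  ring

/-- **`Q_1` in closed form**: `greenQ 2 t = t Q_0(t) - 1 = (t/2) log((t+1)/(t-1)) - 1` (`t > 1`), from
the recurrence `Q_0' = Q_1 - t Q_0` over `t² - 1` (`deriv_greenQ`, `s = 1`) and `Q_0' = -1/(t² - 1)`.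
[folklore] -/
theorem greenQ_two_eq {t : ℝ} (ht : 1 < t) :
    greenQ 2 t = t * (Real.log ((t + 1) / (t - 1)) / 2) - 1 := by
  have hden : t ^ 2 - 1 ≠ 0 := by nlinarith
  have h1 : deriv (greenQ 1) t = ((1 : ℕ) : ℝ) * (greenQ (1 + 1) t - t * greenQ 1 t) / (t ^ 2 - 1) :=
    deriv_greenQ ht le_rfl
  have hev : greenQ 1 =ᶠ[𝓝 t] fun τ => Real.log ((τ + 1) / (τ - 1)) / 2 :=
    Filter.eventually_of_mem (Ioi_mem_nhds ht) fun τ hτ => greenQ_one_eq hτ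
  have h2 : HasDerivAt (fun τ : ℝ => Real.log ((τ + 1) / (τ - 1)) / 2) (-(1 / (t ^ 2 - 1))) t := by
    have hnum : HasDerivAt (fun τ : ℝ => (τ + 1) / (τ - 1))
        ((1 * (t - 1) - (t + 1) * 1) / (t - 1) ^ 2) t :=
      ((hasDerivAt_id t).add_const 1).div ((hasDerivAt_id t).sub_const 1) (by linarith)
    have hpos : (t + 1) / (t - 1) ≠ 0 := (div_pos (by linarith) (by linarith)).ne'
    refine ((hnum.log hpos).div_const 2).congr_deriv ?_
    have : t - 1 ≠ 0 := by linarith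
    have : t + 1 ≠ 0 := by linarith
    field_simp
    ring
  have h3 : deriv (greenQ 1) t = -(1 / (t ^ 2 - 1)) := by
    rw [hev.deriv_eq]; exact h2.deriv
  rw [h3, greenQ_one_eq ht] at h1
  simp only [Nat.cast_one, one_mul] at h1
  field_simp at h1
  linarith

/-- `|x log x| ≤ 1` on `[0, 1]` in the form needed below: `|(t - 1) log(t - 1)| ≤ 1` for
`1 < t ≤ 2`. [folklore] -/
theorem abs_sub_one_mul_log_le {t : ℝ} (ht : 1 < t) (ht2 : t ≤ 2) :
    |(t - 1) * Real.log (t - 1)| ≤ 1 := by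
  rw [mul_comm]
  exact (Real.abs_log_mul_self_lt (t - 1) (by linarith) (by linarith)).le

/-- **The logarithmic singularity of `Q_{s-1}`, sharp form.** For every integer `s ≥ 1` there is a
constant `C` with `|Q_{s-1}(t) + ½ log(t - 1)| ≤ C` for `1 < t ≤ 2`: `Q_{s-1}(t) = -½ log(t-1) + O(1)`
as `t → 1⁺` (the classical `Q_ν(t) = -½ log((t-1)/2) - γ - ψ(ν+1) + o(1)`; only boundedness is
recorded). For `s = 1, 2` this is read off the closed forms `greenQ_one_eq`, `greenQ_two_eq`
(`|x log x| ≤ 1`), and it propagates along Bonnet's recursion `greenQ_three_term`: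
`Q_{s+1} + ½L = ((2s+1) t (Q_s + ½L) - s (Q_{s-1} + ½L))/(s+1) - (2s+1)(t-1)L/(2(s+1))`, `L = log(t-1)`.
With `t = cosh d(z, z')`, `t - 1 = |z - z'|²/(2 Im z Im z')`, this is the singularity
`-2Q_{k-1} = log|z - z'|² + O(1)` of each diagonal term of `G_k` (Gross–Zagier 1986, §II.2 (b)).
[folklore] -/
theorem exists_abs_greenQ_add_half_log_le {s : ℕ} (hs : 1 ≤ s) :
    ∃ C : ℝ, ∀ t : ℝ, 1 < t → t ≤ 2 → |greenQ s t + Real.log (t - 1) / 2| ≤ C := by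
  -- two-step induction
  suffices H : ∀ n : ℕ,
      (∃ C : ℝ, ∀ t : ℝ, 1 < t → t ≤ 2 → |greenQ (n + 1) t + Real.log (t - 1) / 2| ≤ C) ∧
      (∃ C : ℝ, ∀ t : ℝ, 1 < t → t ≤ 2 → |greenQ (n + 2) t + Real.log (t - 1) / 2| ≤ C) by
    obtain ⟨n, rfl⟩ := Nat.exists_eq_add_of_le hs
    rw [add_comm]
    exact (H n).1
  have hlog3 : ∀ t : ℝ, 1 < t → t ≤ 2 → 0 ≤ Real.log (t + 1) ∧ Real.log (t + 1) ≤ 2 := fun t ht ht2 =>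
    ⟨Real.log_nonneg (by linarith), (Real.log_le_sub_one_of_pos (by linarith)).trans (by linarith)⟩
  intro n
  induction n with
  | zero =>
    refine ⟨⟨1, fun t ht ht2 => ?_⟩, ⟨3, fun t ht ht2 => ?_⟩⟩
    · -- `Q_0 + ½ log(t-1) = ½ log(t+1)`
      rw [zero_add, greenQ_one_eq ht, Real.log_div (by linarith) (by linarith)]
      obtain ⟨h0, h2⟩ := hlog3 t ht ht2
      rw [abs_le]
      constructor <;> linarith
    · -- `Q_1 + ½ log(t-1) = ½ t log(t+1) - ½ (t-1) log(t-1) - 1`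
      rw [zero_add, greenQ_two_eq ht, Real.log_div (by linarith) (by linarith)]
      obtain ⟨h0, h2⟩ := hlog3 t ht ht2
      have hxlx := abs_le.mp (abs_sub_one_mul_log_le ht ht2)
      have h4 : 0 ≤ t * Real.log (t + 1) ∧ t * Real.log (t + 1) ≤ 4 :=
        ⟨mul_nonneg (by linarith) h0, by nlinarith⟩
      rw [abs_le]
      constructor <;> nlinarith [hxlx.1, hxlx.2, h4.1, h4.2]
  | succ n ih =>
    refine ⟨ih.2, ?_⟩
    obtain ⟨C₁, hC₁⟩ := ih.1
    obtain ⟨C₂, hC₂⟩ := ih.2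
    have hC₁0 : 0 ≤ C₁ := (abs_nonneg _).trans (hC₁ 2 one_lt_two le_rfl)
    have hC₂0 : 0 ≤ C₂ := (abs_nonneg _).trans (hC₂ 2 one_lt_two le_rfl)
    refine ⟨((2 * n + 3) * (2 * C₂) + (n + 1) * C₁ + (2 * n + 3) / 2) / (n + 2), fun t ht ht2 => ?_⟩
    have h3 := greenQ_three_term ht (s := n + 1) (by omega)
    push_cast at h3
    set L : ℝ := Real.log (t - 1) with hL
    set D₁ : ℝ := greenQ (n + 1) t + L / 2 with hD₁
    set D₂ : ℝ := greenQ (n + 2) t + L / 2 with hD₂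
    have hn2 : (0 : ℝ) < n + 2 := by positivity
    -- the recursion for the regular parts
    have key : ((n : ℝ) + 2) * (greenQ (n + 1 + 2) t + L / 2) =
        (2 * n + 3) * (t * D₂) - (n + 1) * D₁ - (2 * n + 3) / 2 * ((t - 1) * L) := by
      rw [hD₁, hD₂]
      have h22 : n + 1 + 1 = n + 2 := rfl
      rw [h22] at h3
      linear_combination h3
    have hb1 : |(2 * (n : ℝ) + 3) * (t * D₂)| ≤ (2 * n + 3) * (2 * C₂) := by
      rw [abs_mul, abs_of_nonneg (by positivity : (0 : ℝ) ≤ 2 * n + 3), abs_mul, abs_of_pos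
        (by linarith : (0 : ℝ) < t)]
      exact mul_le_mul_of_nonneg_left (mul_le_mul ht2 (hC₂ t ht ht2) (abs_nonneg _) zero_le_two)
        (by positivity)
    have hb2 : |((n : ℝ) + 1) * D₁| ≤ (n + 1) * C₁ := by
      rw [abs_mul, abs_of_nonneg (by positivity : (0 : ℝ) ≤ n + 1)]
      exact mul_le_mul_of_nonneg_left (hC₁ t ht ht2) (by positivity)
    have hb3 : |(2 * (n : ℝ) + 3) / 2 * ((t - 1) * L)| ≤ (2 * n + 3) / 2 := by
      rw [abs_mul, abs_of_nonneg (by positivity : (0 : ℝ) ≤ (2 * n + 3) / 2)]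
      simpa using mul_le_mul_of_nonneg_left (abs_sub_one_mul_log_le ht ht2)
        (by positivity : (0 : ℝ) ≤ (2 * n + 3) / 2)
    have habs : |((n : ℝ) + 2) * (greenQ (n + 1 + 2) t + L / 2)| ≤
        (2 * n + 3) * (2 * C₂) + (n + 1) * C₁ + (2 * n + 3) / 2 := by
      rw [key]
      exact ((abs_sub _ _).trans (add_le_add (abs_sub _ _) le_rfl)).trans
        (add_le_add (add_le_add hb1 hb2) hb3)
    rw [abs_mul, abs_of_pos hn2] at habs
    rw [le_div_iff₀ hn2, mul_comm]
    exact habs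

end LogAsymptotics

section LevelOne

open UpperHalfPlane Complex CongruenceSubgroup
open scoped MatrixGroups ModularForm Manifold

/-! ## Level one, negative weight: the principal part determines the form -/

/-- A `q`-expansion `Σ_{m ≥ 0} c(m) e^{2πimz}` without principal part is bounded at `∞`:
`‖f(z)‖ ≤ Σ_m |c(m)| e^{-2πm}` for `Im z ≥ 1` (absolute convergence at `z = i`). [folklore] -/
theorem isBoundedAtImInfty_of_hasSum_fourier {f : ℍ → ℂ} {c : ℤ → ℚ}
    (hsum : ∀ z : ℍ, HasSum (fun m : ℤ => (c m : ℂ) * Complex.exp (2 * π * Complex.I * m * (z : ℂ)))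
      (f z))
    (hc : ∀ m : ℤ, m < 0 → c m = 0) : IsBoundedAtImInfty f := by
  rw [UpperHalfPlane.isBoundedAtImInfty_iff]
  -- absolute convergence at `z = i`
  have hnorm : ∀ (m : ℤ) (z : ℍ), ‖(c m : ℂ) * Complex.exp (2 * π * Complex.I * m * (z : ℂ))‖ =
      |(c m : ℝ)| * Real.exp (-2 * π * m * z.im) := by
    intro m z
    rw [norm_mul, Complex.norm_ratCast, Complex.norm_exp]
    congr 1
    simp only [Complex.mul_re, Complex.re_ofNat, Complex.ofReal_re, Complex.im_ofNat,
      Complex.ofReal_im, mul_zero, sub_zero, Complex.I_re, Complex.I_im, zero_mul, mul_one,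
      Complex.intCast_re, Complex.intCast_im, add_zero, UpperHalfPlane.coe_re,
      UpperHalfPlane.coe_im, zero_sub, mul_im, zero_add]
    ring_nf
  have hsumI : Summable fun m : ℤ => |(c m : ℝ)| * Real.exp (-2 * π * m * 1) := by
    have h := (summable_norm_iff.mpr (hsum UpperHalfPlane.I).summable)
    refine h.congr fun m => ?_
    rw [hnorm m UpperHalfPlane.I, UpperHalfPlane.I_im]
  refine ⟨∑' m : ℤ, |(c m : ℝ)| * Real.exp (-2 * π * m * 1), 1, fun z hz => ?_⟩
  have hle : ∀ m : ℤ, ‖(c m : ℂ) * Complex.exp (2 * π * Complex.I * m * (z : ℂ))‖ ≤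
      |(c m : ℝ)| * Real.exp (-2 * π * m * 1) := by
    intro m
    rw [hnorm m z]
    rcases lt_or_ge m 0 with hm | hm
    · simp [hc m hm]
    · refine mul_le_mul_of_nonneg_left (Real.exp_le_exp.mpr ?_) (abs_nonneg _)
      have : (0 : ℝ) ≤ m := by exact_mod_cast hm
      nlinarith [Real.pi_pos, mul_nonneg this Real.pi_pos.le]
  rw [← (hsum z).tsum_eq]
  exact tsum_of_norm_bounded hsumI.hasSum hle

/-- In level one the space `Γ₀(1) = SL(2, ℤ)`. [folklore] -/
theorem mem_Gamma0_one (γ : SL(2, ℤ)) : γ ∈ Gamma0 1 := by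
  rw [Gamma0_mem]
  exact Subsingleton.elim _ _

/-- **Level one, negative weight: no principal part forces `f = 0`.** If
`f ∈ M^{!,∞}_k(SL(2, ℤ))` (`IsRatWeaklyHolomorphicForm 1 k f c`) with `k < 0` has `c(m) = 0` for
all `m < 0`, then `f` is bounded at the only cusp `∞`, hence a level-one modular form of negative
weight, hence `0` (Mathlib's `ModularFormClass.levelOne_neg_weight_eq_zero`). So in the setting of
`GKZAlgebraicity` with `N = 1`, a nonzero `f` always has a genuine principal part, and the degenerate
case `gkz_conclusion_of_coeff_eq_zero` is exactly `f = 0`. [folklore] -/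
theorem IsRatWeaklyHolomorphicForm.eq_zero_of_levelOne {k : ℤ} (hk : k < 0) {f : ℍ → ℂ}
    {c : ℤ → ℚ} (h : IsRatWeaklyHolomorphicForm 1 k f c) (hc : ∀ m : ℤ, m < 0 → c m = 0) :
    f = 0 := by
  have hbdd : IsBoundedAtImInfty f := isBoundedAtImInfty_of_hasSum_fourier h.hasSum_fourier hc
  have hslash : ∀ γ : SL(2, ℤ), f ∣[k] γ = f := fun γ => h.slash_eq γ (mem_Gamma0_one γ)
  let F : ModularForm 𝒮ℒ k :=
    { toFun := f
      slash_action_eq' := by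
        rintro γ ⟨g, rfl⟩
        exact hslash g
      holo' := h.mdifferentiable
      bdd_at_cusps' := fun {cusp} hcusp => by
        rw [OnePoint.isBoundedAt_iff_forall_SL2Z hcusp]
        intro γ _
        rw [hslash γ]
        exact hbdd }
  have hF := ModularFormClass.levelOne_neg_weight_eq_zero hk F
  exact hF

/-- The difference of two rational forms of `M^{!,∞}_k(Γ₀(N))` is one (coefficients subtract).
[folklore] -/
theorem IsRatWeaklyHolomorphicForm.sub {N : ℕ} {k : ℤ} {f g : ℍ → ℂ} {c d : ℤ → ℚ}
    (hf : IsRatWeaklyHolomorphicForm N k f c) (hg : IsRatWeaklyHolomorphicForm N k g d) :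
    IsRatWeaklyHolomorphicForm N k (f - g) (c - d) := by
  have h := hf.add (hg.smul (-1))
  have h1 : f + ((-1 : ℚ) : ℂ) • g = f - g := by
    ext z; simp [sub_eq_add_neg]
  have h2 : c + (-1 : ℚ) • d = c - d := by
    ext m; simp [sub_eq_add_neg]
  rwa [h1, h2] at h

/-- **Level one, negative weight: the principal part determines the form.** Two rational forms of
`M^{!,∞}_k(SL(2, ℤ))`, `k < 0`, with the same principal part (`c(m) = d(m)` for `m < 0`) are equal,
and so are all their coefficients: the data `f` of `GKZAlgebraicity` in level `1` is equivalent to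
its principal part `{c(-m)}_{m ≥ 1}`, which is all that enters `G_{r+1,f}`. [folklore] -/
theorem IsRatWeaklyHolomorphicForm.eq_of_principalPart_eq_levelOne {k : ℤ} (hk : k < 0)
    {f g : ℍ → ℂ} {c d : ℤ → ℚ} (hf : IsRatWeaklyHolomorphicForm 1 k f c)
    (hg : IsRatWeaklyHolomorphicForm 1 k g d) (hcd : ∀ m : ℤ, m < 0 → c m = d m) :
    f = g ∧ c = d := by
  have hsub := hf.sub hg
  have hfg : f - g = 0 :=
    hsub.eq_zero_of_levelOne hk fun m hm => by simp [hcd m hm]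
  have hfg' : f = g := sub_eq_zero.mp hfg
  refine ⟨hfg', ?_⟩
  subst hfg'
  exact hf.coeff_unique hg

end LevelOne

section DeltaInv

open UpperHalfPlane Complex CongruenceSubgroup Function
open scoped MatrixGroups ModularForm Manifold ArithmeticFunction.sigma

/-! ## The witness `1/Δ ∈ M^{!,∞}_{-12}(SL(2, ℤ))` with rational coefficients -/

/-- The `q`-expansions of `E₄` and `E₆` have rational coefficients: an explicit `R_k ∈ ℚ⟦X⟧`
(`1 - (2k/B_k) Σ σ_{k-1}(m) X^m`) maps to `qExpansion 1 E_k`. [folklore] -/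
theorem exists_ratPowerSeries_E {k : ℕ} (hk : 3 ≤ k) (hk2 : Even k) :
    ∃ R : PowerSeries ℚ, qExpansion 1 (ModularForm.E hk) = R.map (algebraMap ℚ ℂ) := by
  refine ⟨PowerSeries.mk fun m => if m = 0 then 1 else -(2 * k / bernoulli k : ℚ) * (σ (k - 1) m),
    ?_⟩
  ext m
  rw [EisensteinSeries.E_qExpansion_coeff hk hk2 m, PowerSeries.coeff_map, PowerSeries.coeff_mk,
    eq_ratCast]
  split_ifs with h
  · simp
  · push_cast
    ring

/-- **The `q`-expansion of `Δ` has rational coefficients**: `Δ = (E₄³ - E₆²)/1728`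
(`ModularForm.discriminant_eq_E₄_cube_sub_E₆_sq`) and `qExpansion` is a ring map on level-one
forms. [folklore] -/
theorem exists_ratPowerSeries_discriminant :
    ∃ R : PowerSeries ℚ, qExpansion 1 ModularForm.discriminant = R.map (algebraMap ℚ ℂ) := by
  obtain ⟨R₄, hR₄⟩ := exists_ratPowerSeries_E (k := 4) (by norm_num) (by decide)
  obtain ⟨R₆, hR₆⟩ := exists_ratPowerSeries_E (k := 6) (by norm_num) (by decide)
  refine ⟨PowerSeries.C (1728 : ℚ)⁻¹ * (R₄ ^ 3 - R₆ ^ 2), ?_⟩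
  have h4 := ModularForm.qExpansion_pow one_pos one_mem_strictPeriods_SL ModularForm.E₄ 3
  have h6 := ModularForm.qExpansion_pow one_pos one_mem_strictPeriods_SL ModularForm.E₆ 2
  have hsub := ModularForm.qExpansion_sub one_pos one_mem_strictPeriods_SL
    (ModularForm.E₄.pow 3) (ModularForm.E₆.pow 2)
  -- `Δ = 1728⁻¹ • (E₄³ - E₆²)` as functions
  have hfun : (ModularForm.discriminant : ℍ → ℂ) =
      (1728 : ℂ)⁻¹ • (⇑(ModularForm.E₄.pow 3) - ⇑(ModularForm.E₆.pow 2)) := by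
    funext z
    simp only [Pi.smul_apply, Pi.sub_apply, ModularForm.coe_pow, Pi.pow_apply, smul_eq_mul]
    rw [ModularForm.discriminant_eq_E₄_cube_sub_E₆_sq z]
    ring
  have han : AnalyticAt ℂ (cuspFunction 1 (⇑(ModularForm.E₄.pow 3) - ⇑(ModularForm.E₆.pow 2))) 0 := by
    have ha := ModularFormClass.analyticAt_cuspFunction_zero (ModularForm.E₄.pow 3) one_pos
      one_mem_strictPeriods_SL
    have hb := ModularFormClass.analyticAt_cuspFunction_zero (ModularForm.E₆.pow 2) one_pos
      one_mem_strictPeriods_SL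
    rw [cuspFunction_sub ha.continuousAt hb.continuousAt]
    exact ha.sub hb
  rw [hfun, qExpansion_smul han, hsub, h4, h6, hR₄, hR₆]
  simp only [map_mul, map_sub, map_pow, PowerSeries.map_C]
  rw [PowerSeries.smul_eq_C_mul]
  congr 1
  simp

/-! ### `G = q/Δ = ∏ (1 - qⁿ)^{-24}`: holomorphic, `1`-periodic, bounded at `∞` -/

/-- `G(z) = q/Δ(z)` equals `(∏_{n ≥ 1} (1 - qⁿ)^{24})⁻¹`. [folklore] -/
theorem qParam_div_discriminant_eq (z : ℍ) :
    Periodic.qParam 1 (z : ℂ) / ModularForm.discriminant z =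
      (∏' n : ℕ, (1 - ModularForm.eta_q n z) ^ 24)⁻¹ := by
  rw [ModularForm.discriminant_eq_q_prod z]
  have hq : Periodic.qParam 1 (z : ℂ) ≠ 0 := Complex.exp_ne_zero _
  rw [div_mul_eq_div_div, div_self hq, one_div]

/-- `G = q/Δ` tends to `1` at `i∞`. [folklore] -/
theorem tendsto_qParam_div_discriminant :
    Tendsto (fun z : ℍ => Periodic.qParam 1 (z : ℂ) / ModularForm.discriminant z) atImInfty
      (𝓝 1) := by
  have h := (ModularForm.tendsto_atImInfty_tprod_one_sub_eta_q_pow).inv₀ one_ne_zero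
  rw [inv_one] at h
  refine h.congr fun z => ?_
  rw [qParam_div_discriminant_eq]

/-- `G = q/Δ` is bounded at `i∞`. [folklore] -/
theorem isBoundedAtImInfty_qParam_div_discriminant :
    IsBoundedAtImInfty (fun z : ℍ => Periodic.qParam 1 (z : ℂ) / ModularForm.discriminant z) := by
  rw [UpperHalfPlane.isBoundedAtImInfty_iff]
  have hev : ∀ᶠ z : ℍ in atImInfty,
      dist (Periodic.qParam 1 (z : ℂ) / ModularForm.discriminant z) 1 < 1 :=
    tendsto_qParam_div_discriminant (Metric.ball_mem_nhds 1 one_pos)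
  obtain ⟨A, hA⟩ := (atImInfty_mem _).mp hev
  refine ⟨2, A, fun z hz => ?_⟩
  have h := hA z hz
  simp only [Set.mem_setOf_eq, Complex.dist_eq] at h
  have := norm_sub_norm_le (Periodic.qParam 1 (z : ℂ) / ModularForm.discriminant z) 1
  rw [norm_one] at this
  linarith

/-- `G = q/Δ` is holomorphic on `ℍ`. [folklore] -/
theorem mdifferentiable_qParam_div_discriminant :
    MDiff (fun z : ℍ => Periodic.qParam 1 (z : ℂ) / ModularForm.discriminant z) := by
  rw [UpperHalfPlane.mdifferentiable_iff]
  have hΔ : DifferentiableOn ℂ (ModularForm.discriminant ∘ ofComplex) {z : ℂ | 0 < z.im} :=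
    UpperHalfPlane.mdifferentiable_iff.mp (ModularFormClass.holo CuspForm.discriminant)
  have hq : DifferentiableOn ℂ (fun w : ℂ => Periodic.qParam 1 ((ofComplex w : ℍ) : ℂ))
      {z : ℂ | 0 < z.im} := by
    have hd : Differentiable ℂ (fun w : ℂ => Periodic.qParam 1 w) := by
      unfold Periodic.qParam
      fun_prop
    refine hd.differentiableOn.congr fun w hw => ?_
    simp [ofComplex_apply_of_im_pos hw]
  refine (hq.div hΔ fun w hw => ModularForm.discriminant_ne_zero _).congr fun w hw => ?_
  simp [Function.comp]

/-- `G = q/Δ` (extended through `ofComplex`) is `1`-periodic. [folklore] -/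
theorem periodic_qParam_div_discriminant :
    Periodic ((fun z : ℍ => Periodic.qParam 1 (z : ℂ) / ModularForm.discriminant z) ∘ ofComplex)
      1 := by
  have hΔ : Periodic (ModularForm.discriminant ∘ ofComplex) 1 :=
    SlashInvariantFormClass.periodic_comp_ofComplex CuspForm.discriminant one_mem_strictPeriods_SL
  intro w
  have h1 := hΔ w
  simp only [Function.comp_apply] at h1 ⊢
  rw [h1]
  congr 1
  by_cases hw : 0 < w.im
  · have hw' : 0 < (w + 1).im := by simpa using hw
    rw [ofComplex_apply_of_im_pos hw, ofComplex_apply_of_im_pos hw']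
    show Periodic.qParam 1 (w + 1) = Periodic.qParam 1 w
    simp only [Periodic.qParam, Complex.ofReal_one, div_one]
    rw [mul_add, Complex.exp_add, mul_one, Complex.exp_two_pi_mul_I, mul_one]
  · push Not at hw
    have hw' : (w + 1).im ≤ 0 := by simpa using hw
    rw [ofComplex_apply_eq_of_im_nonpos hw' hw]

/-! ### The `q`-expansion of `G = q/Δ` is the inverse of that of `Δ/q`, with rational coefficients -/

/-- The `q`-expansion of the bounded holomorphic `1`-periodic function `z ↦ q = e^{2πiz}` is `X`.
[folklore] -/
theorem qExpansion_qParam : qExpansion 1 (fun z : ℍ => Periodic.qParam 1 (z : ℂ)) = PowerSeries.X := by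
  -- the function is bounded, holomorphic, periodic, with `q`-series `Pi.single 1 1`
  have hmd : MDiff (fun z : ℍ => Periodic.qParam 1 (z : ℂ)) := by
    rw [UpperHalfPlane.mdifferentiable_iff]
    have hd : Differentiable ℂ (fun w : ℂ => Periodic.qParam 1 w) := by
      unfold Periodic.qParam
      fun_prop
    refine hd.differentiableOn.congr fun w hw => ?_
    simp [ofComplex_apply_of_im_pos hw]
  have hper : Periodic ((fun z : ℍ => Periodic.qParam 1 (z : ℂ)) ∘ ofComplex) 1 := by
    intro w
    simp only [Function.comp_apply]
    by_cases hw : 0 < w.im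
    · have hw' : 0 < (w + 1).im := by simpa using hw
      rw [ofComplex_apply_of_im_pos hw, ofComplex_apply_of_im_pos hw']
      show Periodic.qParam 1 (w + 1) = Periodic.qParam 1 w
      simp only [Periodic.qParam, Complex.ofReal_one, div_one]
      rw [mul_add, Complex.exp_add, mul_one, Complex.exp_two_pi_mul_I, mul_one]
    · push Not at hw
      have hw' : (w + 1).im ≤ 0 := by simpa using hw
      rw [ofComplex_apply_eq_of_im_nonpos hw' hw]
  have hbdd : IsBoundedAtImInfty (fun z : ℍ => Periodic.qParam 1 (z : ℂ)) := by
    rw [UpperHalfPlane.isBoundedAtImInfty_iff]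
    refine ⟨1, 0, fun z _ => ?_⟩
    exact (Periodic.norm_qParam_lt_one one_pos z.im_pos).le
  have han := analyticAt_cuspFunction_zero one_pos hper hmd hbdd
  have hsum : ∀ τ : ℍ, HasSum (fun m : ℕ => (Pi.single 1 1 : ℕ → ℂ) m • Periodic.qParam 1 (τ : ℂ) ^ m)
      (Periodic.qParam 1 (τ : ℂ)) := by
    intro τ
    have := hasSum_single (f := fun m : ℕ => (Pi.single 1 1 : ℕ → ℂ) m • Periodic.qParam 1 (τ : ℂ) ^ m)
      1 (fun m hm => by simp [hm])
    simpa using this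
  -- uniqueness of power series: `c = coefficients`
  have h1 := (hasFPowerSeriesOnBall_cuspFunction one_pos han hsum).hasFPowerSeriesAt
  have h2 : HasFPowerSeriesAt (cuspFunction 1 fun z : ℍ => Periodic.qParam 1 (z : ℂ))
      (FormalMultilinearSeries.ofScalars ℂ fun m =>
        (qExpansion 1 (fun z : ℍ => Periodic.qParam 1 (z : ℂ))).coeff m) 0 := by
    simpa [qExpansion_coeff, div_eq_mul_inv, mul_comm] using han.hasFPowerSeriesAt
  have heq := h1.eq_formalMultilinearSeries h2
  ext m
  have hm := congr_arg (fun p : FormalMultilinearSeries ℂ ℂ ℂ => p.coeff m) heq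
  simp only [FormalMultilinearSeries.coeff_ofScalars] at hm
  rw [← hm, PowerSeries.coeff_X]
  by_cases hm1 : m = 1
  · subst hm1; simp
  · simp [hm1]

/-- `qExpansion(q/Δ) · qExpansion(Δ) = X` (the product of the functions is `q`). [folklore] -/
theorem qExpansion_qParam_div_discriminant_mul :
    qExpansion 1 (fun z : ℍ => Periodic.qParam 1 (z : ℂ) / ModularForm.discriminant z) *
      qExpansion 1 ModularForm.discriminant = PowerSeries.X := by
  have hG := analyticAt_cuspFunction_zero one_pos periodic_qParam_div_discriminant
    mdifferentiable_qParam_div_discriminant isBoundedAtImInfty_qParam_div_discriminant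
  have hΔ := ModularFormClass.analyticAt_cuspFunction_zero CuspForm.discriminant one_pos
    one_mem_strictPeriods_SL
  rw [CuspForm.coe_discriminant] at hΔ
  rw [← qExpansion_mul hG hΔ, ← qExpansion_qParam]
  congr 1
  funext z
  simp only [Pi.mul_apply]
  rw [div_mul_cancel₀ _ (ModularForm.discriminant_ne_zero z)]

/-- **Rational `q`-expansion of `q/Δ`.** There is `V ∈ ℚ⟦X⟧` with constant term `1` such that
`qExpansion 1 (q/Δ) = V` (mapped to `ℂ`): writing `qExpansion Δ = X · U` with `U ∈ ℚ⟦X⟧`,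
`U(0) = 1` (`exists_ratPowerSeries_discriminant`, `discriminant_qExpansion_coeff_one`), the identity
`qExpansion(q/Δ) · qExpansion(Δ) = X` forces `qExpansion(q/Δ) = U⁻¹`. [folklore] -/
theorem exists_ratPowerSeries_qParam_div_discriminant :
    ∃ V : PowerSeries ℚ, PowerSeries.constantCoeff V = 1 ∧
      qExpansion 1 (fun z : ℍ => Periodic.qParam 1 (z : ℂ) / ModularForm.discriminant z) =
        V.map (algebraMap ℚ ℂ) := by
  obtain ⟨R, hR⟩ := exists_ratPowerSeries_discriminant
  -- `R = X * U` with `U(0) = 1`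
  have hR0 : PowerSeries.constantCoeff R = 0 := by
    have h0 : (qExpansion 1 ModularForm.discriminant).coeff 0 = 0 := by
      have := CuspFormClass.qExpansion_coeff_zero CuspForm.discriminant one_pos
        one_mem_strictPeriods_SL
      rwa [CuspForm.coe_discriminant] at this
    rw [hR, PowerSeries.coeff_map, PowerSeries.coeff_zero_eq_constantCoeff, eq_ratCast] at h0
    exact_mod_cast h0
  have hR1 : R.coeff 1 = 1 := by
    have h1 := ModularForm.discriminant_qExpansion_coeff_one
    rw [hR, PowerSeries.coeff_map, eq_ratCast] at h1
    exact_mod_cast h1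
  set U : PowerSeries ℚ := PowerSeries.mk fun n => R.coeff (n + 1) with hU
  have hRU : R = PowerSeries.X * U := by
    rw [PowerSeries.eq_X_mul_shift_add_const R, hR0, map_zero, add_zero]
  have hU0 : PowerSeries.constantCoeff U = 1 := by
    rw [hU, ← PowerSeries.coeff_zero_eq_constantCoeff, PowerSeries.coeff_mk, zero_add, hR1]
  -- the inverse
  set V : PowerSeries ℚ := U⁻¹ with hV
  have hUV : U * V = 1 := PowerSeries.mul_inv_cancel U (by rw [hU0]; exact one_ne_zero)
  refine ⟨V, ?_, ?_⟩
  · have := congrArg PowerSeries.constantCoeff hUV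
    rw [map_mul, hU0, one_mul, map_one] at this
    exact this
  · set qG := qExpansion 1 (fun z : ℍ => Periodic.qParam 1 (z : ℂ) / ModularForm.discriminant z)
      with hqG
    have hprod := qExpansion_qParam_div_discriminant_mul
    rw [← hqG, hR, hRU, map_mul, PowerSeries.map_X] at hprod
    -- cancel `X`
    have hcancel : qG * U.map (algebraMap ℚ ℂ) = 1 := by
      have h2 : (qG * U.map (algebraMap ℚ ℂ)) * PowerSeries.X = 1 * PowerSeries.X := by
        calc (qG * U.map (algebraMap ℚ ℂ)) * PowerSeries.X
            = qG * (PowerSeries.X * U.map (algebraMap ℚ ℂ)) := by ring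
          _ = 1 * PowerSeries.X := by rw [hprod, one_mul]
      exact mul_right_cancel₀ PowerSeries.X_ne_zero h2
    have hUV' : U.map (algebraMap ℚ ℂ) * V.map (algebraMap ℚ ℂ) = 1 := by
      rw [← map_mul, hUV, map_one]
    calc qG = qG * (U.map (algebraMap ℚ ℂ) * V.map (algebraMap ℚ ℂ)) := by rw [hUV', mul_one]
      _ = (qG * U.map (algebraMap ℚ ℂ)) * V.map (algebraMap ℚ ℂ) := by ring
      _ = V.map (algebraMap ℚ ℂ) := by rw [hcancel, one_mul]

/-! ### `1/Δ ∈ M^{!,∞}_{-12}(SL(2, ℤ))` with rational coefficients, and a consequence of `GKZAlgebraicity` -/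

/-- **Non-vacuity of the hypothesis class of `GKZAlgebraicity` with a genuine pole.** The weakly
holomorphic form `1/Δ = q⁻¹ + 24 + 324q + ⋯` of weight `-12` and level `1` is a rational form of
`M^{!,∞}_{-12}(SL(2, ℤ))` in the sense of `IsRatWeaklyHolomorphicForm`, with principal part exactly
`q⁻¹`: holomorphic (`Δ ≠ 0`), weight `-12` invariant (from the invariance of `Δ`), no other cusps
in level one, and Fourier coefficients `c(m) = V_{m+1} ∈ ℚ` where `q/Δ = Σ V_n qⁿ`
(`exists_ratPowerSeries_qParam_div_discriminant`). [folklore] -/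
theorem exists_isRatWeaklyHolomorphicForm_discriminant_inv :
    ∃ c : ℤ → ℚ, IsRatWeaklyHolomorphicForm 1 (-12) (fun z : ℍ => (ModularForm.discriminant z)⁻¹) c ∧
      c (-1) = 1 ∧ ∀ m : ℤ, m < -1 → c m = 0 := by
  obtain ⟨V, hV1, hV⟩ := exists_ratPowerSeries_qParam_div_discriminant
  set c : ℤ → ℚ := fun m => if m < -1 then 0 else V.coeff (m + 1).toNat with hc
  have hc1 : c (-1) = 1 := by
    simp only [hc]
    norm_num
    exact hV1
  have hc0 : ∀ m : ℤ, m < -1 → c m = 0 := fun m hm => by simp only [hc, if_pos hm]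
  refine ⟨c, ?_, hc1, hc0⟩
  -- the `q`-expansion of `1/Δ` on all of `ℍ`
  have hsumG := hasSum_qExpansion one_pos periodic_qParam_div_discriminant
    mdifferentiable_qParam_div_discriminant isBoundedAtImInfty_qParam_div_discriminant
  have hsum : ∀ τ : ℍ, HasSum (fun m : ℤ => (c m : ℂ) * Complex.exp (2 * π * Complex.I * m * (τ : ℂ)))
      (ModularForm.discriminant τ)⁻¹ := by
    intro τ
    have hq : Periodic.qParam 1 (τ : ℂ) = Complex.exp (2 * π * Complex.I * (τ : ℂ)) := by
      simp [Periodic.qParam]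
    have hq0 : Complex.exp (2 * π * Complex.I * (τ : ℂ)) ≠ 0 := Complex.exp_ne_zero _
    have hG := (hsumG τ).mul_right (Complex.exp (2 * π * Complex.I * (τ : ℂ)))⁻¹
    have hval : Periodic.qParam 1 (τ : ℂ) / ModularForm.discriminant τ *
        (Complex.exp (2 * π * Complex.I * (τ : ℂ)))⁻¹ = (ModularForm.discriminant τ)⁻¹ := by
      rw [hq]
      field_simp [ModularForm.discriminant_ne_zero τ]
    rw [hval] at hG
    -- reindex `ℕ → ℤ`, `n ↦ n - 1`
    let g : ℕ → ℤ := fun n => (n : ℤ) - 1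
    have hg : Function.Injective g := fun a b h => by
      simp only [g] at h
      exact_mod_cast (sub_left_inj.mp h)
    have hrange : ∀ m : ℤ, m ∉ Set.range g →
        (c m : ℂ) * Complex.exp (2 * π * Complex.I * m * (τ : ℂ)) = 0 := by
      intro m hm
      have hm' : m < -1 := by
        by_contra hle
        push Not at hle
        exact hm ⟨(m + 1).toNat, by simp only [g]; omega⟩
      simp [hc0 m hm']
    refine (hg.hasSum_iff hrange).mp ?_
    have hfun : ((fun m : ℤ => (c m : ℂ) * Complex.exp (2 * π * Complex.I * m * (τ : ℂ))) ∘ g) =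
        fun i : ℕ => (qExpansion 1 (fun z : ℍ => Periodic.qParam 1 (z : ℂ) /
          ModularForm.discriminant z)).coeff i • Periodic.qParam 1 (τ : ℂ) ^ i *
            (Complex.exp (2 * π * Complex.I * (τ : ℂ)))⁻¹ := by
      funext n
      simp only [Function.comp_apply, g]
      have hcn : c ((n : ℤ) - 1) = V.coeff n := by
        simp only [hc]
        rw [if_neg (by omega), show ((n : ℤ) - 1 + 1).toNat = n by omega]
      rw [hcn, hV, PowerSeries.coeff_map, eq_ratCast, hq]
      push_cast
      rw [show 2 * (π : ℂ) * Complex.I * ((n : ℂ) - 1) * (τ : ℂ) =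
          (n : ℂ) * (2 * π * Complex.I * (τ : ℂ)) - 2 * π * Complex.I * (τ : ℂ) by ring,
        Complex.exp_sub, Complex.exp_nat_mul]
      rw [smul_eq_mul]
      field_simp
    rw [hfun]
    exact hG
  -- holomorphy and invariance
  have hmd : MDiff (fun z : ℍ => (ModularForm.discriminant z)⁻¹) := by
    rw [UpperHalfPlane.mdifferentiable_iff]
    have hΔ : DifferentiableOn ℂ (ModularForm.discriminant ∘ ofComplex) {z : ℂ | 0 < z.im} :=
      UpperHalfPlane.mdifferentiable_iff.mp (ModularFormClass.holo CuspForm.discriminant)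
    exact hΔ.inv fun w hw => ModularForm.discriminant_ne_zero _
  have hslash : ∀ γ : SL(2, ℤ),
      (fun z : ℍ => (ModularForm.discriminant z)⁻¹) ∣[(-12 : ℤ)] (γ : GL (Fin 2) ℝ) =
        fun z : ℍ => (ModularForm.discriminant z)⁻¹ := by
    intro γ
    have hmem : (γ : GL (Fin 2) ℝ) ∈ 𝒮ℒ := ⟨γ, rfl⟩
    funext z
    rw [ModularForm.slash_def]
    have hΔ := SlashInvariantForm.slash_action_eqn'' CuspForm.discriminant hmem z
    simp only [CuspForm.coe_discriminant] at hΔ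
    have hdet : ((γ : GL (Fin 2) ℝ).det : ℝ) = 1 := by simp
    simp only [hdet]
    rw [show ((γ : GL (Fin 2) ℝ) • z) = γ • z from rfl] at hΔ ⊢
    rw [hΔ]
    have hd : denom (γ : GL (Fin 2) ℝ) z ≠ 0 := denom_ne_zero _ z
    have hΔ0 : ModularForm.discriminant z ≠ 0 := ModularForm.discriminant_ne_zero z
    simp only [UpperHalfPlane.σ, neg_neg]
    norm_num
    field_simp
  exact
    { mdifferentiable := hmd
      slash_eq := fun γ _ => hslash γ
      finite_principalPart := ⟨1, fun m hm => hc0 m (by omega)⟩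
      hasSum_fourier := hsum
      isBoundedAtImInfty_slash := fun γ hγ => absurd (mem_Gamma0_one γ) hγ }

/-- **`GKZAlgebraicity` has teeth in level one: the CM values of `G₇^{SL(2,ℤ)}`.** Under the named
fact, for CM points `z₁, z₂` of discriminants `d₁, d₂` that are not `SL(2, ℤ)`-equivalent,
`G₇(z₁, z₂) = |d₁d₂|⁻³ log|α|` for some nonzero algebraic `α`: take `f = 1/Δ ∈ M^{!,∞}_{-12}`
(`r = 6`, principal part `q⁻¹`, `exists_isRatWeaklyHolomorphicForm_discriminant_inv`), for which
`G_{7,f} = G₇^{(1)}` and `Z_f = T_1` is the diagonal. (Weight `2k = 14`: `S₁₄(SL(2, ℤ)) = 0`, the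
classical cusp-form-free case of the Gross–Zagier conjecture.) [cite: BruinierLiYang2025, Conj. 1.1 and Thm. 1.4] -/
theorem GKZAlgebraicity.higherGreen_seven_levelOne (h : GKZAlgebraicity) {z₁ z₂ : ℍ} {d₁ d₂ : ℤ}
    (h₁ : IsCMPointOfDisc z₁ d₁) (h₂ : IsCMPointOfDisc z₂ d₂)
    (hoff : ¬ OnHeckeCorrespondence 1 1 z₁ z₂) :
    ∃ α : ℂ, IsAlgebraic ℚ α ∧ α ≠ 0 ∧
      higherGreen 1 7 1 z₁ z₂ = |((d₁ * d₂ : ℤ) : ℝ)| ^ (-(3 : ℝ)) * Real.log ‖α‖ := by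
  obtain ⟨c, hc, hc1, hc0⟩ := exists_isRatWeaklyHolomorphicForm_discriminant_inv
  have hoff' : ∀ m : ℕ+, c (-(m : ℤ)) ≠ 0 → ¬ OnHeckeCorrespondence 1 (m : ℤ) z₁ z₂ := by
    intro m hm
    have hm1 : m = 1 := by
      by_contra hne
      apply hm
      apply hc0
      have h1 : (1 : ℕ) ≤ m := m.pos
      have hne' : (m : ℕ) ≠ 1 := fun h' => hne (PNat.eq (by simpa using h'))
      have : (2 : ℤ) ≤ (m : ℤ) := by
        have : (2 : ℕ) ≤ m := by omega
        exact_mod_cast this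
      omega
    subst hm1
    simpa using hoff
  obtain ⟨α, hα, hα0, hG⟩ := h 1 6 one_pos (by norm_num) _ c hc z₁ z₂ d₁ d₂ h₁ h₂ hoff'
  refine ⟨α, hα, hα0, ?_⟩
  have hP : principalHigherGreen 1 6 c z₁ z₂ = higherGreen 1 7 1 z₁ z₂ := by
    rw [principalHigherGreen, tsum_eq_single (1 : ℕ+)]
    · simp [hc1]
    · intro m hm
      have h1 : (1 : ℕ) ≤ m := m.pos
      have hne' : (m : ℕ) ≠ 1 := fun h' => hm (PNat.eq (by simpa using h'))
      have : (2 : ℤ) ≤ (m : ℤ) := by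
        have : (2 : ℕ) ≤ m := by omega
        exact_mod_cast this
      simp [hc0 (-(m : ℤ)) (by omega)]
  rw [← hP, hG]
  norm_num

/-! ### `g/Δ` for a level-one form `g` with rational `q`-expansion; the classical case `G₂` -/

/-- **`g/Δ ∈ M^{!,∞}_{k-12}(SL(2, ℤ))` with rational coefficients** for every level-one modular form
`g` of weight `k` whose `q`-expansion is rational: holomorphic (`Δ ≠ 0`), weight `k - 12` invariant,
no other cusps, and `g/Δ = q⁻¹ · (g · q/Δ)` where `g · q/Δ` is bounded, holomorphic and
`1`-periodic with `q`-expansion `qExpansion(g) · qExpansion(q/Δ) ∈ ℚ⟦X⟧`; the principal part is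
`g(i∞) q⁻¹`. [folklore] -/
theorem exists_isRatWeaklyHolomorphicForm_div_discriminant {k : ℤ} (g : ModularForm 𝒮ℒ k)
    (hg : ∃ R : PowerSeries ℚ, qExpansion 1 g = R.map (algebraMap ℚ ℂ)) :
    ∃ c : ℤ → ℚ, IsRatWeaklyHolomorphicForm 1 (k - 12)
        (fun z : ℍ => g z / ModularForm.discriminant z) c ∧
      ((c (-1) : ℚ) : ℂ) = (qExpansion 1 g).coeff 0 ∧ ∀ m : ℤ, m < -1 → c m = 0 := by
  obtain ⟨R, hR⟩ := hg
  obtain ⟨V, hV1, hV⟩ := exists_ratPowerSeries_qParam_div_discriminant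
  -- `H = g · q/Δ`
  have hHmd : MDiff (fun z : ℍ => g z * (Periodic.qParam 1 (z : ℂ) / ModularForm.discriminant z)) :=
    (ModularFormClass.holo g).mul mdifferentiable_qParam_div_discriminant
  have hHper : Periodic ((fun z : ℍ => g z *
      (Periodic.qParam 1 (z : ℂ) / ModularForm.discriminant z)) ∘ ofComplex) 1 := by
    intro w
    have h1 := SlashInvariantFormClass.periodic_comp_ofComplex g one_mem_strictPeriods_SL w
    have h2 := periodic_qParam_div_discriminant w
    simp only [Function.comp_apply, Complex.ofReal_one] at h1 h2 ⊢
    rw [h1, h2]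
  have hHbdd : IsBoundedAtImInfty (fun z : ℍ => g z *
      (Periodic.qParam 1 (z : ℂ) / ModularForm.discriminant z)) :=
    (ModularFormClass.bdd_at_infty g).mul isBoundedAtImInfty_qParam_div_discriminant
  have hsumH := hasSum_qExpansion one_pos hHper hHmd hHbdd
  have hqH : qExpansion 1 (fun z : ℍ => g z *
      (Periodic.qParam 1 (z : ℂ) / ModularForm.discriminant z)) = (R * V).map (algebraMap ℚ ℂ) := by
    have ha := ModularFormClass.analyticAt_cuspFunction_zero g one_pos one_mem_strictPeriods_SL
    have hb := analyticAt_cuspFunction_zero one_pos periodic_qParam_div_discriminant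
      mdifferentiable_qParam_div_discriminant isBoundedAtImInfty_qParam_div_discriminant
    have := qExpansion_mul ha hb
    rw [map_mul, ← hR, ← hV, ← this]
    rfl
  set W : PowerSeries ℚ := R * V with hW
  set c : ℤ → ℚ := fun m => if m < -1 then 0 else W.coeff (m + 1).toNat with hc
  have hc0 : ∀ m : ℤ, m < -1 → c m = 0 := fun m hm => by simp only [hc, if_pos hm]
  have hc1 : ((c (-1) : ℚ) : ℂ) = (qExpansion 1 g).coeff 0 := by
    have hW0 : W.coeff 0 = R.coeff 0 := by
      rw [PowerSeries.coeff_zero_eq_constantCoeff_apply, PowerSeries.coeff_zero_eq_constantCoeff_apply,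
        hW, map_mul, hV1, mul_one]
    have hc1' : c (-1) = W.coeff 0 := by
      simp only [hc]
      norm_num
    rw [hc1', hW0, hR, PowerSeries.coeff_map, eq_ratCast]
  refine ⟨c, ?_, hc1, hc0⟩
  -- the `q`-expansion of `g/Δ` on all of `ℍ`
  have hsum : ∀ τ : ℍ, HasSum (fun m : ℤ => (c m : ℂ) * Complex.exp (2 * π * Complex.I * m * (τ : ℂ)))
      (g τ / ModularForm.discriminant τ) := by
    intro τ
    have hq : Periodic.qParam 1 (τ : ℂ) = Complex.exp (2 * π * Complex.I * (τ : ℂ)) := by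
      simp [Periodic.qParam]
    have hq0 : Complex.exp (2 * π * Complex.I * (τ : ℂ)) ≠ 0 := Complex.exp_ne_zero _
    have hG := (hsumH τ).mul_right (Complex.exp (2 * π * Complex.I * (τ : ℂ)))⁻¹
    have hval : g τ * (Periodic.qParam 1 (τ : ℂ) / ModularForm.discriminant τ) *
        (Complex.exp (2 * π * Complex.I * (τ : ℂ)))⁻¹ = g τ / ModularForm.discriminant τ := by
      rw [hq]
      field_simp [ModularForm.discriminant_ne_zero τ]
    rw [hval] at hG
    let e : ℕ → ℤ := fun n => (n : ℤ) - 1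
    have he : Function.Injective e := fun a b h => by
      simp only [e] at h
      exact_mod_cast (sub_left_inj.mp h)
    have hrange : ∀ m : ℤ, m ∉ Set.range e →
        (c m : ℂ) * Complex.exp (2 * π * Complex.I * m * (τ : ℂ)) = 0 := by
      intro m hm
      have hm' : m < -1 := by
        by_contra hle
        push Not at hle
        exact hm ⟨(m + 1).toNat, by simp only [e]; omega⟩
      simp [hc0 m hm']
    refine (he.hasSum_iff hrange).mp ?_
    have hfun : ((fun m : ℤ => (c m : ℂ) * Complex.exp (2 * π * Complex.I * m * (τ : ℂ))) ∘ e) =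
        fun i : ℕ => (qExpansion 1 (fun z : ℍ => g z *
          (Periodic.qParam 1 (z : ℂ) / ModularForm.discriminant z))).coeff i •
            Periodic.qParam 1 (τ : ℂ) ^ i * (Complex.exp (2 * π * Complex.I * (τ : ℂ)))⁻¹ := by
      funext n
      simp only [Function.comp_apply, e]
      have hcn : c ((n : ℤ) - 1) = W.coeff n := by
        simp only [hc]
        rw [if_neg (by omega), show ((n : ℤ) - 1 + 1).toNat = n by omega]
      rw [hcn, hqH, PowerSeries.coeff_map, eq_ratCast, hq]
      push_cast
      rw [show 2 * (π : ℂ) * Complex.I * ((n : ℂ) - 1) * (τ : ℂ) =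
          (n : ℂ) * (2 * π * Complex.I * (τ : ℂ)) - 2 * π * Complex.I * (τ : ℂ) by ring,
        Complex.exp_sub, Complex.exp_nat_mul]
      rw [smul_eq_mul]
      field_simp
    rw [hfun]
    exact hG
  -- holomorphy and invariance of weight `k - 12`
  have hmd : MDiff (fun z : ℍ => g z / ModularForm.discriminant z) := by
    rw [UpperHalfPlane.mdifferentiable_iff]
    have hΔ : DifferentiableOn ℂ (ModularForm.discriminant ∘ ofComplex) {z : ℂ | 0 < z.im} :=
      UpperHalfPlane.mdifferentiable_iff.mp (ModularFormClass.holo CuspForm.discriminant)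
    have hg' : DifferentiableOn ℂ (⇑g ∘ ofComplex) {z : ℂ | 0 < z.im} :=
      UpperHalfPlane.mdifferentiable_iff.mp (ModularFormClass.holo g)
    exact hg'.div hΔ fun w hw => ModularForm.discriminant_ne_zero _
  have hslash : ∀ γ : SL(2, ℤ),
      (fun z : ℍ => g z / ModularForm.discriminant z) ∣[k - 12] (γ : GL (Fin 2) ℝ) =
        fun z : ℍ => g z / ModularForm.discriminant z := by
    intro γ
    have hmem : (γ : GL (Fin 2) ℝ) ∈ 𝒮ℒ := ⟨γ, rfl⟩
    funext z
    rw [ModularForm.slash_def]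
    have hΔ := SlashInvariantForm.slash_action_eqn'' CuspForm.discriminant hmem z
    have hgγ := SlashInvariantForm.slash_action_eqn'' g hmem z
    simp only [CuspForm.coe_discriminant] at hΔ
    have hdet : ((γ : GL (Fin 2) ℝ).det : ℝ) = 1 := by simp
    simp only [hdet]
    rw [show ((γ : GL (Fin 2) ℝ) • z) = γ • z from rfl] at hΔ hgγ ⊢
    rw [hΔ, hgγ]
    have hd : denom (γ : GL (Fin 2) ℝ) z ≠ 0 := denom_ne_zero _ z
    have hΔ0 : ModularForm.discriminant z ≠ 0 := ModularForm.discriminant_ne_zero z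
    have hdk : denom (γ : GL (Fin 2) ℝ) z ^ k ≠ 0 := zpow_ne_zero _ hd
    have hd12 : denom (γ : GL (Fin 2) ℝ) z ^ (12 : ℤ) ≠ 0 := zpow_ne_zero _ hd
    simp only [UpperHalfPlane.σ]
    norm_num
    rw [zpow_sub₀ hd 12 k]
    field_simp
  exact
    { mdifferentiable := hmd
      slash_eq := fun γ _ => hslash γ
      finite_principalPart := ⟨1, fun m hm => hc0 m (by omega)⟩
      hasSum_fourier := hsum
      isBoundedAtImInfty_slash := fun γ hγ => absurd (mem_Gamma0_one γ) hγ }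

/-- **`GKZAlgebraicity` in the level-one cusp-form-free weights, through `E_k/Δ`.** Under the
named fact: for an even `k ≥ 4` with `k - 12 = -2r`, `r ≥ 1`, and CM points `z₁, z₂` of
discriminants `d₁, d₂` that are not `SL(2, ℤ)`-equivalent, `G_{r+1}(z₁, z₂) = |d₁d₂|^{-r/2} log|α|`
for a nonzero algebraic `α`: take `f = E_k/Δ = q⁻¹ + ⋯ ∈ M^{!,∞}_{-2r}(SL(2, ℤ))`
(`exists_isRatWeaklyHolomorphicForm_div_discriminant`, `exists_ratPowerSeries_E`,
`E_k(i∞) = 1`), for which `G_{r+1,f} = G_{r+1}^{(1)}` and `Z_f = T₁`.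
[cite: BruinierLiYang2025, Conj. 1.1 and Thm. 1.4] -/
theorem GKZAlgebraicity.higherGreen_levelOne_of_E (h : GKZAlgebraicity) {k r : ℕ} (hk : 3 ≤ k)
    (hk2 : Even k) (hr : 0 < r) (hkr : ((k : ℕ) : ℤ) - 12 = -2 * ((r : ℕ) : ℤ))
    {z₁ z₂ : ℍ} {d₁ d₂ : ℤ} (h₁ : IsCMPointOfDisc z₁ d₁) (h₂ : IsCMPointOfDisc z₂ d₂)
    (hoff : ¬ OnHeckeCorrespondence 1 1 z₁ z₂) :
    ∃ α : ℂ, IsAlgebraic ℚ α ∧ α ≠ 0 ∧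
      higherGreen 1 (r + 1) 1 z₁ z₂ = |((d₁ * d₂ : ℤ) : ℝ)| ^ (-(r : ℝ) / 2) * Real.log ‖α‖ := by
  obtain ⟨c, hc, hc1, hc0⟩ := exists_isRatWeaklyHolomorphicForm_div_discriminant
    (ModularForm.E hk) (exists_ratPowerSeries_E hk hk2)
  rw [hkr] at hc
  have hc1' : c (-1) = 1 := by
    have h0 := EisensteinSeries.E_qExpansion_coeff_zero hk hk2
    rw [h0] at hc1
    exact_mod_cast hc1
  have hoff' : ∀ m : ℕ+, c (-(m : ℤ)) ≠ 0 → ¬ OnHeckeCorrespondence 1 (m : ℤ) z₁ z₂ := by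
    intro m hm
    have hm1 : m = 1 := by
      by_contra hne
      apply hm
      apply hc0
      have h1 : (1 : ℕ) ≤ m := m.pos
      have hne' : (m : ℕ) ≠ 1 := fun h' => hne (PNat.eq (by simpa using h'))
      have : (2 : ℤ) ≤ (m : ℤ) := by
        have : (2 : ℕ) ≤ m := by omega
        exact_mod_cast this
      omega
    subst hm1
    simpa using hoff
  obtain ⟨α, hα, hα0, hG⟩ := h 1 r one_pos hr _ c hc z₁ z₂ d₁ d₂ h₁ h₂ hoff'
  refine ⟨α, hα, hα0, ?_⟩
  have hP : principalHigherGreen 1 r c z₁ z₂ = higherGreen 1 (r + 1) 1 z₁ z₂ := by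
    rw [principalHigherGreen, tsum_eq_single (1 : ℕ+)]
    · simp [hc1']
    · intro m hm
      have h1 : (1 : ℕ) ≤ m := m.pos
      have hne' : (m : ℕ) ≠ 1 := fun h' => hm (PNat.eq (by simpa using h'))
      have : (2 : ℤ) ≤ (m : ℤ) := by
        have : (2 : ℕ) ≤ m := by omega
        exact_mod_cast this
      simp [hc0 (-(m : ℤ)) (by omega)]
  rw [← hP, hG]

/-- **The classical case of the Gross–Zagier conjecture under `GKZAlgebraicity`: CM values of
`G₂^{SL(2,ℤ)}`.** Under the named fact, for CM points `z₁, z₂` of discriminants `d₁, d₂` that are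
not `SL(2, ℤ)`-equivalent there is a nonzero algebraic `α` with
`G₂(z₁, z₂) = |d₁d₂|^{-1/2} log|α|` (tree normalisation of `G₂`): `f = E₁₀/Δ = q⁻¹ - 264 - ⋯`,
`r = 1`. This is the conjecture of Gross–Zagier 1986, §V.4 (`k = 2`, level `1`, `S₄(SL(2, ℤ)) = 0`),
as subsumed by Bruinier–Li–Yang 2025, Conjecture 1.1. [cite: BruinierLiYang2025, Conj. 1.1 and Thm. 1.4] -/
theorem GKZAlgebraicity.higherGreen_two_levelOne (h : GKZAlgebraicity) {z₁ z₂ : ℍ} {d₁ d₂ : ℤ}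
    (h₁ : IsCMPointOfDisc z₁ d₁) (h₂ : IsCMPointOfDisc z₂ d₂)
    (hoff : ¬ OnHeckeCorrespondence 1 1 z₁ z₂) :
    ∃ α : ℂ, IsAlgebraic ℚ α ∧ α ≠ 0 ∧
      higherGreen 1 2 1 z₁ z₂ = |((d₁ * d₂ : ℤ) : ℝ)| ^ (-(1 : ℝ) / 2) * Real.log ‖α‖ := by
  simpa using h.higherGreen_levelOne_of_E (k := 10) (r := 1) (by norm_num) (by decide) one_pos
    (by norm_num) h₁ h₂ hoff

/-- `G₃` (weight `6`, `S₆ = 0`): `f = E₈/Δ`, `r = 2`, `G₃(z₁, z₂) = |d₁d₂|⁻¹ log|α|` under the fact.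
[cite: BruinierLiYang2025, Conj. 1.1 and Thm. 1.4] -/
theorem GKZAlgebraicity.higherGreen_three_levelOne (h : GKZAlgebraicity) {z₁ z₂ : ℍ} {d₁ d₂ : ℤ}
    (h₁ : IsCMPointOfDisc z₁ d₁) (h₂ : IsCMPointOfDisc z₂ d₂)
    (hoff : ¬ OnHeckeCorrespondence 1 1 z₁ z₂) :
    ∃ α : ℂ, IsAlgebraic ℚ α ∧ α ≠ 0 ∧
      higherGreen 1 3 1 z₁ z₂ = |((d₁ * d₂ : ℤ) : ℝ)| ^ (-(2 : ℝ) / 2) * Real.log ‖α‖ := by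
  simpa using h.higherGreen_levelOne_of_E (k := 8) (r := 2) (by norm_num) (by decide) two_pos
    (by norm_num) h₁ h₂ hoff

/-- `G₄` (weight `8`, `S₈ = 0`): `f = E₆/Δ`, `r = 3`, `G₄(z₁, z₂) = |d₁d₂|^{-3/2} log|α|` under the
fact. [cite: BruinierLiYang2025, Conj. 1.1 and Thm. 1.4] -/
theorem GKZAlgebraicity.higherGreen_four_levelOne (h : GKZAlgebraicity) {z₁ z₂ : ℍ} {d₁ d₂ : ℤ}
    (h₁ : IsCMPointOfDisc z₁ d₁) (h₂ : IsCMPointOfDisc z₂ d₂)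
    (hoff : ¬ OnHeckeCorrespondence 1 1 z₁ z₂) :
    ∃ α : ℂ, IsAlgebraic ℚ α ∧ α ≠ 0 ∧
      higherGreen 1 4 1 z₁ z₂ = |((d₁ * d₂ : ℤ) : ℝ)| ^ (-(3 : ℝ) / 2) * Real.log ‖α‖ := by
  simpa using h.higherGreen_levelOne_of_E (k := 6) (r := 3) (by norm_num) (by decide)
    (by norm_num) (by norm_num) h₁ h₂ hoff

/-- `G₅` (weight `10`, `S₁₀ = 0`): `f = E₄/Δ`, `r = 4`, `G₅(z₁, z₂) = |d₁d₂|⁻² log|α|` under the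
fact. [cite: BruinierLiYang2025, Conj. 1.1 and Thm. 1.4] -/
theorem GKZAlgebraicity.higherGreen_five_levelOne (h : GKZAlgebraicity) {z₁ z₂ : ℍ} {d₁ d₂ : ℤ}
    (h₁ : IsCMPointOfDisc z₁ d₁) (h₂ : IsCMPointOfDisc z₂ d₂)
    (hoff : ¬ OnHeckeCorrespondence 1 1 z₁ z₂) :
    ∃ α : ℂ, IsAlgebraic ℚ α ∧ α ≠ 0 ∧
      higherGreen 1 5 1 z₁ z₂ = |((d₁ * d₂ : ℤ) : ℝ)| ^ (-(4 : ℝ) / 2) * Real.log ‖α‖ := by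
  simpa using h.higherGreen_levelOne_of_E (k := 4) (r := 4) (by norm_num) (by decide)
    (by norm_num) (by norm_num) h₁ h₂ hoff

end DeltaInv

section DeltaPow

open UpperHalfPlane Complex CongruenceSubgroup Function
open scoped MatrixGroups ModularForm Manifold

/-! ### Powers `(q/Δ)ⁿ`: holomorphic, `1`-periodic, bounded at `∞`, rational `q`-expansion -/

/-- `(q/Δ)ⁿ` is holomorphic on `ℍ`. [folklore] -/
theorem mdifferentiable_qParam_div_discriminant_pow (n : ℕ) :
    MDiff (fun z : ℍ => (Periodic.qParam 1 (z : ℂ) / ModularForm.discriminant z) ^ n) := by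
  rw [UpperHalfPlane.mdifferentiable_iff]
  have h := UpperHalfPlane.mdifferentiable_iff.mp mdifferentiable_qParam_div_discriminant
  exact (h.pow n).congr fun w _ => by simp [Function.comp]

/-- `(q/Δ)ⁿ` (through `ofComplex`) is `1`-periodic. [folklore] -/
theorem periodic_qParam_div_discriminant_pow (n : ℕ) :
    Periodic ((fun z : ℍ => (Periodic.qParam 1 (z : ℂ) / ModularForm.discriminant z) ^ n) ∘
      ofComplex) 1 := by
  have h := periodic_qParam_div_discriminant.comp (fun x : ℂ => x ^ n)
  exact h

/-- `(q/Δ)ⁿ` is bounded at `i∞`. [folklore] -/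
theorem isBoundedAtImInfty_qParam_div_discriminant_pow (n : ℕ) :
    IsBoundedAtImInfty (fun z : ℍ => (Periodic.qParam 1 (z : ℂ) / ModularForm.discriminant z) ^ n) := by
  induction n with
  | zero =>
    simp only [pow_zero]
    exact const_boundedAtFilter _ _
  | succ n ih =>
    simp only [pow_succ]
    exact ih.mul isBoundedAtImInfty_qParam_div_discriminant

/-- The `q`-expansion of `(q/Δ)ⁿ` is the `n`-th power of that of `q/Δ`. [folklore] -/
theorem qExpansion_qParam_div_discriminant_pow (n : ℕ) :
    qExpansion 1 (fun z : ℍ => (Periodic.qParam 1 (z : ℂ) / ModularForm.discriminant z) ^ n) =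
      qExpansion 1 (fun z : ℍ => Periodic.qParam 1 (z : ℂ) / ModularForm.discriminant z) ^ n := by
  induction n with
  | zero =>
    simp only [pow_zero]
    -- the `q`-expansion of the constant function `1` is `1`
    exact qExpansion_one 1
  | succ n ih =>
    have ha := analyticAt_cuspFunction_zero one_pos (periodic_qParam_div_discriminant_pow n)
      (mdifferentiable_qParam_div_discriminant_pow n) (isBoundedAtImInfty_qParam_div_discriminant_pow n)
    have hb := analyticAt_cuspFunction_zero one_pos periodic_qParam_div_discriminant
      mdifferentiable_qParam_div_discriminant isBoundedAtImInfty_qParam_div_discriminant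
    have := qExpansion_mul ha hb
    rw [pow_succ, ← ih, ← this]
    rfl

/-! ### `g/Δⁿ ∈ M^{!,∞}_{k-12n}(SL(2, ℤ))` with rational coefficients -/

/-- **`g/Δⁿ ∈ M^{!,∞}_{k-12n}(SL(2, ℤ))` with rational coefficients** for every level-one modular
form `g` of weight `k` with rational `q`-expansion and every `n ≥ 0`: holomorphic (`Δ ≠ 0`),
weight `k - 12n` invariant, no other cusps, and `g/Δⁿ = q⁻ⁿ · (g · (q/Δ)ⁿ)` where `g · (q/Δ)ⁿ` is
bounded, holomorphic and `1`-periodic with `q`-expansion `qExpansion(g) · qExpansion(q/Δ)ⁿ ∈ ℚ⟦X⟧`;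
the principal part has order exactly `n` when `g(i∞) ≠ 0`: `c(-n) = g(i∞)`, `c(m) = 0` for
`m < -n`. (The case `n = 1` is `exists_isRatWeaklyHolomorphicForm_div_discriminant`.) [folklore] -/
theorem exists_isRatWeaklyHolomorphicForm_div_discriminant_pow {k : ℤ} (g : ModularForm 𝒮ℒ k)
    (hg : ∃ R : PowerSeries ℚ, qExpansion 1 g = R.map (algebraMap ℚ ℂ)) (n : ℕ) :
    ∃ c : ℤ → ℚ, IsRatWeaklyHolomorphicForm 1 (k - 12 * n)
        (fun z : ℍ => g z / ModularForm.discriminant z ^ n) c ∧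
      ((c (-(n : ℤ)) : ℚ) : ℂ) = (qExpansion 1 g).coeff 0 ∧ ∀ m : ℤ, m < -(n : ℤ) → c m = 0 := by
  obtain ⟨R, hR⟩ := hg
  obtain ⟨V, hV1, hV⟩ := exists_ratPowerSeries_qParam_div_discriminant
  set G : ℍ → ℂ := fun z : ℍ => (Periodic.qParam 1 (z : ℂ) / ModularForm.discriminant z) ^ n with hG
  -- `H = g · (q/Δ)ⁿ`
  have hHmd : MDiff (fun z : ℍ => g z * G z) :=
    (ModularFormClass.holo g).mul (mdifferentiable_qParam_div_discriminant_pow n)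
  have hHper : Periodic ((fun z : ℍ => g z * G z) ∘ ofComplex) 1 := by
    intro w
    have h1 := SlashInvariantFormClass.periodic_comp_ofComplex g one_mem_strictPeriods_SL w
    have h2 := periodic_qParam_div_discriminant_pow n w
    simp only [Function.comp_apply, Complex.ofReal_one, hG] at h1 h2 ⊢
    rw [h1, h2]
  have hHbdd : IsBoundedAtImInfty (fun z : ℍ => g z * G z) :=
    (ModularFormClass.bdd_at_infty g).mul (isBoundedAtImInfty_qParam_div_discriminant_pow n)
  have hsumH := hasSum_qExpansion one_pos hHper hHmd hHbdd
  have hqH : qExpansion 1 (fun z : ℍ => g z * G z) = (R * V ^ n).map (algebraMap ℚ ℂ) := by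
    have ha := ModularFormClass.analyticAt_cuspFunction_zero g one_pos one_mem_strictPeriods_SL
    have hb := analyticAt_cuspFunction_zero one_pos (periodic_qParam_div_discriminant_pow n)
      (mdifferentiable_qParam_div_discriminant_pow n) (isBoundedAtImInfty_qParam_div_discriminant_pow n)
    have := qExpansion_mul ha hb
    rw [map_mul, map_pow, ← hR, ← hV, ← qExpansion_qParam_div_discriminant_pow, ← this]
    rfl
  set W : PowerSeries ℚ := R * V ^ n with hW
  set c : ℤ → ℚ := fun m => if m < -(n : ℤ) then 0 else W.coeff (m + n).toNat with hc
  have hc0 : ∀ m : ℤ, m < -(n : ℤ) → c m = 0 := fun m hm => by simp only [hc, if_pos hm]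
  have hc1 : ((c (-(n : ℤ)) : ℚ) : ℂ) = (qExpansion 1 g).coeff 0 := by
    have hW0 : W.coeff 0 = R.coeff 0 := by
      rw [PowerSeries.coeff_zero_eq_constantCoeff_apply, PowerSeries.coeff_zero_eq_constantCoeff_apply,
        hW, map_mul, map_pow, hV1, one_pow, mul_one]
    have hc1' : c (-(n : ℤ)) = W.coeff 0 := by
      simp only [hc]
      rw [if_neg (lt_irrefl _), show (-(n : ℤ) + n).toNat = 0 by omega]
    rw [hc1', hW0, hR, PowerSeries.coeff_map, eq_ratCast]
  refine ⟨c, ?_, hc1, hc0⟩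
  -- the `q`-expansion of `g/Δⁿ` on all of `ℍ`
  have hsum : ∀ τ : ℍ, HasSum (fun m : ℤ => (c m : ℂ) * Complex.exp (2 * π * Complex.I * m * (τ : ℂ)))
      (g τ / ModularForm.discriminant τ ^ n) := by
    intro τ
    have hq : Periodic.qParam 1 (τ : ℂ) = Complex.exp (2 * π * Complex.I * (τ : ℂ)) := by
      simp [Periodic.qParam]
    have hq0 : Complex.exp (2 * π * Complex.I * (τ : ℂ)) ≠ 0 := Complex.exp_ne_zero _
    have hGsum := (hsumH τ).mul_right ((Complex.exp (2 * π * Complex.I * (τ : ℂ))) ^ n)⁻¹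
    have hval : g τ * G τ * ((Complex.exp (2 * π * Complex.I * (τ : ℂ))) ^ n)⁻¹ =
        g τ / ModularForm.discriminant τ ^ n := by
      rw [hG]
      simp only [hq, div_pow]
      field_simp [ModularForm.discriminant_ne_zero τ]
    rw [hval] at hGsum
    let e : ℕ → ℤ := fun i => (i : ℤ) - n
    have he : Function.Injective e := fun a b h => by
      simp only [e] at h
      exact_mod_cast (sub_left_inj.mp h)
    have hrange : ∀ m : ℤ, m ∉ Set.range e →
        (c m : ℂ) * Complex.exp (2 * π * Complex.I * m * (τ : ℂ)) = 0 := by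
      intro m hm
      have hm' : m < -(n : ℤ) := by
        by_contra hle
        push Not at hle
        exact hm ⟨(m + n).toNat, by simp only [e]; omega⟩
      simp [hc0 m hm']
    refine (he.hasSum_iff hrange).mp ?_
    have hfun : ((fun m : ℤ => (c m : ℂ) * Complex.exp (2 * π * Complex.I * m * (τ : ℂ))) ∘ e) =
        fun i : ℕ => (qExpansion 1 (fun z : ℍ => g z * G z)).coeff i •
            Periodic.qParam 1 (τ : ℂ) ^ i * ((Complex.exp (2 * π * Complex.I * (τ : ℂ))) ^ n)⁻¹ := by
      funext i
      simp only [Function.comp_apply, e]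
      have hci : c ((i : ℤ) - n) = W.coeff i := by
        simp only [hc]
        rw [if_neg (by omega), show ((i : ℤ) - n + n).toNat = i by omega]
      rw [hci, hqH, PowerSeries.coeff_map, eq_ratCast, hq]
      push_cast
      rw [show 2 * (π : ℂ) * Complex.I * ((i : ℂ) - n) * (τ : ℂ) =
          (i : ℂ) * (2 * π * Complex.I * (τ : ℂ)) - (n : ℂ) * (2 * π * Complex.I * (τ : ℂ)) by ring,
        Complex.exp_sub, Complex.exp_nat_mul, Complex.exp_nat_mul]
      rw [smul_eq_mul]
      field_simp
    rw [hfun]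
    exact hGsum
  -- holomorphy and invariance of weight `k - 12n`
  have hmd : MDiff (fun z : ℍ => g z / ModularForm.discriminant z ^ n) := by
    rw [UpperHalfPlane.mdifferentiable_iff]
    have hΔ : DifferentiableOn ℂ (ModularForm.discriminant ∘ ofComplex) {z : ℂ | 0 < z.im} :=
      UpperHalfPlane.mdifferentiable_iff.mp (ModularFormClass.holo CuspForm.discriminant)
    have hg' : DifferentiableOn ℂ (⇑g ∘ ofComplex) {z : ℂ | 0 < z.im} :=
      UpperHalfPlane.mdifferentiable_iff.mp (ModularFormClass.holo g)
    exact (hg'.div (hΔ.pow n) fun w hw => pow_ne_zero _ (ModularForm.discriminant_ne_zero _)).congr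
      fun w _ => by simp [Function.comp]
  have hslash : ∀ γ : SL(2, ℤ),
      (fun z : ℍ => g z / ModularForm.discriminant z ^ n) ∣[k - 12 * n] (γ : GL (Fin 2) ℝ) =
        fun z : ℍ => g z / ModularForm.discriminant z ^ n := by
    intro γ
    have hmem : (γ : GL (Fin 2) ℝ) ∈ 𝒮ℒ := ⟨γ, rfl⟩
    funext z
    rw [ModularForm.slash_def]
    have hΔ := SlashInvariantForm.slash_action_eqn'' CuspForm.discriminant hmem z
    have hgγ := SlashInvariantForm.slash_action_eqn'' g hmem z
    simp only [CuspForm.coe_discriminant] at hΔ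
    have hdet : ((γ : GL (Fin 2) ℝ).det : ℝ) = 1 := by simp
    simp only [hdet]
    rw [show ((γ : GL (Fin 2) ℝ) • z) = γ • z from rfl] at hΔ hgγ ⊢
    rw [hΔ, hgγ]
    have hd : denom (γ : GL (Fin 2) ℝ) z ≠ 0 := denom_ne_zero _ z
    have hΔ0 : ModularForm.discriminant z ≠ 0 := ModularForm.discriminant_ne_zero z
    have hdk : denom (γ : GL (Fin 2) ℝ) z ^ k ≠ 0 := zpow_ne_zero _ hd
    have hd12 : denom (γ : GL (Fin 2) ℝ) z ^ (12 : ℤ) ≠ 0 := zpow_ne_zero _ hd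
    have hd12n : denom (γ : GL (Fin 2) ℝ) z ^ (12 * (n : ℤ)) ≠ 0 := zpow_ne_zero _ hd
    simp only [UpperHalfPlane.σ]
    norm_num
    rw [zpow_sub₀ hd (12 * (n : ℤ)) k, mul_pow, ← zpow_natCast (denom (γ : GL (Fin 2) ℝ) z ^ (12 : ℤ)) n,
      ← zpow_mul]
    field_simp
  exact
    { mdifferentiable := hmd
      slash_eq := fun γ _ => hslash γ
      finite_principalPart := ⟨n, fun m hm => hc0 m hm⟩
      hasSum_fourier := hsum
      isBoundedAtImInfty_slash := fun γ hγ => absurd (mem_Gamma0_one γ) hγ }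

end DeltaPow

/-- **Non-vacuity of `GKZAlgebraicity` with a genuine pole in every weight.** For every `r ≥ 1`
there is a rational form `f ∈ M^{!,∞}_{-2r}(SL(2, ℤ))` (in the sense of
`IsRatWeaklyHolomorphicForm 1 (-2r) f c`) whose principal part has exact order `n ≥ 1`
(`c(-n) = 1`, `c(m) = 0` for `m < -n`): writing `r = 6j + i`, `0 ≤ i ≤ 5`, take `f = E_k/Δⁿ`
with `(k, n) = (12 - 2i, j + 1)` for `i ≤ 4` and `(14, j + 2)` for `i = 5`
(`exists_isRatWeaklyHolomorphicForm_div_discriminant_pow`, `E_k(i∞) = 1`). So the hypothesis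
class of Conjecture 1.1 of Bruinier–Li–Yang 2025 has members with nonzero principal part for
every `r ≥ 1` (already at level one). [folklore] -/
theorem exists_isRatWeaklyHolomorphicForm_levelOne (r : ℕ) :
    ∃ (n : ℕ) (f : ℍ → ℂ) (c : ℤ → ℚ), 0 < n ∧ IsRatWeaklyHolomorphicForm 1 (-2 * (r : ℤ)) f c ∧
      c (-(n : ℤ)) = 1 ∧ ∀ m : ℤ, m < -(n : ℤ) → c m = 0 := by
  -- `r = 6j + i`
  obtain ⟨j, i, hi, rfl⟩ : ∃ j i : ℕ, i < 6 ∧ r = 6 * j + i :=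
    ⟨r / 6, r % 6, Nat.mod_lt _ (by norm_num), (Nat.div_add_mod r 6).symm⟩
  by_cases h5 : i = 5
  · subst h5
    obtain ⟨c, hc, hc1, hc0⟩ := exists_isRatWeaklyHolomorphicForm_div_discriminant_pow
      (ModularForm.E (k := 14) (by norm_num)) (exists_ratPowerSeries_E (by norm_num) ⟨7, rfl⟩) (j + 2)
    have hw : ((14 : ℕ) : ℤ) - 12 * ((j + 2 : ℕ) : ℤ) = -2 * ((6 * j + 5 : ℕ) : ℤ) := by
      push_cast; ring
    rw [hw] at hc
    refine ⟨j + 2, _, c, by omega, hc, ?_, hc0⟩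
    rw [EisensteinSeries.E_qExpansion_coeff_zero (by norm_num) ⟨7, rfl⟩] at hc1
    exact_mod_cast hc1
  · have hi4 : i ≤ 4 := by omega
    have hk3 : 3 ≤ 12 - 2 * i := by omega
    have hk2 : Even (12 - 2 * i) := ⟨6 - i, by omega⟩
    obtain ⟨c, hc, hc1, hc0⟩ := exists_isRatWeaklyHolomorphicForm_div_discriminant_pow
      (ModularForm.E hk3) (exists_ratPowerSeries_E hk3 hk2) (j + 1)
    have hw : ((12 - 2 * i : ℕ) : ℤ) - 12 * ((j + 1 : ℕ) : ℤ) = -2 * ((6 * j + i : ℕ) : ℤ) := by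
      have : ((12 - 2 * i : ℕ) : ℤ) = 12 - 2 * (i : ℤ) := by omega
      rw [this]
      push_cast
      ring
    rw [hw] at hc
    refine ⟨j + 1, _, c, by omega, hc, ?_, hc0⟩
    rw [EisensteinSeries.E_qExpansion_coeff_zero hk3 hk2] at hc1
    exact_mod_cast hc1

/-- In particular, for every `r ≥ 1` the level-one hypothesis class of `GKZAlgebraicity` contains a
form whose divisor `Z_f` is a genuine (non-empty) union of Hecke correspondences: some
`c(-m) ≠ 0`, `m ≥ 1`. [folklore] -/
theorem exists_isRatWeaklyHolomorphicForm_coeff_ne_zero (r : ℕ) :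
    ∃ (f : ℍ → ℂ) (c : ℤ → ℚ) (m : ℕ+), IsRatWeaklyHolomorphicForm 1 (-2 * (r : ℤ)) f c ∧
      c (-(m : ℤ)) ≠ 0 := by
  obtain ⟨n, f, c, hn, hf, hc1, -⟩ := exists_isRatWeaklyHolomorphicForm_levelOne r
  exact ⟨f, c, ⟨n, hn⟩, hf, by rw [PNat.mk_coe, hc1]; exact one_ne_zero⟩

section PrimeLevel

open UpperHalfPlane Complex CongruenceSubgroup Function
open scoped MatrixGroups ModularForm Manifold

open Literature.NumberTheory.EllipticCurves.ModularForms (intGL intGL_apply coe_intGL intGL_mul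
  mapGL_eq_intGL)

/-! ### The scaling matrix `diag(p, 1)`: `z ↦ pz` -/

/-- `diag(m, 1) ∈ R_N^{(m)}` for every `N`. [folklore] -/
theorem levelScale_mem_heckeMatrices (N : ℕ) (m : ℤ) : !![m, 0; 0, 1] ∈ heckeMatrices N m := by
  rw [mem_heckeMatrices, Matrix.det_fin_two]
  simp

/-- `diag(m, 1) z = m z` for `m > 0`. [folklore] -/
theorem coe_levelScale_smul {m : ℤ} (hm : 0 < m) (z : ℍ) :
    ((intGL !![m, 0; 0, 1] • z : ℍ) : ℂ) = (m : ℂ) * (z : ℂ) := by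
  rw [coe_intGL_smul hm (levelScale_mem_heckeMatrices 1 m) z]
  simp

/-- `Im(diag(m, 1) z) = m Im z`. [folklore] -/
theorem im_levelScale_smul {m : ℤ} (hm : 0 < m) (z : ℍ) :
    (intGL !![m, 0; 0, 1] • z).im = (m : ℝ) * z.im := by
  rw [← UpperHalfPlane.coe_im, coe_levelScale_smul hm]
  simp

/-- `Im(diag(m, 1) z) → ∞` as `Im z → ∞` (`m > 0`). [folklore] -/
theorem tendsto_levelScale_smul_atImInfty {m : ℤ} (hm : 0 < m) :
    Tendsto (fun z : ℍ => intGL !![m, 0; 0, 1] • z) atImInfty atImInfty :=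
  tendsto_intGL_upper_smul_atImInfty hm one_pos

/-! ### `Δ(pz)` is a weight-12 form for `Γ₀(p)` -/

/-- **`Δ(p γz) = (cz + d)¹² Δ(pz)` for `γ ∈ Γ₀(p)`**: `diag(p,1) γ = γ' diag(p,1)` with
`γ' = (a, pb; c/p, d) ∈ SL(2, ℤ)`, and `j(γ', pz) = (c/p)(pz) + d = cz + d`. (Any `p ≥ 1`.)
[folklore] -/
theorem discriminant_levelScale_smul_gamma0 {p : ℕ} (hp : 0 < p) {γ : SL(2, ℤ)} (hγ : γ ∈ Gamma0 p)
    (z : ℍ) :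
    ModularForm.discriminant (intGL !![(p : ℤ), 0; 0, 1] • γ • z) =
      denom (γ : GL (Fin 2) ℝ) z ^ (12 : ℤ) *
        ModularForm.discriminant (intGL !![(p : ℤ), 0; 0, 1] • z) := by
  have hp' : (0 : ℤ) < p := by exact_mod_cast hp
  obtain ⟨e, he⟩ : (p : ℤ) ∣ (γ : Matrix (Fin 2) (Fin 2) ℤ) 1 0 :=
    (ZMod.intCast_zmod_eq_zero_iff_dvd _ p).mp (Gamma0_mem.mp hγ)
  have hdet : (γ : Matrix (Fin 2) (Fin 2) ℤ) 0 0 * (γ : Matrix (Fin 2) (Fin 2) ℤ) 1 1 -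
      (γ : Matrix (Fin 2) (Fin 2) ℤ) 0 1 * (γ : Matrix (Fin 2) (Fin 2) ℤ) 1 0 = 1 := by
    have h1 := γ.det_coe
    rw [Matrix.det_fin_two] at h1
    exact h1
  have hdet' : Matrix.det !![(γ : Matrix (Fin 2) (Fin 2) ℤ) 0 0, (p : ℤ) * (γ : Matrix (Fin 2) (Fin 2) ℤ) 0 1;
      e, (γ : Matrix (Fin 2) (Fin 2) ℤ) 1 1] = 1 := by
    rw [Matrix.det_fin_two]
    simp only [Matrix.of_apply, Matrix.cons_val', Matrix.cons_val_zero, Matrix.cons_val_one,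
      Matrix.cons_val_fin_one]
    rw [he] at hdet
    linear_combination hdet
  set γ' : SL(2, ℤ) := ⟨_, hdet'⟩ with hγ'
  clear_value γ'
  have hP : (!![(p : ℤ), 0; 0, 1] : Matrix (Fin 2) (Fin 2) ℤ).det ≠ 0 := by
    rw [Matrix.det_fin_two]
    simp only [Matrix.of_apply, Matrix.cons_val', Matrix.cons_val_zero, Matrix.cons_val_one,
      Matrix.cons_val_fin_one]
    omega
  have hmat : !![(p : ℤ), 0; 0, 1] * (γ : Matrix (Fin 2) (Fin 2) ℤ) =
      (γ' : Matrix (Fin 2) (Fin 2) ℤ) * !![(p : ℤ), 0; 0, 1] := by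
    ext i j
    fin_cases i <;> fin_cases j <;>
      simp [Matrix.mul_apply, Fin.sum_univ_two, hγ', he] <;> ring
  have h1 : intGL !![(p : ℤ), 0; 0, 1] • γ • z = γ' • (intGL !![(p : ℤ), 0; 0, 1] • z) := by
    rw [sl_smul_eq_intGL_smul, sl_smul_eq_intGL_smul, ← mul_smul, ← mul_smul,
      ← intGL_mul hP (by rw [γ.det_coe]; exact one_ne_zero),
      ← intGL_mul (by rw [γ'.det_coe]; exact one_ne_zero) hP, hmat]
  have hmem : (γ' : GL (Fin 2) ℝ) ∈ 𝒮ℒ := ⟨γ', rfl⟩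
  have h2 := SlashInvariantForm.slash_action_eqn'' CuspForm.discriminant hmem
    (intGL !![(p : ℤ), 0; 0, 1] • z)
  simp only [CuspForm.coe_discriminant] at h2
  rw [show ((γ' : GL (Fin 2) ℝ) • (intGL !![(p : ℤ), 0; 0, 1] • z)) =
    γ' • (intGL !![(p : ℤ), 0; 0, 1] • z) from rfl] at h2
  have hden : denom (γ' : GL (Fin 2) ℝ) ((intGL !![(p : ℤ), 0; 0, 1] • z : ℍ) : ℂ) =
      denom (γ : GL (Fin 2) ℝ) (z : ℂ) := by
    rw [ModularGroup.denom_apply, ModularGroup.denom_apply, coe_levelScale_smul hp']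
    have h10 : ((γ' 1 0 : ℤ) : ℂ) = e := by rw [hγ']; rfl
    have h11 : ((γ' 1 1 : ℤ) : ℂ) = ((γ : Matrix (Fin 2) (Fin 2) ℤ) 1 1 : ℂ) := by rw [hγ']; rfl
    have hce : (((γ : Matrix (Fin 2) (Fin 2) ℤ) 1 0 : ℤ) : ℂ) = (p : ℂ) * e := by exact_mod_cast he
    push_cast
    rw [h10, h11, hce]
    ring
  rw [h1, h2, hden]

/-! ### Composition with `z ↦ mz`: holomorphy, periodicity, boundedness, `q`-expansion -/

/-- `diag(m,1) · ofComplex w = ofComplex (m w)` for `Im w > 0`. [folklore] -/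
theorem levelScale_smul_ofComplex {m : ℤ} (hm : 0 < m) {w : ℂ} (hw : 0 < w.im) :
    intGL !![m, 0; 0, 1] • ofComplex w = ofComplex ((m : ℂ) * w) := by
  have hw' : 0 < ((m : ℂ) * w).im := by
    simp only [Complex.mul_im, Complex.intCast_re, Complex.intCast_im, zero_mul, add_zero]
    exact mul_pos (by exact_mod_cast hm) hw
  apply UpperHalfPlane.ext
  rw [coe_levelScale_smul hm, ofComplex_apply_of_im_pos hw, ofComplex_apply_of_im_pos hw']

/-- `F(mz)` is holomorphic if `F` is. [folklore] -/
theorem mdifferentiable_comp_levelScale_smul {F : ℍ → ℂ} (hF : MDiff F) {m : ℤ} (hm : 0 < m) :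
    MDiff (fun z : ℍ => F (intGL !![m, 0; 0, 1] • z)) := by
  rw [UpperHalfPlane.mdifferentiable_iff] at hF ⊢
  have hmul : DifferentiableOn ℂ (fun w : ℂ => (m : ℂ) * w) {w : ℂ | 0 < w.im} :=
    (differentiable_id.const_mul _).differentiableOn
  have hmaps : Set.MapsTo (fun w : ℂ => (m : ℂ) * w) {w : ℂ | 0 < w.im} {w : ℂ | 0 < w.im} := by
    intro w hw
    simp only [Set.mem_setOf_eq, Complex.mul_im, Complex.intCast_re, Complex.intCast_im, zero_mul,
      add_zero] at hw ⊢
    exact mul_pos (by exact_mod_cast hm) hw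
  refine (hF.comp hmul hmaps).congr fun w hw => ?_
  simp only [Function.comp_apply]
  rw [levelScale_smul_ofComplex hm hw]

/-- `F(mz)` (through `ofComplex`) is `1`-periodic if `F` is. [folklore] -/
theorem periodic_comp_levelScale_smul {F : ℍ → ℂ} (hF : Periodic (F ∘ ofComplex) 1) {m : ℕ}
    (hm : 0 < m) :
    Periodic ((fun z : ℍ => F (intGL !![(m : ℤ), 0; 0, 1] • z)) ∘ ofComplex) 1 := by
  have hm' : (0 : ℤ) < m := by exact_mod_cast hm
  intro w
  simp only [Function.comp_apply]
  by_cases hw : 0 < w.im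
  · have hw1 : 0 < (w + 1).im := by simpa using hw
    rw [levelScale_smul_ofComplex hm' hw, levelScale_smul_ofComplex hm' hw1]
    have hper := hF.nat_mul m
    have := hper ((m : ℂ) * w)
    simp only [Function.comp_apply] at this
    push_cast at this ⊢
    rw [show ((m : ℂ)) * (w + 1) = (m : ℂ) * w + (m : ℂ) * 1 by ring, this]
  · push Not at hw
    have hw' : (w + 1).im ≤ 0 := by simpa using hw
    rw [ofComplex_apply_eq_of_im_nonpos hw' hw]

/-- `F(mz)` is bounded at `i∞` if `F` is. [folklore] -/
theorem isBoundedAtImInfty_comp_levelScale_smul {F : ℍ → ℂ} (hF : IsBoundedAtImInfty F) {m : ℤ}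
    (hm : 0 < m) : IsBoundedAtImInfty (fun z : ℍ => F (intGL !![m, 0; 0, 1] • z)) := by
  rw [UpperHalfPlane.isBoundedAtImInfty_iff] at hF ⊢
  obtain ⟨C, A, hA⟩ := hF
  refine ⟨C, max A 0, fun z hz => hA _ ?_⟩
  rw [im_levelScale_smul hm]
  have h1 : (1 : ℝ) ≤ m := by exact_mod_cast hm
  nlinarith [le_max_left A 0, le_max_right A 0, z.im_pos]

/-- `q(mz) = q(z)ᵐ`. [folklore] -/
theorem qParam_levelScale_smul {m : ℕ} (hm : 0 < m) (z : ℍ) :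
    Periodic.qParam 1 ((intGL !![(m : ℤ), 0; 0, 1] • z : ℍ) : ℂ) = Periodic.qParam 1 (z : ℂ) ^ m := by
  have hm' : (0 : ℤ) < m := by exact_mod_cast hm
  simp only [Periodic.qParam, Complex.ofReal_one, div_one]
  rw [coe_levelScale_smul hm', ← Complex.exp_nat_mul]
  push_cast
  ring_nf

/-- **The `q`-expansion of `F(mz)`**: if `F` is `1`-periodic, holomorphic and bounded at `i∞` with
`qExpansion F = Σ aₙ Xⁿ`, then `qExpansion (F(m·)) = Σ aₙ X^{mn}` (coefficient `a_{k/m}` at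
`k ∈ mℕ`, `0` otherwise). [folklore] -/
theorem qExpansion_comp_levelScale_smul {F : ℍ → ℂ} (hper : Periodic (F ∘ ofComplex) 1) (hmd : MDiff F)
    (hbdd : IsBoundedAtImInfty F) {m : ℕ} (hm : 0 < m) :
    qExpansion 1 (fun z : ℍ => F (intGL !![(m : ℤ), 0; 0, 1] • z)) =
      PowerSeries.mk fun k => if m ∣ k then (qExpansion 1 F).coeff (k / m) else 0 := by
  have hm' : (0 : ℤ) < m := by exact_mod_cast hm
  set Fm : ℍ → ℂ := fun z : ℍ => F (intGL !![(m : ℤ), 0; 0, 1] • z) with hFm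
  set c : ℕ → ℂ := fun k => if m ∣ k then (qExpansion 1 F).coeff (k / m) else 0 with hc
  have han := analyticAt_cuspFunction_zero one_pos (periodic_comp_levelScale_smul hper hm)
    (mdifferentiable_comp_levelScale_smul hmd hm') (isBoundedAtImInfty_comp_levelScale_smul hbdd hm')
  -- the `q`-series of `F(mz)`
  have hsum : ∀ τ : ℍ, HasSum (fun k : ℕ => c k • Periodic.qParam 1 (τ : ℂ) ^ k) (Fm τ) := by
    intro τ
    have h := hasSum_qExpansion one_pos hper hmd hbdd (intGL !![(m : ℤ), 0; 0, 1] • τ)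
    rw [qParam_levelScale_smul hm] at h
    let e : ℕ → ℕ := fun n => m * n
    have he : Function.Injective e := fun a b hab => Nat.eq_of_mul_eq_mul_left hm hab
    have hrange : ∀ k : ℕ, k ∉ Set.range e → c k • Periodic.qParam 1 (τ : ℂ) ^ k = 0 := by
      intro k hk
      have hk' : ¬ m ∣ k := fun ⟨n, hn⟩ => hk ⟨n, hn.symm⟩
      simp [hc, hk']
    refine (he.hasSum_iff hrange).mp ?_
    have hfun : ((fun k : ℕ => c k • Periodic.qParam 1 (τ : ℂ) ^ k) ∘ e) =
        fun n : ℕ => (qExpansion 1 F).coeff n • (Periodic.qParam 1 (τ : ℂ) ^ m) ^ n := by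
      funext n
      simp only [Function.comp_apply, e, hc, dvd_mul_right, if_true, Nat.mul_div_cancel_left _ hm,
        pow_mul]
    rw [hfun]
    exact h
  -- uniqueness of power series
  have h1 := (hasFPowerSeriesOnBall_cuspFunction one_pos han hsum).hasFPowerSeriesAt
  have h2 : HasFPowerSeriesAt (cuspFunction 1 Fm)
      (FormalMultilinearSeries.ofScalars ℂ fun k => (qExpansion 1 Fm).coeff k) 0 := by
    simpa [qExpansion_coeff, div_eq_mul_inv, mul_comm] using han.hasFPowerSeriesAt
  have heq := h1.eq_formalMultilinearSeries h2
  ext k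
  have hk := congr_arg (fun q : FormalMultilinearSeries ℂ ℂ ℂ => q.coeff k) heq
  simp only [FormalMultilinearSeries.coeff_ofScalars] at hk
  rw [PowerSeries.coeff_mk, ← hk]


/-! ### The other cusp of `X₀(p)`: `diag(p,1) γ = g (1 B; 0 p)` for `p ∤ c` -/

/-- **Bringing `diag(p,1)γ` to Hermite form.** For `γ = (a b; c d) ∈ SL(2, ℤ)` with
`gcd(pa, c) = 1` (e.g. `p` prime, `p ∤ c`), Bézout `u(pa) + vc = 1` gives
`diag(p, 1) γ = g T` with `g = (pa, -v; c, u) ∈ SL(2, ℤ)` and `T = (1, B; 0, p)`,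
`B = upb + vd`. [folklore] -/
theorem exists_levelScale_mul_eq_mul_upper {p : ℤ} {γ : SL(2, ℤ)}
    (hcop : IsCoprime (p * (γ : Matrix (Fin 2) (Fin 2) ℤ) 0 0) ((γ : Matrix (Fin 2) (Fin 2) ℤ) 1 0)) :
    ∃ (g : SL(2, ℤ)) (B : ℤ), (g : Matrix (Fin 2) (Fin 2) ℤ) 1 0 = (γ : Matrix (Fin 2) (Fin 2) ℤ) 1 0 ∧
      (p : ℤ) * (g : Matrix (Fin 2) (Fin 2) ℤ) 1 1 +
          (γ : Matrix (Fin 2) (Fin 2) ℤ) 1 0 * B = (γ : Matrix (Fin 2) (Fin 2) ℤ) 1 1 ∧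
      !![p, 0; 0, 1] * (γ : Matrix (Fin 2) (Fin 2) ℤ) = (g : Matrix (Fin 2) (Fin 2) ℤ) * !![1, B; 0, p] := by
  obtain ⟨u, v, huv⟩ := hcop
  have hdet : (γ : Matrix (Fin 2) (Fin 2) ℤ) 0 0 * (γ : Matrix (Fin 2) (Fin 2) ℤ) 1 1 -
      (γ : Matrix (Fin 2) (Fin 2) ℤ) 0 1 * (γ : Matrix (Fin 2) (Fin 2) ℤ) 1 0 = 1 := by
    have h1 := γ.det_coe
    rw [Matrix.det_fin_two] at h1
    exact h1
  have hdetg : Matrix.det !![p * (γ : Matrix (Fin 2) (Fin 2) ℤ) 0 0, -v;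
      (γ : Matrix (Fin 2) (Fin 2) ℤ) 1 0, u] = 1 := by
    rw [Matrix.det_fin_two]
    simp only [Matrix.of_apply, Matrix.cons_val', Matrix.cons_val_zero, Matrix.cons_val_one,
      Matrix.cons_val_fin_one]
    linear_combination huv
  set B : ℤ := u * p * (γ : Matrix (Fin 2) (Fin 2) ℤ) 0 1 + v * (γ : Matrix (Fin 2) (Fin 2) ℤ) 1 1
    with hB
  refine ⟨⟨_, hdetg⟩, B, rfl, ?_, ?_⟩
  · show p * u + (γ : Matrix (Fin 2) (Fin 2) ℤ) 1 0 * B = (γ : Matrix (Fin 2) (Fin 2) ℤ) 1 1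
    rw [hB]
    linear_combination ((γ : Matrix (Fin 2) (Fin 2) ℤ) 1 1) * huv - (p * u) * hdet
  · ext i j
    fin_cases i <;> fin_cases j <;>
      simp [Matrix.mul_apply, Fin.sum_univ_two, hB]
    · linear_combination (-(p * (γ : Matrix (Fin 2) (Fin 2) ℤ) 0 1)) * huv - (p * v) * hdet
    · linear_combination (-(γ : Matrix (Fin 2) (Fin 2) ℤ) 1 1) * huv + (p * u) * hdet


/-- **The Fourier-side of the cusp `0` of `X₀(p)`.** For `γ = (a b; c d) ∈ SL(2, ℤ)` with
`gcd(pa, c) = 1` there is `B ∈ ℤ` such that, with `τ = (z + B)/p`,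
`(f ∣₋₁₂ γ)(z) = p²⁴ Δ(z)/Δ(τ)²` for `f = Δ(z)/Δ(pz)²`: indeed `diag(p,1)γ = gT`,
`T = (1 B; 0 p)`, so `Δ(p·γz) = Δ(gτ) = j(g, τ)¹² Δ(τ)` and `j(γ, z) = p j(g, τ)`. [folklore] -/
theorem exists_slash_discriminant_div_sq_eq {p : ℕ} (hp : 0 < p) {γ : SL(2, ℤ)}
    (hcop : IsCoprime ((p : ℤ) * (γ : Matrix (Fin 2) (Fin 2) ℤ) 0 0)
      ((γ : Matrix (Fin 2) (Fin 2) ℤ) 1 0)) :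
    ∃ B : ℤ, ∀ z : ℍ,
      ((fun w : ℍ => ModularForm.discriminant w /
          ModularForm.discriminant (intGL !![(p : ℤ), 0; 0, 1] • w) ^ 2) ∣[(-12 : ℤ)]
          (γ : GL (Fin 2) ℝ)) z =
        (p : ℂ) ^ 24 * ModularForm.discriminant z /
          ModularForm.discriminant (intGL !![1, B; 0, (p : ℤ)] • z) ^ 2 := by
  obtain ⟨g, B, hg10, hg11, hmat⟩ := exists_levelScale_mul_eq_mul_upper hcop
  refine ⟨B, fun z => ?_⟩
  have hp' : (0 : ℤ) < p := by exact_mod_cast hp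
  have hP : (!![(p : ℤ), 0; 0, 1] : Matrix (Fin 2) (Fin 2) ℤ).det ≠ 0 := by
    rw [Matrix.det_fin_two]
    simp only [Matrix.of_apply, Matrix.cons_val', Matrix.cons_val_zero, Matrix.cons_val_one,
      Matrix.cons_val_fin_one]
    omega
  have hT : (!![1, B; 0, (p : ℤ)] : Matrix (Fin 2) (Fin 2) ℤ) ∈ heckeMatrices 1 p := by
    rw [mem_heckeMatrices, Matrix.det_fin_two]
    simp
  have hTdet : (!![1, B; 0, (p : ℤ)] : Matrix (Fin 2) (Fin 2) ℤ).det ≠ 0 :=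
    det_ne_zero_of_mem_heckeMatrices hp'.ne' hT
  set τ : ℍ := intGL !![1, B; 0, (p : ℤ)] • z with hτ
  -- `diag(p,1) γ z = g τ`
  have h1 : intGL !![(p : ℤ), 0; 0, 1] • γ • z = g • τ := by
    rw [sl_smul_eq_intGL_smul, sl_smul_eq_intGL_smul, hτ, ← mul_smul, ← mul_smul,
      ← intGL_mul hP (by rw [γ.det_coe]; exact one_ne_zero),
      ← intGL_mul (by rw [g.det_coe]; exact one_ne_zero) hTdet, hmat]
  -- the two automorphy relations for `Δ`
  have hmemγ : (γ : GL (Fin 2) ℝ) ∈ 𝒮ℒ := ⟨γ, rfl⟩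
  have hmemg : (g : GL (Fin 2) ℝ) ∈ 𝒮ℒ := ⟨g, rfl⟩
  have hΔγ := SlashInvariantForm.slash_action_eqn'' CuspForm.discriminant hmemγ z
  have hΔg := SlashInvariantForm.slash_action_eqn'' CuspForm.discriminant hmemg τ
  simp only [CuspForm.coe_discriminant] at hΔγ hΔg
  rw [show ((γ : GL (Fin 2) ℝ) • z) = γ • z from rfl] at hΔγ
  rw [show ((g : GL (Fin 2) ℝ) • τ) = g • τ from rfl] at hΔg
  -- the denominators: `j(γ, z) = p j(g, τ)`
  have hden : denom (γ : GL (Fin 2) ℝ) (z : ℂ) = (p : ℂ) * denom (g : GL (Fin 2) ℝ) (τ : ℂ) := by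
    rw [ModularGroup.denom_apply, ModularGroup.denom_apply, hτ, coe_intGL_smul hp' hT z]
    simp only [Matrix.of_apply, Matrix.cons_val', Matrix.cons_val_zero, Matrix.cons_val_one,
      Matrix.cons_val_fin_one, Int.cast_one, one_mul, Int.cast_zero, zero_mul, zero_add]
    have hp0 : (p : ℂ) ≠ 0 := by exact_mod_cast hp.ne'
    have hg11' : (p : ℂ) * ((g : Matrix (Fin 2) (Fin 2) ℤ) 1 1 : ℂ) +
        ((γ : Matrix (Fin 2) (Fin 2) ℤ) 1 0 : ℂ) * (B : ℂ) = ((γ : Matrix (Fin 2) (Fin 2) ℤ) 1 1 : ℂ) := by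
      exact_mod_cast hg11
    have hg10' : ((g : Matrix (Fin 2) (Fin 2) ℤ) 1 0 : ℂ) = ((γ : Matrix (Fin 2) (Fin 2) ℤ) 1 0 : ℂ) := by
      exact_mod_cast hg10
    push_cast
    rw [hg10']
    field_simp
    linear_combination -hg11'
  -- assemble
  rw [show ((fun w : ℍ => ModularForm.discriminant w /
      ModularForm.discriminant (intGL !![(p : ℤ), 0; 0, 1] • w) ^ 2) ∣[(-12 : ℤ)]
      (γ : GL (Fin 2) ℝ)) = ((fun w : ℍ => ModularForm.discriminant w /
      ModularForm.discriminant (intGL !![(p : ℤ), 0; 0, 1] • w) ^ 2) ∣[(-12 : ℤ)] γ) from rfl,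
    ModularForm.SL_slash_apply]
  simp only [neg_neg]
  rw [h1, hΔγ, hΔg, hden]
  have hgτ : denom (g : GL (Fin 2) ℝ) (τ : ℂ) ≠ 0 := denom_ne_zero _ _
  have hΔτ : ModularForm.discriminant τ ≠ 0 := ModularForm.discriminant_ne_zero τ
  have hp0 : (p : ℂ) ≠ 0 := by exact_mod_cast hp.ne'
  simp only [zpow_ofNat]
  field_simp

/-- `Im((z + B)/p) = Im z / p`. [folklore] -/
theorem im_upper_one_smul {p : ℤ} (hp : 0 < p) (B : ℤ) (z : ℍ) :
    (intGL !![1, B; 0, p] • z).im = z.im / p := by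
  have hT : (!![1, B; 0, p] : Matrix (Fin 2) (Fin 2) ℤ) ∈ heckeMatrices 1 p := by
    rw [mem_heckeMatrices, Matrix.det_fin_two]
    simp
  rw [im_intGL_smul hp hT]
  simp only [Matrix.of_apply, Matrix.cons_val', Matrix.cons_val_zero, Matrix.cons_val_one,
    Matrix.cons_val_fin_one, Int.cast_zero, zero_mul, zero_add, Complex.normSq_intCast]
  have hp0 : (p : ℝ) ≠ 0 := by exact_mod_cast hp.ne'
  field_simp

/-- **Boundedness at the cusp `0`**: `p²⁴ Δ(z)/Δ((z + B)/p)²` is bounded as `Im z → ∞` for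
`p ≥ 2`, since `|Δ(z)| ≍ e^{-2π Im z}` and `|Δ((z+B)/p)|² ≍ e^{-4π Im z/p}` (`Δ/q → 1`).
[folklore] -/
theorem isBoundedAtImInfty_discriminant_div_sq {p : ℕ} (hp : 2 ≤ p) (B : ℤ) :
    IsBoundedAtImInfty (fun z : ℍ => (p : ℂ) ^ 24 * ModularForm.discriminant z /
      ModularForm.discriminant (intGL !![1, B; 0, (p : ℤ)] • z) ^ 2) := by
  have hp0 : 0 < p := by omega
  have hp' : (0 : ℤ) < p := by exact_mod_cast hp0
  -- `‖Δ(z)‖ ≤ 2 ‖q(z)‖` eventually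
  have hev1 : ∀ᶠ z : ℍ in atImInfty,
      ‖ModularForm.discriminant z‖ ≤ 2 * ‖Periodic.qParam 1 (z : ℂ)‖ := by
    have h := (tendsto_qParam_div_discriminant.inv₀ one_ne_zero)
    rw [inv_one] at h
    have h' : ∀ᶠ z : ℍ in atImInfty,
        dist ((Periodic.qParam 1 (z : ℂ) / ModularForm.discriminant z)⁻¹) 1 < 1 :=
      h (Metric.ball_mem_nhds 1 one_pos)
    filter_upwards [h'] with z hz
    rw [inv_div, Complex.dist_eq] at hz
    have hq : Periodic.qParam 1 (z : ℂ) ≠ 0 := Complex.exp_ne_zero _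
    have h2 : ‖ModularForm.discriminant z / Periodic.qParam 1 (z : ℂ)‖ ≤ 2 := by
      have := norm_sub_norm_le (ModularForm.discriminant z / Periodic.qParam 1 (z : ℂ)) 1
      rw [norm_one] at this
      linarith
    rw [norm_div, div_le_iff₀ (norm_pos_iff.mpr hq)] at h2
    linarith
  -- `‖q(w)‖ ≤ 2 ‖Δ(w)‖` eventually, transported along `w = (z + B)/p`
  have hev2 : ∀ᶠ w : ℍ in atImInfty,
      ‖Periodic.qParam 1 (w : ℂ)‖ ≤ 2 * ‖ModularForm.discriminant w‖ := by
    have h' : ∀ᶠ w : ℍ in atImInfty,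
        dist (Periodic.qParam 1 (w : ℂ) / ModularForm.discriminant w) 1 < 1 :=
      tendsto_qParam_div_discriminant (Metric.ball_mem_nhds 1 one_pos)
    filter_upwards [h'] with w hw
    rw [Complex.dist_eq] at hw
    have hΔ : ModularForm.discriminant w ≠ 0 := ModularForm.discriminant_ne_zero w
    have h2 : ‖Periodic.qParam 1 (w : ℂ) / ModularForm.discriminant w‖ ≤ 2 := by
      have := norm_sub_norm_le (Periodic.qParam 1 (w : ℂ) / ModularForm.discriminant w) 1
      rw [norm_one] at this
      linarith
    rw [norm_div, div_le_iff₀ (norm_pos_iff.mpr hΔ)] at h2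
    linarith
  have hev2' := (tendsto_intGL_upper_smul_atImInfty (a := 1) (b := B) one_pos hp').eventually hev2
  -- combine
  rw [UpperHalfPlane.isBoundedAtImInfty_iff]
  obtain ⟨A, hA⟩ := (atImInfty_mem _).mp (hev1.and hev2')
  refine ⟨8 * (p : ℝ) ^ 24, max A 0, fun z hz => ?_⟩
  have hzA : A ≤ z.im := le_trans (le_max_left _ _) hz
  obtain ⟨h1, h2⟩ := hA z hzA
  set τ : ℍ := intGL !![1, B; 0, (p : ℤ)] • z with hτ
  have hΔτ : ModularForm.discriminant τ ≠ 0 := ModularForm.discriminant_ne_zero τ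
  have hΔτpos : 0 < ‖ModularForm.discriminant τ‖ := norm_pos_iff.mpr hΔτ
  -- norms of `q`
  have hqz : ‖Periodic.qParam 1 (z : ℂ)‖ = Real.exp (-2 * π * z.im) := by
    rw [Periodic.norm_qParam]; simp
  have hqτ : ‖Periodic.qParam 1 (τ : ℂ)‖ = Real.exp (-2 * π * (z.im / p)) := by
    rw [Periodic.norm_qParam, UpperHalfPlane.coe_im, hτ, im_upper_one_smul hp']
    simp
  -- `e^{-2π y} ≤ (e^{-2π y/p})²` for `p ≥ 2`
  have hexp : Real.exp (-2 * π * z.im) ≤ Real.exp (-2 * π * (z.im / p)) ^ 2 := by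
    rw [← Real.exp_nat_mul, Real.exp_le_exp]
    have hy : 0 < z.im := z.im_pos
    have hp2 : (2 : ℝ) ≤ p := by exact_mod_cast hp
    have hpR : (0 : ℝ) < p := by positivity
    rw [show ((2 : ℕ) : ℝ) * (-2 * π * (z.im / p)) = -2 * π * z.im * (2 / p) by push_cast; field_simp]
    have h2p : 2 / (p : ℝ) ≤ 1 := by rw [div_le_one hpR]; exact hp2
    have key : 0 ≤ 2 * π * z.im * (1 - 2 / p) := mul_nonneg (by positivity) (by linarith)
    linarith [key]
  -- the estimate
  rw [norm_div, norm_mul, norm_pow, norm_pow, Complex.norm_natCast,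
    div_le_iff₀ (by positivity)]
  have hΔz : ‖ModularForm.discriminant z‖ ≤ 2 * Real.exp (-2 * π * z.im) := hqz ▸ h1
  have hΔτ' : Real.exp (-2 * π * (z.im / p)) ≤ 2 * ‖ModularForm.discriminant τ‖ := hqτ ▸ h2
  have hppos : (0 : ℝ) ≤ (p : ℝ) ^ 24 := by positivity
  calc (p : ℝ) ^ 24 * ‖ModularForm.discriminant z‖
      ≤ (p : ℝ) ^ 24 * (2 * Real.exp (-2 * π * z.im)) :=
        mul_le_mul_of_nonneg_left hΔz hppos
    _ ≤ (p : ℝ) ^ 24 * (2 * Real.exp (-2 * π * (z.im / p)) ^ 2) := by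
        gcongr
    _ ≤ (p : ℝ) ^ 24 * (2 * (2 * ‖ModularForm.discriminant τ‖) ^ 2) := by
        gcongr
    _ = 8 * (p : ℝ) ^ 24 * ‖ModularForm.discriminant τ‖ ^ 2 := by ring


/-! ### `Δ(z)/Δ(pz)² ∈ M^{!,∞}_{-12}(Γ₀(p))` with rational coefficients -/

/-- **Non-vacuity of `GKZAlgebraicity` at prime level with a genuine pole.** For a prime `p`,
the function `f(z) = Δ(z)/Δ(pz)²` is a rational form of `M^{!,∞}_{-12}(Γ₀(p))` in the sense of
`IsRatWeaklyHolomorphicForm`, with principal part of exact order `2p - 1`: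
`f = q^{1-2p} + ⋯`, `c(1 - 2p) = 1`, `c(m) = 0` for `m < 1 - 2p`. Ingredients: `Δ(p·γz) =
(cz+d)¹² Δ(pz)` for `γ ∈ Γ₀(p)` (`discriminant_levelScale_smul_gamma0`), so `f` has weight `-12`;
`f = q^{-2p} · Δ · (q/Δ)(pz)²` with `qExpansion(Δ) · qExpansion(q/Δ)(Xᵖ)² ∈ ℚ⟦X⟧`
(`exists_ratPowerSeries_discriminant`, `exists_ratPowerSeries_qParam_div_discriminant`,
`qExpansion_comp_levelScale_smul`); and at the other cusp `(f ∣₋₁₂ γ)(z) = p²⁴ Δ(z)/Δ((z+B)/p)²`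
(`exists_slash_discriminant_div_sq_eq`) is bounded (`isBoundedAtImInfty_discriminant_div_sq`,
vanishing to order `p - 2` at the cusp `0`). So Conjecture 1.1 of Bruinier–Li–Yang 2025 has
content beyond level one: the hypothesis class `M^{!,∞}_{-2r}(Γ₀(N))` with rational coefficients
has members with a pole for `N = p` prime, `r = 6`. [folklore] -/
theorem exists_isRatWeaklyHolomorphicForm_primeLevel {p : ℕ} (hp : p.Prime) :
    ∃ c : ℤ → ℚ, IsRatWeaklyHolomorphicForm p (-12)
        (fun z : ℍ => ModularForm.discriminant z /
          ModularForm.discriminant (intGL !![(p : ℤ), 0; 0, 1] • z) ^ 2) c ∧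
      c (1 - 2 * (p : ℤ)) = 1 ∧ ∀ m : ℤ, m < 1 - 2 * (p : ℤ) → c m = 0 := by
  have hp0 : 0 < p := hp.pos
  have hp2 : 2 ≤ p := hp.two_le
  have hp' : (0 : ℤ) < p := by exact_mod_cast hp0
  obtain ⟨R, hR⟩ := exists_ratPowerSeries_discriminant
  obtain ⟨V, hV1, hV⟩ := exists_ratPowerSeries_qParam_div_discriminant
  -- notation
  set P : Matrix (Fin 2) (Fin 2) ℤ := !![(p : ℤ), 0; 0, 1] with hPdef
  set G : ℍ → ℂ := fun z : ℍ => Periodic.qParam 1 (z : ℂ) / ModularForm.discriminant z with hGdef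
  set Gp : ℍ → ℂ := fun z : ℍ => G (intGL P • z) with hGpdef
  -- `Gp = (q/Δ)(pz)`: periodic, holomorphic, bounded, `q`-expansion `V(Xᵖ)`
  have hGp_per : Periodic (Gp ∘ ofComplex) 1 := periodic_comp_levelScale_smul periodic_qParam_div_discriminant hp0
  have hGp_md : MDiff Gp := mdifferentiable_comp_levelScale_smul mdifferentiable_qParam_div_discriminant hp'
  have hGp_bdd : IsBoundedAtImInfty Gp := isBoundedAtImInfty_comp_levelScale_smul isBoundedAtImInfty_qParam_div_discriminant hp'
  set Vp : PowerSeries ℚ := PowerSeries.mk fun k => if p ∣ k then V.coeff (k / p) else 0 with hVpdef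
  have hGp_q : qExpansion 1 Gp = Vp.map (algebraMap ℚ ℂ) := by
    rw [hGpdef, qExpansion_comp_levelScale_smul periodic_qParam_div_discriminant
      mdifferentiable_qParam_div_discriminant isBoundedAtImInfty_qParam_div_discriminant hp0, ← hGdef, hV]
    ext k
    simp only [PowerSeries.coeff_mk, PowerSeries.coeff_map, hVpdef]
    split_ifs <;> simp
  -- `F = Δ · Gp²`
  set F : ℍ → ℂ := fun z : ℍ => ModularForm.discriminant z * (Gp z * Gp z) with hFdef
  have hΔper : Periodic (ModularForm.discriminant ∘ ofComplex) 1 :=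
    SlashInvariantFormClass.periodic_comp_ofComplex CuspForm.discriminant one_mem_strictPeriods_SL
  have hΔmd : MDiff (ModularForm.discriminant : ℍ → ℂ) := ModularFormClass.holo CuspForm.discriminant
  have hΔbdd : IsBoundedAtImInfty (ModularForm.discriminant : ℍ → ℂ) :=
    ModularFormClass.bdd_at_infty CuspForm.discriminant
  have hGG_per : Periodic ((fun z : ℍ => Gp z * Gp z) ∘ ofComplex) 1 := by
    intro w
    have h := hGp_per w
    simp only [Function.comp_apply] at h ⊢
    rw [h]
  have hGG_md : MDiff (fun z : ℍ => Gp z * Gp z) := hGp_md.mul hGp_md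
  have hGG_bdd : IsBoundedAtImInfty (fun z : ℍ => Gp z * Gp z) := hGp_bdd.mul hGp_bdd
  have hFper : Periodic (F ∘ ofComplex) 1 := by
    intro w
    have h1 := hΔper w
    have h2 := hGG_per w
    simp only [Function.comp_apply, hFdef] at h1 h2 ⊢
    rw [h1, h2]
  have hFmd : MDiff F := hΔmd.mul hGG_md
  have hFbdd : IsBoundedAtImInfty F := hΔbdd.mul hGG_bdd
  have hsumF := hasSum_qExpansion one_pos hFper hFmd hFbdd
  have hqF : qExpansion 1 F = (R * (Vp * Vp)).map (algebraMap ℚ ℂ) := by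
    have ha := analyticAt_cuspFunction_zero one_pos hΔper hΔmd hΔbdd
    have hb := analyticAt_cuspFunction_zero one_pos hGp_per hGp_md hGp_bdd
    have hbb := analyticAt_cuspFunction_zero one_pos hGG_per hGG_md hGG_bdd
    have h1 := qExpansion_mul ha hbb
    have h2 := qExpansion_mul hb hb
    rw [map_mul, map_mul, ← hR, ← hGp_q, ← h2, show (Gp * Gp) = fun z => Gp z * Gp z from rfl, ← h1]
    rfl
  set W : PowerSeries ℚ := R * (Vp * Vp) with hW
  -- the coefficients
  set c : ℤ → ℚ := fun m => if m < -(2 * (p : ℤ)) then 0 else W.coeff (m + 2 * p).toNat with hc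
  have hc0 : ∀ m : ℤ, m < -(2 * (p : ℤ)) → c m = 0 := fun m hm => by simp only [hc, if_pos hm]
  -- `R = X · (1 + …)`, `Vp(0) = 1`
  have hR0 : PowerSeries.constantCoeff R = 0 := by
    have h0 : (qExpansion 1 ModularForm.discriminant).coeff 0 = 0 := by
      have := CuspFormClass.qExpansion_coeff_zero CuspForm.discriminant one_pos
        one_mem_strictPeriods_SL
      rwa [CuspForm.coe_discriminant] at this
    rw [hR, PowerSeries.coeff_map, PowerSeries.coeff_zero_eq_constantCoeff, eq_ratCast] at h0
    exact_mod_cast h0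
  have hR1 : R.coeff 1 = 1 := by
    have h1 := ModularForm.discriminant_qExpansion_coeff_one
    rw [hR, PowerSeries.coeff_map, eq_ratCast] at h1
    exact_mod_cast h1
  have hVp0 : PowerSeries.constantCoeff Vp = 1 := by
    rw [← PowerSeries.coeff_zero_eq_constantCoeff, hVpdef, PowerSeries.coeff_mk]
    simp only [dvd_zero, if_true, Nat.zero_div]
    rw [PowerSeries.coeff_zero_eq_constantCoeff]
    exact hV1
  have hW0 : W.coeff 0 = 0 := by
    rw [PowerSeries.coeff_zero_eq_constantCoeff, hW, map_mul, hR0, zero_mul]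
  have hW1 : W.coeff 1 = 1 := by
    rw [hW, PowerSeries.coeff_mul, Finset.Nat.antidiagonal_succ, Finset.sum_cons,
      Finset.Nat.antidiagonal_zero, Finset.map_singleton, Finset.sum_singleton]
    simp only [Function.Embedding.coe_prodMap, Function.Embedding.coeFn_mk, Prod.map_apply,
      Nat.succ_eq_add_one, zero_add, Function.Embedding.refl_apply,
      PowerSeries.coeff_zero_eq_constantCoeff, hR0, zero_mul, hR1, map_mul, hVp0, mul_one]
  have hc1 : c (1 - 2 * (p : ℤ)) = 1 := by
    simp only [hc]
    rw [if_neg (by omega), show (1 - 2 * (p : ℤ) + 2 * p).toNat = 1 by omega, hW1]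
  have hc2p : c (-(2 * (p : ℤ))) = 0 := by
    simp only [hc]
    rw [if_neg (lt_irrefl _), show (-(2 * (p : ℤ)) + 2 * p).toNat = 0 by omega, hW0]
  have hc0' : ∀ m : ℤ, m < 1 - 2 * (p : ℤ) → c m = 0 := by
    intro m hm
    rcases lt_or_eq_of_le (show m ≤ -(2 * (p : ℤ)) by omega) with h | h
    · exact hc0 m h
    · rw [h]; exact hc2p
  refine ⟨c, ?_, hc1, hc0'⟩
  -- the `q`-expansion of `f` on all of `ℍ`
  have hsum : ∀ τ : ℍ, HasSum (fun m : ℤ => (c m : ℂ) * Complex.exp (2 * π * Complex.I * m * (τ : ℂ)))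
      (ModularForm.discriminant τ / ModularForm.discriminant (intGL P • τ) ^ 2) := by
    intro τ
    have hq : Periodic.qParam 1 (τ : ℂ) = Complex.exp (2 * π * Complex.I * (τ : ℂ)) := by
      simp [Periodic.qParam]
    have hq0 : Complex.exp (2 * π * Complex.I * (τ : ℂ)) ≠ 0 := Complex.exp_ne_zero _
    have hGsum := (hsumF τ).mul_right ((Complex.exp (2 * π * Complex.I * (τ : ℂ))) ^ (2 * p))⁻¹
    have hval : F τ * ((Complex.exp (2 * π * Complex.I * (τ : ℂ))) ^ (2 * p))⁻¹ =
        ModularForm.discriminant τ / ModularForm.discriminant (intGL P • τ) ^ 2 := by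
      rw [hFdef, hGpdef, hGdef]
      simp only [hPdef, qParam_levelScale_smul hp0 τ, hq]
      have hΔ1 := ModularForm.discriminant_ne_zero τ
      have hΔ2 := ModularForm.discriminant_ne_zero (intGL !![(p : ℤ), 0; 0, 1] • τ)
      field_simp
      ring
    rw [hval] at hGsum
    let e : ℕ → ℤ := fun i => (i : ℤ) - 2 * p
    have he : Function.Injective e := fun a b h => by
      simp only [e] at h
      exact_mod_cast (sub_left_inj.mp h)
    have hrange : ∀ m : ℤ, m ∉ Set.range e →
        (c m : ℂ) * Complex.exp (2 * π * Complex.I * m * (τ : ℂ)) = 0 := by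
      intro m hm
      have hm' : m < -(2 * (p : ℤ)) := by
        by_contra hle
        push Not at hle
        exact hm ⟨(m + 2 * p).toNat, by simp only [e]; omega⟩
      simp [hc0 m hm']
    refine (he.hasSum_iff hrange).mp ?_
    have hfun : ((fun m : ℤ => (c m : ℂ) * Complex.exp (2 * π * Complex.I * m * (τ : ℂ))) ∘ e) =
        fun i : ℕ => (qExpansion 1 F).coeff i •
            Periodic.qParam 1 (τ : ℂ) ^ i * ((Complex.exp (2 * π * Complex.I * (τ : ℂ))) ^ (2 * p))⁻¹ := by
      funext i
      simp only [Function.comp_apply, e]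
      have hci : c ((i : ℤ) - 2 * p) = W.coeff i := by
        simp only [hc]
        rw [if_neg (by omega), show ((i : ℤ) - 2 * p + 2 * p).toNat = i by omega]
      rw [hci, hqF, PowerSeries.coeff_map, eq_ratCast, hq]
      push_cast
      rw [show 2 * (π : ℂ) * Complex.I * ((i : ℂ) - 2 * (p : ℂ)) * (τ : ℂ) =
          (i : ℂ) * (2 * π * Complex.I * (τ : ℂ)) - ((2 * p : ℕ) : ℂ) * (2 * π * Complex.I * (τ : ℂ)) by
            push_cast; ring,
        Complex.exp_sub, Complex.exp_nat_mul, Complex.exp_nat_mul]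
      rw [smul_eq_mul]
      field_simp
    rw [hfun]
    exact hGsum
  -- holomorphy
  have hmd : MDiff (fun z : ℍ => ModularForm.discriminant z / ModularForm.discriminant (intGL P • z) ^ 2) := by
    have hΔP : MDiff (fun z : ℍ => ModularForm.discriminant (intGL P • z)) :=
      mdifferentiable_comp_levelScale_smul hΔmd hp'
    rw [UpperHalfPlane.mdifferentiable_iff] at hΔmd hΔP ⊢
    exact (hΔmd.div (hΔP.pow 2) fun w _ => pow_ne_zero _ (ModularForm.discriminant_ne_zero _)).congr
      fun w _ => by simp [Function.comp]
  -- invariance under `Γ₀(p)` in weight `-12`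
  have hslash : ∀ γ : SL(2, ℤ), γ ∈ Gamma0 p →
      (fun z : ℍ => ModularForm.discriminant z / ModularForm.discriminant (intGL P • z) ^ 2) ∣[(-12 : ℤ)]
        (γ : GL (Fin 2) ℝ) =
        fun z : ℍ => ModularForm.discriminant z / ModularForm.discriminant (intGL P • z) ^ 2 := by
    intro γ hγ
    funext z
    rw [show ((fun z : ℍ => ModularForm.discriminant z / ModularForm.discriminant (intGL P • z) ^ 2)
        ∣[(-12 : ℤ)] (γ : GL (Fin 2) ℝ)) = ((fun z : ℍ => ModularForm.discriminant z /
        ModularForm.discriminant (intGL P • z) ^ 2) ∣[(-12 : ℤ)] γ) from rfl,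
      ModularForm.SL_slash_apply]
    simp only [neg_neg]
    have hmem : (γ : GL (Fin 2) ℝ) ∈ 𝒮ℒ := ⟨γ, rfl⟩
    have hΔγ := SlashInvariantForm.slash_action_eqn'' CuspForm.discriminant hmem z
    simp only [CuspForm.coe_discriminant] at hΔγ
    rw [show ((γ : GL (Fin 2) ℝ) • z) = γ • z from rfl] at hΔγ
    rw [hPdef, discriminant_levelScale_smul_gamma0 hp0 hγ z, hΔγ]
    have hd : denom (γ : GL (Fin 2) ℝ) (z : ℂ) ≠ 0 := denom_ne_zero _ _
    have hΔ2 := ModularForm.discriminant_ne_zero (intGL !![(p : ℤ), 0; 0, 1] • z)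
    simp only [zpow_ofNat]
    field_simp
  -- boundedness at the cusp `0`
  have hbdd : ∀ γ : SL(2, ℤ), γ ∉ Gamma0 p →
      IsBoundedAtImInfty ((fun z : ℍ => ModularForm.discriminant z /
        ModularForm.discriminant (intGL P • z) ^ 2) ∣[(-12 : ℤ)] (γ : GL (Fin 2) ℝ)) := by
    intro γ hγ
    have hndvd : ¬ (p : ℤ) ∣ (γ : Matrix (Fin 2) (Fin 2) ℤ) 1 0 := fun h =>
      hγ (Gamma0_mem.mpr ((ZMod.intCast_zmod_eq_zero_iff_dvd _ p).mpr h))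
    have hcop1 : IsCoprime (p : ℤ) ((γ : Matrix (Fin 2) (Fin 2) ℤ) 1 0) :=
      (Prime.coprime_iff_not_dvd (Nat.prime_iff_prime_int.mp hp)).mpr hndvd
    have hcop2 : IsCoprime ((γ : Matrix (Fin 2) (Fin 2) ℤ) 0 0) ((γ : Matrix (Fin 2) (Fin 2) ℤ) 1 0) := by
      have h1 := γ.det_coe
      rw [Matrix.det_fin_two] at h1
      exact ⟨(γ : Matrix (Fin 2) (Fin 2) ℤ) 1 1, -(γ : Matrix (Fin 2) (Fin 2) ℤ) 0 1,
        by linear_combination h1⟩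
    obtain ⟨B, hB⟩ := exists_slash_discriminant_div_sq_eq hp0 (hcop1.mul_left hcop2)
    have hfun : ((fun z : ℍ => ModularForm.discriminant z /
        ModularForm.discriminant (intGL P • z) ^ 2) ∣[(-12 : ℤ)] (γ : GL (Fin 2) ℝ)) =
        fun z : ℍ => (p : ℂ) ^ 24 * ModularForm.discriminant z /
          ModularForm.discriminant (intGL !![1, B; 0, (p : ℤ)] • z) ^ 2 := by
      funext z
      rw [← hB z]
    rw [hfun]
    exact isBoundedAtImInfty_discriminant_div_sq hp2 B
  exact
    { mdifferentiable := hmd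
      slash_eq := hslash
      finite_principalPart := ⟨2 * p, fun m hm => hc0 m (by push_cast at hm; omega)⟩
      hasSum_fourier := hsum
      isBoundedAtImInfty_slash := hbdd }


end PrimeLevel

section Mul

open UpperHalfPlane Complex CongruenceSubgroup Function
open scoped MatrixGroups ModularForm Manifold

/-! ### Products: `M^{!,∞}_{k₁}(Γ₀(N)) · M^{!,∞}_{k₂}(Γ₀(N)) ⊂ M^{!,∞}_{k₁+k₂}(Γ₀(N))` -/

/-- **The product of two rational forms of `M^{!,∞}_{kⱼ}(Γ₀(N))` is a rational form of
`M^{!,∞}_{k₁+k₂}(Γ₀(N))`**, with Fourier coefficients the Cauchy product: if `c(m) = 0` for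
`m < -M₁` and `d(m) = 0` for `m < -M₂` then `(fg)` has coefficients
`e(m) = Σ_{i+j=m} c(i) d(j)`, `e(m) = 0` for `m < -(M₁+M₂)` and `e(-(M₁+M₂)) = c(-M₁) d(-M₂)`
(the `q`-series converge absolutely, so the Cauchy product over `ℕ` applies after the shift
`q^{M₁}f · q^{M₂}g`; the slash action is multiplicative, `ModularForm.mul_slash_SL2`). [folklore] -/
theorem IsRatWeaklyHolomorphicForm.mul {N : ℕ} {k₁ k₂ : ℤ} {f g : ℍ → ℂ} {c d : ℤ → ℚ}
    (hf : IsRatWeaklyHolomorphicForm N k₁ f c) (hg : IsRatWeaklyHolomorphicForm N k₂ g d)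
    {M₁ M₂ : ℕ} (hc : ∀ m : ℤ, m < -(M₁ : ℤ) → c m = 0) (hd : ∀ m : ℤ, m < -(M₂ : ℤ) → d m = 0) :
    ∃ e : ℤ → ℚ, IsRatWeaklyHolomorphicForm N (k₁ + k₂) (f * g) e ∧
      e (-((M₁ + M₂ : ℕ) : ℤ)) = c (-(M₁ : ℤ)) * d (-(M₂ : ℤ)) ∧
      ∀ m : ℤ, m < -((M₁ + M₂ : ℕ) : ℤ) → e m = 0 := by
  classical
  set M : ℕ := M₁ + M₂ with hM
  set e : ℤ → ℚ := fun m => if m < -(M : ℤ) then 0 else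
    ∑ kl ∈ Finset.HasAntidiagonal.antidiagonal (m + M).toNat,
      c ((kl.1 : ℤ) - M₁) * d ((kl.2 : ℤ) - M₂) with he
  have he0 : ∀ m : ℤ, m < -(M : ℤ) → e m = 0 := fun m hm => by simp only [he, if_pos hm]
  have heM : e (-(M : ℤ)) = c (-(M₁ : ℤ)) * d (-(M₂ : ℤ)) := by
    simp only [he]
    rw [if_neg (lt_irrefl _), show (-(M : ℤ) + M).toNat = 0 by omega]
    simp
  refine ⟨e, ?_, heM, he0⟩
  -- the Fourier expansion of the product
  have hsum : ∀ z : ℍ, HasSum (fun m : ℤ => (e m : ℂ) * Complex.exp (2 * π * Complex.I * m * (z : ℂ)))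
      (f z * g z) := by
    intro z
    set E : ℤ → ℂ := fun m => Complex.exp (2 * π * Complex.I * m * (z : ℂ)) with hE
    have hEadd : ∀ m n : ℤ, E m * E n = E (m + n) := by
      intro m n
      simp only [hE, ← Complex.exp_add]
      congr 1
      push_cast
      ring
    -- shift to `ℕ`-indexed series
    set A : ℕ → ℂ := fun i => (c ((i : ℤ) - M₁) : ℂ) * E ((i : ℤ) - M₁) with hA
    set B : ℕ → ℂ := fun j => (d ((j : ℤ) - M₂) : ℂ) * E ((j : ℤ) - M₂) with hB
    have shiftA : HasSum A (f z) := by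
      let sh : ℕ → ℤ := fun i => (i : ℤ) - M₁
      have hsh : Function.Injective sh := fun a b h => by
        simp only [sh] at h; exact_mod_cast (sub_left_inj.mp h)
      have hrange : ∀ m : ℤ, m ∉ Set.range sh → (c m : ℂ) * E m = 0 := by
        intro m hm
        have hm' : m < -(M₁ : ℤ) := by
          by_contra hle
          push Not at hle
          exact hm ⟨(m + M₁).toNat, by simp only [sh]; omega⟩
        simp [hc m hm']
      exact (hsh.hasSum_iff hrange).mpr (hf.hasSum_fourier z)
    have shiftB : HasSum B (g z) := by
      let sh : ℕ → ℤ := fun i => (i : ℤ) - M₂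
      have hsh : Function.Injective sh := fun a b h => by
        simp only [sh] at h; exact_mod_cast (sub_left_inj.mp h)
      have hrange : ∀ m : ℤ, m ∉ Set.range sh → (d m : ℂ) * E m = 0 := by
        intro m hm
        have hm' : m < -(M₂ : ℤ) := by
          by_contra hle
          push Not at hle
          exact hm ⟨(m + M₂).toNat, by simp only [sh]; omega⟩
        simp [hd m hm']
      exact (hsh.hasSum_iff hrange).mpr (hg.hasSum_fourier z)
    have hAn : Summable fun i => ‖A i‖ := summable_norm_iff.mpr shiftA.summable
    have hBn : Summable fun j => ‖B j‖ := summable_norm_iff.mpr shiftB.summable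
    -- Cauchy product
    have hprod : HasSum (fun n : ℕ => ∑ kl ∈ Finset.HasAntidiagonal.antidiagonal n, A kl.1 * B kl.2)
        (f z * g z) := by
      have h1 := tsum_mul_tsum_eq_tsum_sum_antidiagonal_of_summable_norm hAn hBn
      rw [shiftA.tsum_eq, shiftB.tsum_eq] at h1
      rw [h1]
      exact (summable_norm_sum_mul_antidiagonal_of_summable_norm hAn hBn).of_norm.hasSum
    -- identify the terms
    have hterm : ∀ n : ℕ, ∑ kl ∈ Finset.HasAntidiagonal.antidiagonal n, A kl.1 * B kl.2 =
        (e ((n : ℤ) - M) : ℂ) * E ((n : ℤ) - M) := by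
      intro n
      have hen : e ((n : ℤ) - M) =
          ∑ kl ∈ Finset.HasAntidiagonal.antidiagonal n, c ((kl.1 : ℤ) - M₁) * d ((kl.2 : ℤ) - M₂) := by
        simp only [he]
        rw [if_neg (by omega), show ((n : ℤ) - M + M).toNat = n by omega]
      rw [hen]
      push_cast
      rw [Finset.sum_mul]
      refine Finset.sum_congr rfl fun kl hkl => ?_
      rw [Finset.HasAntidiagonal.mem_antidiagonal] at hkl
      simp only [hA, hB]
      rw [show (c ((kl.1 : ℤ) - M₁) : ℂ) * E ((kl.1 : ℤ) - M₁) * ((d ((kl.2 : ℤ) - M₂) : ℂ) *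
          E ((kl.2 : ℤ) - M₂)) = (c ((kl.1 : ℤ) - M₁) : ℂ) * (d ((kl.2 : ℤ) - M₂) : ℂ) *
          (E ((kl.1 : ℤ) - M₁) * E ((kl.2 : ℤ) - M₂)) by ring, hEadd]
      congr 2
      rw [hM]
      push_cast
      rw [← hkl]
      push_cast
      ring
    simp_rw [hterm] at hprod
    -- back to `ℤ`
    let sh : ℕ → ℤ := fun n => (n : ℤ) - M
    have hsh : Function.Injective sh := fun a b h => by
      simp only [sh] at h; exact_mod_cast (sub_left_inj.mp h)
    have hrange : ∀ m : ℤ, m ∉ Set.range sh → (e m : ℂ) * E m = 0 := by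
      intro m hm
      have hm' : m < -(M : ℤ) := by
        by_contra hle
        push Not at hle
        exact hm ⟨(m + M).toNat, by simp only [sh]; omega⟩
      simp [he0 m hm']
    exact (hsh.hasSum_iff hrange).mp hprod
  -- slash invariance and boundedness at the other cusps
  have hslash : ∀ γ : SL(2, ℤ), (f * g) ∣[k₁ + k₂] (γ : GL (Fin 2) ℝ) =
      f ∣[k₁] (γ : GL (Fin 2) ℝ) * g ∣[k₂] (γ : GL (Fin 2) ℝ) := fun γ =>
    ModularForm.mul_slash_SL2 k₁ k₂ γ f g
  exact
    { mdifferentiable := hf.mdifferentiable.mul hg.mdifferentiable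
      slash_eq := fun γ hγ => by rw [hslash γ, hf.slash_eq γ hγ, hg.slash_eq γ hγ]
      finite_principalPart := ⟨M, he0⟩
      hasSum_fourier := hsum
      isBoundedAtImInfty_slash := fun γ hγ => by
        rw [hslash γ]
        exact (hf.isBoundedAtImInfty_slash γ hγ).mul (hg.isBoundedAtImInfty_slash γ hγ) }

/-- The constant `1` is a rational form of `M^{!,∞}_0(Γ₀(N))` (coefficients `δ_{m,0}`).
[folklore] -/
theorem isRatWeaklyHolomorphicForm_one (N : ℕ) :
    IsRatWeaklyHolomorphicForm N 0 1 (fun m => if m = 0 then 1 else 0) where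
  mdifferentiable := mdifferentiable_const
  slash_eq γ _ := ModularForm.is_invariant_one γ
  finite_principalPart := ⟨0, fun m hm => by
    have hm0 : m ≠ 0 := by omega
    simp [hm0]⟩
  hasSum_fourier z := by
    have := hasSum_single (f := fun m : ℤ =>
      (((if m = 0 then 1 else 0 : ℚ)) : ℂ) * Complex.exp (2 * π * Complex.I * m * (z : ℂ))) 0
      (fun m hm => by simp [hm])
    simpa using this
  isBoundedAtImInfty_slash γ _ := by
    have h := ModularForm.is_invariant_one γ
    rw [ModularForm.SL_slash] at h
    rw [h]
    exact const_boundedAtFilter _ _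

/-- Powers of a rational form of `M^{!,∞}_k(Γ₀(N))`: `fⁿ ∈ M^{!,∞}_{nk}(Γ₀(N))` with leading
principal coefficient `c(-M)ⁿ` at `q^{-nM}`. [folklore] -/
theorem IsRatWeaklyHolomorphicForm.pow {N : ℕ} {k : ℤ} {f : ℍ → ℂ} {c : ℤ → ℚ}
    (hf : IsRatWeaklyHolomorphicForm N k f c) {M : ℕ} (hc : ∀ m : ℤ, m < -(M : ℤ) → c m = 0)
    (n : ℕ) :
    ∃ e : ℤ → ℚ, IsRatWeaklyHolomorphicForm N (n * k) (f ^ n) e ∧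
      e (-((n * M : ℕ) : ℤ)) = c (-(M : ℤ)) ^ n ∧ ∀ m : ℤ, m < -((n * M : ℕ) : ℤ) → e m = 0 := by
  induction n with
  | zero =>
    refine ⟨fun m => if m = 0 then 1 else 0, ?_, by simp, fun m hm => ?_⟩
    · simp only [pow_zero, Nat.cast_zero, zero_mul]
      exact isRatWeaklyHolomorphicForm_one N
    · simp only [Nat.zero_mul, Nat.cast_zero, neg_zero] at hm
      simp [hm.ne]
  | succ n ih =>
    obtain ⟨e, he, heM, he0⟩ := ih
    obtain ⟨e', he', heM', he0'⟩ := he.mul hf he0 hc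
    refine ⟨e', ?_, ?_, ?_⟩
    · rw [pow_succ, show ((n + 1 : ℕ) : ℤ) * k = n * k + k by push_cast; ring]
      exact he'
    · rw [show ((n + 1) * M : ℕ) = n * M + M by ring, heM', heM, pow_succ]
    · intro m hm
      exact he0' m (by rw [show ((n * M + M : ℕ)) = (n + 1) * M by ring]; exact hm)

/-- Transport of `IsRatWeaklyHolomorphicForm` along an equality of weights. [folklore] -/
theorem IsRatWeaklyHolomorphicForm.congr_weight {N : ℕ} {k k' : ℤ} {f : ℍ → ℂ} {c : ℤ → ℚ}
    (h : IsRatWeaklyHolomorphicForm N k f c) (hk : k = k') : IsRatWeaklyHolomorphicForm N k' f c :=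
  hk ▸ h

/-- **Level raising for pole-free forms**: a rational form of `M^{!,∞}_k(SL(2, ℤ))` without
principal part (e.g. a level-one modular form with rational `q`-expansion) is a rational form of
`M^{!,∞}_k(Γ₀(N))` for every `N` — it is bounded at every cusp since `f ∣ₖ γ = f`. (With a pole
this fails: the pole at `∞` of `X₀(1)` lies under every cusp of `X₀(N)`.) [folklore] -/
theorem IsRatWeaklyHolomorphicForm.of_levelOne {k : ℤ} {f : ℍ → ℂ} {c : ℤ → ℚ}
    (h : IsRatWeaklyHolomorphicForm 1 k f c) (hc : ∀ m : ℤ, m < 0 → c m = 0) (N : ℕ) :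
    IsRatWeaklyHolomorphicForm N k f c where
  mdifferentiable := h.mdifferentiable
  slash_eq γ _ := h.slash_eq γ (mem_Gamma0_one γ)
  finite_principalPart := h.finite_principalPart
  hasSum_fourier := h.hasSum_fourier
  isBoundedAtImInfty_slash γ _ := by
    rw [h.slash_eq γ (mem_Gamma0_one γ)]
    exact isBoundedAtImInfty_of_hasSum_fourier h.hasSum_fourier hc

/-- `E_k ∈ M^{!,∞}_k(Γ₀(N))` with rational coefficients and `c(0) = 1`, `c(m) = 0` for `m < 0`
(`k ≥ 4` even; any level `N`). [folklore] -/
theorem exists_isRatWeaklyHolomorphicForm_E {k : ℕ} (hk : 3 ≤ k) (hk2 : Even k) (N : ℕ) :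
    ∃ c : ℤ → ℚ, IsRatWeaklyHolomorphicForm N k (ModularForm.E hk) c ∧ c 0 = 1 ∧
      ∀ m : ℤ, m < 0 → c m = 0 := by
  obtain ⟨c, hc, hc1, hc0⟩ := exists_isRatWeaklyHolomorphicForm_div_discriminant_pow
    (ModularForm.E hk) (exists_ratPowerSeries_E hk hk2) 0
  simp only [pow_zero, div_one, Nat.cast_zero, mul_zero, sub_zero, neg_zero] at hc hc1 hc0
  refine ⟨c, hc.of_levelOne hc0 N, ?_, hc0⟩
  rw [EisensteinSeries.E_qExpansion_coeff_zero hk hk2] at hc1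
  exact_mod_cast hc1

/-- **Non-vacuity of `GKZAlgebraicity` with a genuine pole in every weight at every prime level.**
For `p` prime and every `r ≥ 0` there is a rational `f ∈ M^{!,∞}_{-2r}(Γ₀(p))` with principal part
of exact order `n ≥ 1`: `f = E_k · (Δ(z)/Δ(pz)²)^{n₀}` with `(k, n₀)` as in
`exists_isRatWeaklyHolomorphicForm_levelOne` (`r = 6j + i`: `(12 - 2i, j + 1)` for `i ≤ 4`,
`(14, j + 2)` for `i = 5`) and `n = n₀(2p - 1)` (`exists_isRatWeaklyHolomorphicForm_primeLevel`,
`.pow`, `.mul`, `exists_isRatWeaklyHolomorphicForm_E`). [folklore] -/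
theorem exists_isRatWeaklyHolomorphicForm_primeLevel_weight {p : ℕ} (hp : p.Prime) (r : ℕ) :
    ∃ (n : ℕ) (f : ℍ → ℂ) (c : ℤ → ℚ), 0 < n ∧ IsRatWeaklyHolomorphicForm p (-2 * (r : ℤ)) f c ∧
      c (-(n : ℤ)) = 1 ∧ ∀ m : ℤ, m < -(n : ℤ) → c m = 0 := by
  have hp1 : 1 ≤ p := hp.one_lt.le
  obtain ⟨cp, hcp, hcp1, hcp0⟩ := exists_isRatWeaklyHolomorphicForm_primeLevel hp
  -- `M = 2p - 1`
  have hcp0' : ∀ m : ℤ, m < -((2 * p - 1 : ℕ) : ℤ) → cp m = 0 := fun m hm => hcp0 m (by omega)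
  have hcpM : cp (-((2 * p - 1 : ℕ) : ℤ)) = 1 := by
    rw [show (-((2 * p - 1 : ℕ) : ℤ)) = 1 - 2 * (p : ℤ) by omega]
    exact hcp1
  -- the general construction from a weight `k` and an exponent `n₀ ≥ 1`
  have key : ∀ (k : ℕ) (hk : 3 ≤ k) (hk2 : Even k) (n₀ : ℕ), 0 < n₀ →
      ∃ (n : ℕ) (f : ℍ → ℂ) (c : ℤ → ℚ), 0 < n ∧
        IsRatWeaklyHolomorphicForm p ((k : ℤ) - 12 * n₀) f c ∧
        c (-(n : ℤ)) = 1 ∧ ∀ m : ℤ, m < -(n : ℤ) → c m = 0 := by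
    intro k hk hk2 n₀ hn₀
    obtain ⟨cE, hE, hE1, hE0⟩ := exists_isRatWeaklyHolomorphicForm_E hk hk2 p
    obtain ⟨e, he, heM, he0⟩ := hcp.pow hcp0' n₀
    have hE0' : ∀ m : ℤ, m < -((0 : ℕ) : ℤ) → cE m = 0 := fun m hm => hE0 m (by simpa using hm)
    obtain ⟨e', he', heM', he0'⟩ := hE.mul he hE0' he0
    refine ⟨n₀ * (2 * p - 1), _, e', Nat.mul_pos hn₀ (by omega), he'.congr_weight (by ring), ?_, ?_⟩
    · rw [show (-((n₀ * (2 * p - 1) : ℕ) : ℤ)) = -((0 + n₀ * (2 * p - 1) : ℕ) : ℤ) by simp, heM',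
        heM, hcpM, one_pow, mul_one]
      simpa using hE1
    · intro m hm
      exact he0' m (by simpa using hm)
  -- `r = 6j + i`
  obtain ⟨j, i, hi, rfl⟩ : ∃ j i : ℕ, i < 6 ∧ r = 6 * j + i :=
    ⟨r / 6, r % 6, Nat.mod_lt _ (by norm_num), (Nat.div_add_mod r 6).symm⟩
  by_cases h5 : i = 5
  · subst h5
    obtain ⟨n, f, c, hn, hf, hc1, hc0⟩ := key 14 (by norm_num) ⟨7, rfl⟩ (j + 2) (by omega)
    exact ⟨n, f, c, hn, hf.congr_weight (by push_cast; ring), hc1, hc0⟩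
  · have hk3 : 3 ≤ 12 - 2 * i := by omega
    have hk2 : Even (12 - 2 * i) := ⟨6 - i, by omega⟩
    obtain ⟨n, f, c, hn, hf, hc1, hc0⟩ := key (12 - 2 * i) hk3 hk2 (j + 1) (by omega)
    refine ⟨n, f, c, hn, hf.congr_weight ?_, hc1, hc0⟩
    have : ((12 - 2 * i : ℕ) : ℤ) = 12 - 2 * (i : ℤ) := by omega
    rw [this]
    push_cast
    ring

end Mul

section Hecke

open UpperHalfPlane Complex CongruenceSubgroup Function
open scoped MatrixGroups ModularForm Manifold

open Literature.NumberTheory.EllipticCurves.ModularForms (intGL intGL_apply coe_intGL intGL_mul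
  mapGL_eq_intGL tpB tpD coe_tpB_smul coe_tpD_smul slash_tpB_apply slash_tpD_apply ζp
  heckeRep HeckeIdx Delta0 intGL_heckeRep_some intGL_heckeRep_none sum_heckeIdx det_heckeRep_ne_zero
  heckeRep_mem_delta0 existsUnique_mem_delta0_mul_heckeRep exists_mem_delta0_one_iff
  intGL_mul_inv_mem_gamma0_iff sum_slash_eq_sum_slash_of_transversal mul_mem_delta0)

variable {p : ℕ} [NeZero p]

/-! ### `z ↦ (z + j)/p`: holomorphy and growth -/

/-- `(1 j; 0 p) · ofComplex w = ofComplex ((w + j)/p)` for `Im w > 0`. [folklore] -/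
theorem tpB_smul_ofComplex (j : ℤ) {w : ℂ} (hw : 0 < w.im) :
    tpB p j • ofComplex w = ofComplex ((w + j) / p) := by
  have hp : (0 : ℝ) < p := by exact_mod_cast NeZero.pos p
  have hw' : 0 < ((w + j) / p : ℂ).im := by
    rw [Complex.div_natCast_im]
    simp only [Complex.add_im, Complex.intCast_im, add_zero]
    exact div_pos hw hp
  apply UpperHalfPlane.ext
  rw [coe_tpB_smul, ofComplex_apply_of_im_pos hw, ofComplex_apply_of_im_pos hw']

/-- `Im((z + j)/p) = Im z / p`. [folklore] -/
theorem im_tpB_smul (j : ℤ) (z : ℍ) : (tpB p j • z).im = z.im / p := by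
  rw [← UpperHalfPlane.coe_im, coe_tpB_smul, Complex.div_natCast_im]
  simp

/-- `F((z + j)/p)` is holomorphic if `F` is. [folklore] -/
theorem mdifferentiable_comp_tpB_smul {F : ℍ → ℂ} (hF : MDiff F) (j : ℤ) :
    MDiff (fun z : ℍ => F (tpB p j • z)) := by
  have hp : (0 : ℝ) < p := by exact_mod_cast NeZero.pos p
  rw [UpperHalfPlane.mdifferentiable_iff] at hF ⊢
  have hmul : DifferentiableOn ℂ (fun w : ℂ => (w + j) / p) {w : ℂ | 0 < w.im} := by
    apply Differentiable.differentiableOn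
    fun_prop
  have hmaps : Set.MapsTo (fun w : ℂ => (w + j) / p) {w : ℂ | 0 < w.im} {w : ℂ | 0 < w.im} := by
    intro w hw
    simp only [Set.mem_setOf_eq] at hw ⊢
    rw [Complex.div_natCast_im]
    simp only [Complex.add_im, Complex.intCast_im, add_zero]
    exact div_pos hw hp
  refine (hF.comp hmul hmaps).congr fun w hw => ?_
  simp only [Function.comp_apply]
  rw [tpB_smul_ofComplex j hw]

/-- `F((z + j)/p)` is bounded at `i∞` if `F` is. [folklore] -/
theorem isBoundedAtImInfty_comp_tpB_smul {F : ℍ → ℂ} (hF : IsBoundedAtImInfty F) (j : ℤ) :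
    IsBoundedAtImInfty (fun z : ℍ => F (tpB p j • z)) := by
  have hp : (0 : ℝ) < p := by exact_mod_cast NeZero.pos p
  rw [UpperHalfPlane.isBoundedAtImInfty_iff] at hF ⊢
  obtain ⟨C, A, hA⟩ := hF
  refine ⟨C, p * max A 0, fun z hz => hA _ ?_⟩
  rw [im_tpB_smul, le_div_iff₀ hp]
  nlinarith [le_max_left A 0, le_max_right A 0]

/-! ### The root-of-unity sum for integral exponents -/

omit [NeZero p] in
/-- `∑_{j mod p} ζ_p^{mj} = p · 𝟙_{p ∣ m}` for `m ∈ ℤ`. [folklore] -/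
theorem sum_ζp_zpow (hp : p.Prime) (m : ℤ) :
    ∑ j : Fin p, (ζp p ^ m) ^ (j : ℕ) = if (p : ℤ) ∣ m then (p : ℂ) else 0 := by
  have hζ : IsPrimitiveRoot (ζp p) p := Complex.isPrimitiveRoot_exp p hp.ne_zero
  rw [Fin.sum_univ_eq_sum_range (fun j => (ζp p ^ m) ^ j) p]
  split_ifs with h
  · rw [(hζ.zpow_eq_one_iff_dvd m).mpr h]
    simp
  · have h1 : ζp p ^ m ≠ 1 := fun h' => h ((hζ.zpow_eq_one_iff_dvd m).mp h')
    rw [geom_sum_eq h1, ← zpow_natCast, ← zpow_mul, mul_comm, zpow_mul, zpow_natCast,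
      hζ.pow_eq_one, one_zpow, sub_self, zero_div]

/-! ### Fourier expansions of `f ∣ (1 j; 0 p)` and `f ∣ diag(p, 1)` -/

omit [NeZero p] in
/-- `∑_{j mod p} ζ_p^{mj} = p · 𝟙_{p ∣ m}`, `ZMod p`-indexed. [folklore] -/
theorem sum_zmod_ζp_zpow [NeZero p] (hp : p.Prime) (m : ℤ) :
    ∑ j : ZMod p, (ζp p ^ m) ^ j.val = if (p : ℤ) ∣ m then (p : ℂ) else 0 := by
  rw [Literature.NumberTheory.EllipticCurves.ModularForms.sum_zmod_val_eq_sum_fin p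
    (fun j => (ζp p ^ m) ^ j), sum_ζp_zpow hp m]

/-- **`f ∣ₖ diag(p,1) = p^{k-1} Σ c(m) q^{pm}`**: the Fourier expansion of `z ↦ p^{k-1} f(pz)`
for `f` with expansion `Σ c(m) qᵐ`. [folklore] -/
theorem IsRatWeaklyHolomorphicForm.hasSum_slash_tpD {N : ℕ} {k : ℤ} {f : ℍ → ℂ} {c : ℤ → ℚ}
    (hf : IsRatWeaklyHolomorphicForm N k f c) (z : ℍ) :
    HasSum (fun n : ℤ => (((if (p : ℤ) ∣ n then c (n / p) else 0 : ℚ) : ℂ) * (p : ℂ) ^ (k - 1)) *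
        Complex.exp (2 * π * Complex.I * n * (z : ℂ))) ((f ∣[k] tpD p) z) := by
  have hp0 : (p : ℤ) ≠ 0 := by exact_mod_cast NeZero.ne p
  rw [slash_tpD_apply]
  have h := (hf.hasSum_fourier (tpD p • z)).mul_left ((p : ℂ) ^ (k - 1))
  simp only [coe_tpD_smul] at h
  let e : ℤ → ℤ := fun m => p * m
  have he : Function.Injective e := mul_right_injective₀ hp0
  have hrange : ∀ n : ℤ, n ∉ Set.range e →
      (((if (p : ℤ) ∣ n then c (n / p) else 0 : ℚ) : ℂ) * (p : ℂ) ^ (k - 1)) *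
        Complex.exp (2 * π * Complex.I * n * (z : ℂ)) = 0 := by
    intro n hn
    have : ¬ (p : ℤ) ∣ n := fun ⟨m, hm⟩ => hn ⟨m, hm.symm⟩
    simp [this]
  refine (he.hasSum_iff hrange).mp ?_
  have hfun : ((fun n : ℤ => (((if (p : ℤ) ∣ n then c (n / p) else 0 : ℚ) : ℂ) * (p : ℂ) ^ (k - 1)) *
      Complex.exp (2 * π * Complex.I * n * (z : ℂ))) ∘ e) =
      fun m : ℤ => (p : ℂ) ^ (k - 1) * ((c m : ℂ) * Complex.exp (2 * π * Complex.I * m * ((p : ℂ) * (z : ℂ)))) := by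
    funext m
    simp only [Function.comp_apply, e, dvd_mul_right, if_true, Int.mul_ediv_cancel_left _ hp0]
    push_cast
    ring_nf
  rw [hfun]
  exact h

/-- **`∑_{j mod p} f ∣ₖ (1 j; 0 p) = Σ c(pm) qᵐ`**: the `U_p`-part of `T_p` on a Fourier
expansion `Σ_{m ∈ ℤ} c(m) qᵐ` (orthogonality of the characters of `ℤ/pℤ`). [folklore] -/
theorem IsRatWeaklyHolomorphicForm.hasSum_sum_slash_tpB {N : ℕ} {k : ℤ} {f : ℍ → ℂ} {c : ℤ → ℚ}
    (hf : IsRatWeaklyHolomorphicForm N k f c) (hp : p.Prime) (z : ℍ) :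
    HasSum (fun n : ℤ => (c (p * n) : ℂ) * Complex.exp (2 * π * Complex.I * n * (z : ℂ)))
      ((∑ j : ZMod p, f ∣[k] tpB p (j.val : ℤ)) z) := by
  have hp0 : (p : ℂ) ≠ 0 := by exact_mod_cast hp.ne_zero
  have hp0' : (p : ℤ) ≠ 0 := by exact_mod_cast hp.ne_zero
  set E : ℤ → ℂ := fun m => Complex.exp (2 * π * Complex.I * m * (z : ℂ) / p) with hE
  -- each `f ∣ (1 j; 0 p)`
  have h1 : ∀ j : ZMod p, HasSum (fun m : ℤ =>
      (p : ℂ)⁻¹ * ((c m : ℂ) * (E m * (ζp p ^ m) ^ j.val))) ((f ∣[k] tpB p (j.val : ℤ)) z) := by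
    intro j
    rw [slash_tpB_apply]
    refine HasSum.mul_left _ ?_
    have h := hf.hasSum_fourier (tpB p (j.val : ℤ) • z)
    have hfun : (fun m : ℤ => (c m : ℂ) * (E m * (ζp p ^ m) ^ j.val)) =
        fun m : ℤ => (c m : ℂ) * Complex.exp (2 * π * Complex.I * m * ((tpB p (j.val : ℤ) • z : ℍ) : ℂ)) := by
      funext m
      rw [coe_tpB_smul, hE]
      simp only
      rw [← zpow_natCast, ← zpow_mul, ζp, ← Complex.exp_int_mul, ← Complex.exp_add]
      congr 2
      push_cast
      ring
    rw [hfun]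
    exact h
  -- sum over `j`
  have h3 : ∀ m : ℤ, ∑ j : ZMod p, (p : ℂ)⁻¹ * ((c m : ℂ) * (E m * (ζp p ^ m) ^ j.val)) =
      if (p : ℤ) ∣ m then (c m : ℂ) * E m else 0 := by
    intro m
    simp_rw [← mul_assoc]
    rw [← Finset.mul_sum, sum_zmod_ζp_zpow hp m]
    split_ifs
    · field_simp
    · rw [mul_zero]
  have h2 : HasSum (fun m : ℤ => if (p : ℤ) ∣ m then (c m : ℂ) * E m else 0)
      ((∑ j : ZMod p, f ∣[k] tpB p (j.val : ℤ)) z) := by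
    have := hasSum_sum fun j (_ : j ∈ Finset.univ) => h1 j
    rw [Finset.sum_apply]
    simpa only [h3] using this
  -- reindex `m = pn`
  let e : ℤ → ℤ := fun n => p * n
  have he : Function.Injective e := mul_right_injective₀ hp0'
  have hrange : ∀ m : ℤ, m ∉ Set.range e → (if (p : ℤ) ∣ m then (c m : ℂ) * E m else 0) = 0 := by
    intro m hm
    have : ¬ (p : ℤ) ∣ m := fun ⟨n, hn⟩ => hm ⟨n, hn.symm⟩
    simp [this]
  have h4 := (he.hasSum_iff hrange).mpr h2
  convert h4 using 1
  funext n
  simp only [Function.comp_apply, e, dvd_mul_right, if_true, hE]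
  congr 1
  push_cast
  field_simp

/-! ### `T_p` preserves `M^{!,∞}_k(Γ₀(N))` with rational coefficients (`p ∤ N`) -/

/-- Boundedness at `i∞` is preserved by composition with a map tending to `i∞`. [folklore] -/
theorem isBoundedAtImInfty_comp_of_tendsto {F : ℍ → ℂ} (hF : IsBoundedAtImInfty F) {g : ℍ → ℍ}
    (hg : Tendsto g atImInfty atImInfty) : IsBoundedAtImInfty (F ∘ g) :=
  hF.comp_tendsto hg

omit [NeZero p] in
/-- `(f ∣ₖ (a b; 0 d))(z) = |ad|^{k-1} d^{-k} f((az + b)/d)` is bounded at `i∞` when `f` is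
(`a, d > 0`). [folklore] -/
theorem isBoundedAtImInfty_slash_intGL_upper {k : ℤ} {f : ℍ → ℂ} (hf : IsBoundedAtImInfty f)
    {a b d : ℤ} (ha : 0 < a) (hd : 0 < d) :
    IsBoundedAtImInfty (f ∣[k] intGL !![a, b; 0, d]) := by
  have hdet : (!![a, b; 0, d] : Matrix (Fin 2) (Fin 2) ℤ).det ≠ 0 := by
    rw [Matrix.det_fin_two_of, mul_zero, sub_zero]; positivity
  have ha' : (0 : ℝ) < a := by exact_mod_cast ha
  have hd' : (0 : ℝ) < d := by exact_mod_cast hd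
  have hdetpos : 0 < (intGL !![a, b; 0, d]).det.val := by
    rw [val_det_intGL hdet, Matrix.det_fin_two_of]
    push_cast
    nlinarith [mul_pos ha' hd']
  -- the slash is a constant multiple of `f ∘ T`
  have hfun : f ∣[k] intGL !![a, b; 0, d] = fun z : ℍ =>
      (((|(a : ℝ) * d| : ℝ) : ℂ) ^ (k - 1) * ((d : ℂ) ^ (-k))) * f (intGL !![a, b; 0, d] • z) := by
    funext z
    rw [ModularForm.slash_apply,
      Literature.NumberTheory.EllipticCurves.ModularForms.σ_eq_self hdetpos,
      val_det_intGL hdet, denom_intGL hdet, Matrix.det_fin_two_of]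
    simp only [Matrix.of_apply, Matrix.cons_val', Matrix.cons_val_zero, Matrix.cons_val_one,
      Matrix.cons_val_fin_one, Int.cast_zero, zero_mul, zero_add, mul_zero, sub_zero]
    push_cast
    ring
  rw [hfun]
  exact (isBoundedAtImInfty_comp_of_tendsto hf
    (tendsto_intGL_upper_smul_atImInfty (b := b) ha hd)).const_mul_left _

/-- **The Hecke operators `T_p`, `p ∤ N` prime, preserve `M^{!,∞}_k(Γ₀(N))` with rational
coefficients.** For `f ∈ M^{!,∞}_k(Γ₀(N))` with rational Fourier coefficients `c(m)` at `∞`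
(`IsRatWeaklyHolomorphicForm N k f c`) and a prime `p ∤ N`,
`T_p f := ∑_{i ∈ I_p(N)} f ∣ₖ βᵢ = p^{k-1} f(pz) + p⁻¹ ∑_{j mod p} f((z+j)/p)`
(the representatives `βⱼ = (1 j; 0 p)`, `β_∞ = diag(p, 1)` of `Γ₀(N) \ Δ₀ᴺ(p)`,
Diamond–Shurman Prop. 5.2.1, through the tree's `heckeRep`/`HeckeIdx`) is again in
`M^{!,∞}_k(Γ₀(N))`, with rational coefficients `c'(n) = c(pn) + p^{k-1} c(n/p)` (`c(n/p) := 0`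
for `p ∤ n`): weight-`k` invariance by the independence of the transversal
(`sum_slash_eq_sum_slash_of_transversal`, `existsUnique_mem_delta0_mul_heckeRep`); holomorphy
at the cusps other than `∞` because for `σ ∉ Γ₀(N)` each `βᵢσ = γ (a b; 0 d)` has
`γ ∉ Γ₀(N)` (as `gcd(p, N) = 1`); the coefficients by the orthogonality of the characters of
`ℤ/pℤ`. In particular the hypothesis class of `GKZAlgebraicity` is stable under the Hecke
operators prime to the level. [folklore] -/
theorem IsRatWeaklyHolomorphicForm.hecke {N : ℕ} [NeZero N] {k : ℤ} {f : ℍ → ℂ} {c : ℤ → ℚ}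
    (hf : IsRatWeaklyHolomorphicForm N k f c) (hp : p.Prime) (hpN : ¬ p ∣ N) :
    IsRatWeaklyHolomorphicForm N k (∑ i : HeckeIdx N p, f ∣[k] intGL (heckeRep p i.1))
      (fun n => c (p * n) + if (p : ℤ) ∣ n then (p : ℚ) ^ (k - 1) * c (n / p) else 0) := by
  haveI : Fact p.Prime := ⟨hp⟩
  have hp0 : (p : ℤ) ≠ 0 := by exact_mod_cast hp.ne_zero
  -- the two pieces
  have hdecomp : (∑ i : HeckeIdx N p, f ∣[k] intGL (heckeRep p i.1)) =
      (∑ j : ZMod p, f ∣[k] tpB p (j.val : ℤ)) + f ∣[k] tpD p := by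
    rw [sum_heckeIdx N p fun i => f ∣[k] intGL (heckeRep p i), if_neg hpN]
    simp only [intGL_heckeRep_some, intGL_heckeRep_none]
  -- invariance under `Γ₀(N)`
  set Γ' : Subgroup (GL (Fin 2) ℝ) := ((Gamma0 N : Subgroup SL(2, ℤ)) : Subgroup (GL (Fin 2) ℝ))
    with hΓ'
  have hmemΓ' : ∀ {x : GL (Fin 2) ℝ}, x ∈ Γ' ↔ ∃ g : SL(2, ℤ), g ∈ Gamma0 N ∧ (g : GL (Fin 2) ℝ) = x :=
    fun {x} => Subgroup.mem_map
  have hf' : ∀ γ ∈ Γ', f ∣[k] γ = f := by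
    intro γ hγ
    obtain ⟨g, hg, rfl⟩ := hmemΓ'.mp hγ
    exact hf.slash_eq g hg
  have hslash : ∀ γ : SL(2, ℤ), γ ∈ Gamma0 N →
      (∑ i : HeckeIdx N p, f ∣[k] intGL (heckeRep p i.1)) ∣[k] (γ : GL (Fin 2) ℝ) =
        ∑ i : HeckeIdx N p, f ∣[k] intGL (heckeRep p i.1) := by
    intro γ hγ
    rw [SlashAction.sum_slash]
    simp_rw [← SlashAction.slash_mul]
    -- both `i ↦ βᵢ γ` and `i ↦ βᵢ` are exact transversals of `Γ₀(N) \ Δ₀ᴺ(p)`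
    have hγmat : (γ : Matrix (Fin 2) (Fin 2) ℤ) ∈ Delta0 N 1 := by
      have := (exists_mem_delta0_one_iff (N := N) (fun M => M = (γ : Matrix (Fin 2) (Fin 2) ℤ))).mpr
        ⟨γ, hγ, rfl⟩
      obtain ⟨M, hM, rfl⟩ := this
      exact hM
    have hγinvmat : ((γ⁻¹ : SL(2, ℤ)) : Matrix (Fin 2) (Fin 2) ℤ) ∈ Delta0 N 1 := by
      have := (exists_mem_delta0_one_iff (N := N)
        (fun M => M = ((γ⁻¹ : SL(2, ℤ)) : Matrix (Fin 2) (Fin 2) ℤ))).mpr ⟨γ⁻¹, inv_mem hγ, rfl⟩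
      obtain ⟨M, hM, rfl⟩ := this
      exact hM
    have hβS : ∀ i : HeckeIdx N p, intGL (heckeRep p i.1) ∈ intGL '' Delta0 N p :=
      fun i => ⟨_, heckeRep_mem_delta0 hp i, rfl⟩
    have hαS : ∀ i : HeckeIdx N p, intGL (heckeRep p i.1) * (γ : GL (Fin 2) ℝ) ∈ intGL '' Delta0 N p := by
      intro i
      refine ⟨heckeRep p i.1 * (γ : Matrix (Fin 2) (Fin 2) ℤ), ?_, ?_⟩
      · simpa using mul_mem_delta0 (heckeRep_mem_delta0 hp i) hγmat
      · rw [intGL_mul (det_heckeRep_ne_zero hp.ne_zero _) (by rw [γ.det_coe]; exact one_ne_zero),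
          ← mapGL_eq_intGL]
        rfl
    -- exactness for `βᵢ`
    have hβ' : ∀ x ∈ intGL '' Delta0 N p, ∃! i : HeckeIdx N p, x * (intGL (heckeRep p i.1))⁻¹ ∈ Γ' := by
      rintro x ⟨M, hM, rfl⟩
      have hMdet : M.det ≠ 0 := by rw [hM.1]; exact hp0
      have hM' : M ∈ Delta0 N (p * 1) := by rwa [mul_one]
      have huniq := existsUnique_mem_delta0_mul_heckeRep hp (D := 1)
        (by exact_mod_cast hp.not_dvd_one) hM'
      refine (existsUnique_congr fun i => ?_).mp huniq
      rw [intGL_mul_inv_mem_gamma0_iff hMdet (det_heckeRep_ne_zero hp.ne_zero _),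
        exists_mem_delta0_one_iff]
    have hα' : ∀ x ∈ intGL '' Delta0 N p,
        ∃! i : HeckeIdx N p, x * (intGL (heckeRep p i.1) * (γ : GL (Fin 2) ℝ))⁻¹ ∈ Γ' := by
      rintro x ⟨M, hM, rfl⟩
      have hMdet : M.det ≠ 0 := by rw [hM.1]; exact hp0
      -- `x γ⁻¹ ∈ S`
      have hx' : intGL M * (γ : GL (Fin 2) ℝ)⁻¹ ∈ intGL '' Delta0 N p := by
        refine ⟨M * ((γ⁻¹ : SL(2, ℤ)) : Matrix (Fin 2) (Fin 2) ℤ), ?_, ?_⟩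
        · simpa using mul_mem_delta0 hM hγinvmat
        · rw [intGL_mul hMdet (by rw [(γ⁻¹).det_coe]; exact one_ne_zero), ← mapGL_eq_intGL, map_inv]
          rfl
      refine (existsUnique_congr fun i => ?_).mp (hβ' _ hx')
      rw [mul_inv_rev, ← mul_assoc]
    exact sum_slash_eq_sum_slash_of_transversal hf' (intGL '' Delta0 N p) hαS hα' hβS hβ'
  -- holomorphy
  have hmd : MDiff (∑ i : HeckeIdx N p, f ∣[k] intGL (heckeRep p i.1)) := by
    rw [hdecomp]
    have h1 : ∀ j : ZMod p, MDiff (f ∣[k] tpB p (j.val : ℤ)) := by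
      intro j
      have : f ∣[k] tpB p (j.val : ℤ) = fun z => (p : ℂ)⁻¹ * f (tpB p (j.val : ℤ) • z) :=
        funext fun z => slash_tpB_apply p k f _ z
      rw [this]
      exact (mdifferentiable_comp_tpB_smul hf.mdifferentiable _).const_smul _
    have h2 : MDiff (f ∣[k] tpD p) := by
      have : f ∣[k] tpD p = fun z => (p : ℂ) ^ (k - 1) * f (tpD p • z) :=
        funext fun z => slash_tpD_apply p k f z
      rw [this, ← intGL_heckeRep_none]
      exact (mdifferentiable_comp_levelScale_smul hf.mdifferentiable (m := (p : ℤ))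
        (by exact_mod_cast hp.pos)).const_smul _
    have h1' : MDiff (∑ j : ZMod p, f ∣[k] tpB p (j.val : ℤ)) := by
      rw [UpperHalfPlane.mdifferentiable_iff]
      have : ((∑ j : ZMod p, f ∣[k] tpB p (j.val : ℤ)) ∘ ofComplex) =
          ∑ j : ZMod p, ((f ∣[k] tpB p (j.val : ℤ)) ∘ ofComplex) := by
        funext w
        simp [Finset.sum_apply]
      rw [this]
      exact DifferentiableOn.sum fun j _ => UpperHalfPlane.mdifferentiable_iff.mp (h1 j)
    exact h1'.add h2
  -- the Fourier expansion
  have hsum : ∀ z : ℍ, HasSum (fun n : ℤ =>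
      (((c (p * n) + if (p : ℤ) ∣ n then (p : ℚ) ^ (k - 1) * c (n / p) else 0 : ℚ)) : ℂ) *
        Complex.exp (2 * π * Complex.I * n * (z : ℂ)))
      ((∑ i : HeckeIdx N p, f ∣[k] intGL (heckeRep p i.1)) z) := by
    intro z
    rw [hdecomp, Pi.add_apply]
    have h := (hf.hasSum_sum_slash_tpB hp z).add (hf.hasSum_slash_tpD (p := p) z)
    have hfun : (fun n : ℤ => (c (p * n) : ℂ) * Complex.exp (2 * π * Complex.I * n * (z : ℂ)) +
        (((if (p : ℤ) ∣ n then c (n / p) else 0 : ℚ) : ℂ) * (p : ℂ) ^ (k - 1)) *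
          Complex.exp (2 * π * Complex.I * n * (z : ℂ))) =
        fun n : ℤ => (((c (p * n) + if (p : ℤ) ∣ n then (p : ℚ) ^ (k - 1) * c (n / p) else 0 : ℚ)) : ℂ) *
          Complex.exp (2 * π * Complex.I * n * (z : ℂ)) := by
      funext n
      split_ifs <;> push_cast <;> ring
    rw [hfun] at h
    exact h
  -- boundedness at the other cusps
  have hbdd : ∀ σ : SL(2, ℤ), σ ∉ Gamma0 N →
      IsBoundedAtImInfty ((∑ i : HeckeIdx N p, f ∣[k] intGL (heckeRep p i.1)) ∣[k] (σ : GL (Fin 2) ℝ)) := by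
    intro σ hσ
    rw [SlashAction.sum_slash]
    simp_rw [← SlashAction.slash_mul]
    -- each term is bounded
    have hterm : ∀ i : HeckeIdx N p,
        IsBoundedAtImInfty (f ∣[k] (intGL (heckeRep p i.1) * (σ : GL (Fin 2) ℝ))) := by
      intro i
      set M : Matrix (Fin 2) (Fin 2) ℤ := heckeRep p i.1 * (σ : Matrix (Fin 2) (Fin 2) ℤ) with hMdef
      have hMdet : M.det = p := by
        rw [hMdef, Matrix.det_mul, σ.det_coe, mul_one]
        exact Literature.NumberTheory.EllipticCurves.ModularForms.det_heckeRep p i.1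
      have hMmem : M ∈ heckeMatrices 1 (p : ℤ) := by
        rw [mem_heckeMatrices]
        exact ⟨hMdet, by simp⟩
      have hpp : (0 : ℤ) < p := by exact_mod_cast hp.pos
      obtain ⟨γ₁, -, a, b, d, ha, hd, -, -, had, h₃⟩ :=
        exists_gamma0_mul_eq_upper hpp hMmem isCoprime_one_right
      -- `M = γ₁⁻¹ (a b; 0 d)` in `GL(2, ℝ)`
      have hTdet : (!![a, b; 0, d] : Matrix (Fin 2) (Fin 2) ℤ).det ≠ 0 := by
        rw [Matrix.det_fin_two_of, mul_zero, sub_zero]; positivity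
      have hMdet0 : M.det ≠ 0 := by rw [hMdet]; exact hp0
      have hGL : intGL (heckeRep p i.1) * (σ : GL (Fin 2) ℝ) =
          ((γ₁⁻¹ : SL(2, ℤ)) : GL (Fin 2) ℝ) * intGL !![a, b; 0, d] := by
        have h1 : intGL M = intGL (heckeRep p i.1) * (σ : GL (Fin 2) ℝ) := by
          rw [hMdef, intGL_mul (det_heckeRep_ne_zero hp.ne_zero _) (by rw [σ.det_coe]; exact one_ne_zero),
            ← mapGL_eq_intGL]
          rfl
        have h2 : (γ₁ : GL (Fin 2) ℝ) * intGL M = intGL !![a, b; 0, d] := by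
          rw [← h₃, intGL_mul (by rw [γ₁.det_coe]; exact one_ne_zero) hMdet0, ← mapGL_eq_intGL]
          rfl
        rw [← h1, map_inv, map_inv]
        symm
        calc ((γ₁ : SL(2, ℤ)) : GL (Fin 2) ℝ)⁻¹ * intGL !![a, b; 0, d]
            = ((γ₁ : SL(2, ℤ)) : GL (Fin 2) ℝ)⁻¹ * (((γ₁ : SL(2, ℤ)) : GL (Fin 2) ℝ) * intGL M) := by
              rw [h2]
          _ = intGL M := by rw [← mul_assoc, inv_mul_cancel, one_mul]
      rw [hGL, SlashAction.slash_mul]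
      -- `γ₁⁻¹ ∉ Γ₀(N)`
      have hγ₁ : γ₁⁻¹ ∉ Gamma0 N := by
        intro hmem
        have hmem' : γ₁ ∈ Gamma0 N := by simpa using inv_mem hmem
        apply hσ
        -- `M₁₀ = -a (γ₁)₁₀` and `M₁₀ = (βᵢ)₁₁ σ₁₀`
        have e00 := congrFun (congrFun h₃ 0) 0
        have e10 := congrFun (congrFun h₃ 1) 0
        simp only [Matrix.mul_apply, Fin.sum_univ_two, Matrix.of_apply, Matrix.cons_val',
          Matrix.cons_val_zero, Matrix.cons_val_one, Matrix.cons_val_fin_one] at e00 e10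
        have hdet1 := γ₁.det_coe
        rw [Matrix.det_fin_two] at hdet1
        have hM10 : M 1 0 = -(a * (γ₁ : Matrix (Fin 2) (Fin 2) ℤ) 1 0) := by
          linear_combination ((γ₁ : Matrix (Fin 2) (Fin 2) ℤ) 0 0) * e10 -
            ((γ₁ : Matrix (Fin 2) (Fin 2) ℤ) 1 0) * e00 - (M 1 0) * hdet1
        have hNγ : (N : ℤ) ∣ (γ₁ : Matrix (Fin 2) (Fin 2) ℤ) 1 0 :=
          (ZMod.intCast_zmod_eq_zero_iff_dvd _ N).mp (Gamma0_mem.mp hmem')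
        have hNM : (N : ℤ) ∣ M 1 0 := by
          rw [hM10]
          exact (hNγ.mul_left a).neg_right
        -- `M₁₀ = (βᵢ)₁₁ σ₁₀`, `(βᵢ)₁₁ ∈ {p, 1}` coprime to `N`
        have hM10' : M 1 0 = (heckeRep p i.1) 1 1 * (σ : Matrix (Fin 2) (Fin 2) ℤ) 1 0 := by
          rw [hMdef]
          obtain ⟨_ | j, hi⟩ := i <;>
            simp [heckeRep, Matrix.mul_apply, Fin.sum_univ_two]
        have hcop : IsCoprime ((heckeRep p i.1) 1 1) (N : ℤ) := by
          obtain ⟨_ | j, hi⟩ := i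
          · simp only [heckeRep, Matrix.of_apply, Matrix.cons_val', Matrix.cons_val_one,
              Matrix.cons_val_fin_one]
            exact isCoprime_one_left
          · simp only [heckeRep, Matrix.of_apply, Matrix.cons_val', Matrix.cons_val_one,
              Matrix.cons_val_fin_one]
            exact Nat.isCoprime_iff_coprime.mpr ((Nat.Prime.coprime_iff_not_dvd hp).mpr hpN)
        rw [hM10'] at hNM
        have hNσ : (N : ℤ) ∣ (σ : Matrix (Fin 2) (Fin 2) ℤ) 1 0 := hcop.symm.dvd_of_dvd_mul_left hNM
        exact Gamma0_mem.mpr ((ZMod.intCast_zmod_eq_zero_iff_dvd _ N).mpr hNσ)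
      exact isBoundedAtImInfty_slash_intGL_upper (hf.isBoundedAtImInfty_slash γ₁⁻¹ hγ₁) ha hd
    -- sum of bounded functions
    have : ∀ s : Finset (HeckeIdx N p),
        IsBoundedAtImInfty (∑ i ∈ s, f ∣[k] (intGL (heckeRep p i.1) * (σ : GL (Fin 2) ℝ))) := by
      intro s
      induction s using Finset.induction_on with
      | empty => simpa using UpperHalfPlane.zero_form_isBoundedAtImInfty
      | insert i s hi ih =>
        rw [Finset.sum_insert hi]
        exact (hterm i).add ih
    exact this Finset.univ
  -- finite principal part
  obtain ⟨M, hM⟩ := hf.finite_principalPart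
  exact
    { mdifferentiable := hmd
      slash_eq := hslash
      finite_principalPart := ⟨p * M, fun n hn => by
        have hp1 : (1 : ℤ) ≤ p := by exact_mod_cast hp.one_lt.le
        have hM0 : (0 : ℤ) ≤ M := by positivity
        push_cast at hn
        have hn0 : n < 0 := by nlinarith
        have h1 : c (p * n) = 0 := hM _ (by nlinarith)
        have h2 : (if (p : ℤ) ∣ n then (p : ℚ) ^ (k - 1) * c (n / p) else 0) = 0 := by
          split_ifs with hdvd
          · obtain ⟨m, rfl⟩ := hdvd
            rw [Int.mul_ediv_cancel_left _ hp0,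
              hM m (lt_of_mul_lt_mul_left (by linarith) (by linarith : (0 : ℤ) ≤ p)), mul_zero]
          · rfl
        rw [h1, h2, add_zero]⟩
      hasSum_fourier := hsum
      isBoundedAtImInfty_slash := hbdd }

end Hecke

end Literature.NumberTheory.Automorphic
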